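/-
Copyright (c) 2026. All rights reserved.
Released under Apache 2.0 license as described in the file LICENSE.
-/
import Literature.Geometry.Kaehler.ComplexTorusQuaternionXSixAtkinLehnerQuotientsFibres
import HarnessLib

/-!
# The tower `X₆ → X₆^{(d)} → X₆⁺` over the special cycle `Z(t)`, second storey (every `t`, `d = 2, 3, 6`): a fibre of
# `Pt(t)/Γ₆^{(d)} → Pt(t)/Γ₆⁺` is `{[τ]_d, [ρ(w_{d′})τ]_d}` — ONE class exactly at the lifted fixed points of the two OTHER
# involutions: `Pt(3) ∪ Pt(6)` for `d = 2`, `Pt(1) ∪ Pt(6)` for `d = 3`, `Pt(1) ∪ Pt(3)` for `d = 6`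

[tag: complex_torus] [tag: abelian_surface] [tag: quaternion_multiplication] [tag: complex_multiplication]
[tag: shimura_curve] [tag: special_cycles] [tag: atkin_lehner] [tag: elliptic_points]

Lane `lit-hodgefound`, seat p12, row g38-#3 — THEOREMS ONLY (no definition, no named fact, no instance); the second half of
g38-#2 `…XSixAtkinLehnerQuotientsFibres` (the first storey `X₆ → X₆^{(d)}`: fibres `{[τ], [ρ(w_d)τ]}`, one class exactly at the
`Z(t_d)`-points). Setting as in all `…XSix…` files: `B = (−1,3)_ℚ`, `𝔬`, `O₆`, `Γ₆ = O₆¹`, `ρ`, `Pt(t)`, `Γ₆⁺ = N(O₆)⁺`,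
`Γ₆^{(d)} = {g ∈ Γ₆⁺ : nr g ∈ ℚ^{×2}·{1, d}}`, `w₂ = 1 + i`, `μ = w₃ = 3 + j + ij`, `w₆ = w₂μ`; the projections are `Quot.factor`
along `Γ₆ ⊂ Γ₆^{(d)} ⊂ Γ₆⁺`, fibres are inline subtypes, `[τ] ↦ [ρ(w)τ]` is written on representatives `⟨ρ(w)τ, _⟩`.

## The mechanism (the print)

`W = Γ₆⁺/ℚ^×Γ₆ = {1, ω₂, ω₃, ω₆} ≅ (ℤ/2ℤ)²` acts on `Pt(t)/Γ₆` with `Pt(t)/Γ₆⁺ = (Pt(t)/Γ₆)/W` and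
`Pt(t)/Γ₆^{(d)} = (Pt(t)/Γ₆)/⟨ω_d⟩` (Bayer–Travesa: «`X₆^{(2)} = X₆/⟨ω₂⟩, X₆^{(3)} = X₆/⟨ω₃⟩, X₆^{(6)} = X₆/⟨ω₆⟩` and `X₆⁺ = X₆/W`»;
KRY Remark 3.4.7). So the fibre of `X₆ → X₆⁺` through `[τ]` is the `W`-orbit `{[τ], ω₂[τ], ω₃[τ], ω₆[τ]}`, the fibre of
`X₆^{(d)} → X₆⁺` through `[τ]_d` is the `W/⟨ω_d⟩ ≅ ℤ/2ℤ`-orbit `{[τ]_d, ω_{d′}[τ]_d}`, and it is a single class iff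
`ω_{d′}[τ] ∈ {[τ], ω_d[τ]}`, i.e. iff `τ` is a lifted fixed point of `ω_{d′}` or of `ω_dω_{d′} = ω_{d″}` — iff
`τ ∈ Pt(t_{d′}) ∪ Pt(t_{d″})`, `{d, d′, d″} = {2, 3, 6}`, `t₂ = 1`, `t₃ = 3`, `t₆ = 6` (Ogg's fixed points of `w(m)`). In
Bayer–Travesa's words (§7): «`P₀` is an elliptic point for `X₆^{(6)}` and `X₆⁺`, but it is not elliptic for `X₆`, `X₆^{(2)}` and
`X₆^{(3)}`» — the cover `X₆^{(d)} → X₆⁺` ramifies over the images of the fixed points of the two other involutions.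

* P. Bayer, A. Travesa (2007), §2 p. 318, §7 p. 332 and Table 9. [cite: BayerTravesa2007, §2 p. 318 and §7]
* A. P. Ogg (1983), §2 pp. 283–284, (2)–(4). [cite: Ogg1983RealPoints, §2]
* S. Kudla, M. Rapoport, T. Yang (2006), §3.4 (3.4.9)–(3.4.11) and Remark 3.4.7. [cite: KudlaRapoportYang2006, §3.4]
* M.-F. Vignéras (1980), Ch. IV §3 B. [cite: VignerasLNM800, Ch. IV §3 B]

## What is proved

* §1 **`factor_mk_eq_mk_iff_specialPointsPlus`**: the fibre of `Pt(t)/Γ₆ → Pt(t)/Γ₆⁺` through `[τ]` is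
  `{[τ], [ρ(w₂)τ], [ρ(μ)τ], [ρ(w₂)ρ(μ)τ]}` (the orbit-level form of `…XSixSpecialPointsFibres`).
* §2 for `d = 2, 3, 6`: **`factorPlus_mk_eq_mk_iff_atkinLehnerQuotient{Two,Three,Six}`** (the fibre through `[τ]_d` is
  `{[τ]_d, [ρ(w_{d′})τ]_d}` with `w_{2′} = μ`, `w_{3′} = w_{6′} = w₂`), **`card_plusFibre_atkinLehnerQuotientTwo_eq_one_iff`**
  (`⟺ τ ∈ Pt(3) ∪ Pt(6)`), **`…Three_eq_one_iff`** (`⟺ τ ∈ Pt(1) ∪ Pt(6)`), **`…Six_eq_one_iff`** (`⟺ τ ∈ Pt(1) ∪ Pt(3)`),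
  **`…_eq_two_iff`**, **`…_eq_one_or_eq_two`** (double covers), and the class equations
  **`card_atkinLehnerQuotient{Two,Three,Six}_add_card_onePlusFibres_eq_two_mul_card_specialPointsPlus`**
  (`#(Pt(t)/Γ₆^{(d)}) + #{one-class fibres} = 2·#(Pt(t)/Γ₆⁺)`, `t > 0`).

## Honest scope

Statements about the bare quotient TYPES and `Quot.factor` maps of the `…XSix…` files; nothing identifies them with points
of algebraic models of `X₆^{(d)}`, `X₆⁺` or names Bayer–Travesa's `P₀, …`; genera and Riemann–Hurwitz are not touched.
0 definitions, 0 named facts, 0 instances — net debt `0`.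
-/

noncomputable section

set_option maxSynthPendingDepth 3

open Quaternion Function

namespace Literature.Geometry.Kaehler.ComplexTorus.QuaternionType

/-! ## §0 Helpers -/

section Helpers

/-- A subtype cut out by `b = x ∨ b = y` with `y = x` has one element. [folklore] -/
private theorem card_eq_one_of_iff_eq_or_eq₂₂ {Q : Type*} {F : Q → Prop} {x y : Q} (hF : ∀ b, F b ↔ b = x ∨ b = y)
    (h : y = x) : Nat.card {b // F b} = 1 := by
  rw [Nat.card_eq_one_iff_unique]
  refine ⟨⟨fun a b ↦ Subtype.ext ?_⟩, ⟨⟨x, (hF x).2 (Or.inl rfl)⟩⟩⟩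
  have ha := (hF a.1).1 a.2
  have hb := (hF b.1).1 b.2
  rw [h, or_self] at ha hb
  rw [ha, hb]

/-- A subtype cut out by `b = x ∨ b = y` with `y ≠ x` has two elements. [folklore] -/
private theorem card_eq_two_of_iff_eq_or_eq₂₂ {Q : Type*} {F : Q → Prop} {x y : Q} (hF : ∀ b, F b ↔ b = x ∨ b = y)
    (h : y ≠ x) : Nat.card {b // F b} = 2 := by
  rw [Nat.card_eq_two_iff]
  refine ⟨⟨x, (hF x).2 (Or.inl rfl)⟩, ⟨y, (hF y).2 (Or.inr rfl)⟩, fun e ↦ h (congrArg Subtype.val e).symm, ?_⟩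
  rw [Set.eq_univ_iff_forall]
  rintro ⟨b, hb⟩
  simp only [Set.mem_insert_iff, Set.mem_singleton_iff, Subtype.mk.injEq]
  exact (hF b).1 hb

/-- … so it has one or two elements, one iff `y = x`, two iff `y ≠ x`. [folklore] -/
private theorem card_eq_one_iff_of_iff_eq_or_eq₂₂ {Q : Type*} {F : Q → Prop} {x y : Q} (hF : ∀ b, F b ↔ b = x ∨ b = y) :
    (Nat.card {b // F b} = 1 ↔ y = x) ∧ (Nat.card {b // F b} = 2 ↔ y ≠ x) ∧
    (Nat.card {b // F b} = 1 ∨ Nat.card {b // F b} = 2) := by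
  by_cases h : y = x
  · have h1 := card_eq_one_of_iff_eq_or_eq₂₂ hF h
    exact ⟨⟨fun _ ↦ h, fun _ ↦ h1⟩, ⟨fun h2 ↦ by omega, fun hne ↦ absurd h hne⟩, Or.inl h1⟩
  · have h2 := card_eq_two_of_iff_eq_or_eq₂₂ hF h
    exact ⟨⟨fun h1 ↦ by omega, fun he ↦ absurd he h⟩, ⟨fun _ ↦ h, fun _ ↦ h2⟩, Or.inr h2⟩

/-- **Fibres of size `1` or `2`**: `|Q| + #{c : |f⁻¹(c)| = 1} = 2·|Q'|`. [folklore] -/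
private theorem card_add_card_eq_two_mul₂₂ {Q Q' : Type*} [Finite Q] [Finite Q'] (f : Q → Q')
    (h12 : ∀ c, Nat.card {a // f a = c} = 1 ∨ Nat.card {a // f a = c} = 2) :
    Nat.card Q + Nat.card {c // Nat.card {a // f a = c} = 1} = 2 * Nat.card Q' := by
  classical
  letI := Fintype.ofFinite Q'
  have hsig : Nat.card Q = ∑ c, Nat.card {a // f a = c} := by
    rw [← Nat.card_congr (Equiv.sigmaFiberEquiv f), Nat.card_sigma]
  have hc : ∀ c, Nat.card {a // f a = c} + (if Nat.card {a // f a = c} = 1 then 1 else 0) = 2 := by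
    intro c
    rcases h12 c with h | h <;> simp [h]
  have hs := Finset.sum_congr rfl (fun c (_ : c ∈ (Finset.univ : Finset Q')) ↦ hc c)
  rw [Finset.sum_add_distrib] at hs
  simp only [Finset.sum_boole, Nat.cast_id, Finset.sum_const, smul_eq_mul, Finset.card_univ] at hs
  rw [← hsig, ← Fintype.card_subtype, ← Nat.card_eq_fintype_card, ← Nat.card_eq_fintype_card] at hs
  omega

/-- `nr w₂ = 2`. [folklore] -/
private theorem norm_w2₂₂ : ((⟨1, 1, 0, 0⟩ : ℍ[ℚ,((-1 : ℤ) : ℚ),((3 : ℤ) : ℚ)]) * star ⟨1, 1, 0, 0⟩).re = 2 := by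
  rw [QuaternionAlgebra.star_mk, QuaternionAlgebra.mk_mul_mk]; norm_num

/-- `nr μ = 3`. [folklore] -/
private theorem norm_mu₂₂ : ((⟨3, 0, 1, 1⟩ : ℍ[ℚ,((-1 : ℤ) : ℚ),((3 : ℤ) : ℚ)]) * star ⟨3, 0, 1, 1⟩).re = 3 := by
  rw [QuaternionAlgebra.star_mk, QuaternionAlgebra.mk_mul_mk]; norm_num

/-- `w₂, μ` normalise `O₆` on the left. [folklore] -/
private theorem normalises_w2_mu₂₂ :
    (∀ a : ℍ[ℚ,((-1 : ℤ) : ℚ),((3 : ℤ) : ℚ)], (a ∈ order (-1) 3 ∨ a - ⟨1/2, 1/2, 1/2, -1/2⟩ ∈ order (-1) 3) →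
      ∃ b : ℍ[ℚ,((-1 : ℤ) : ℚ),((3 : ℤ) : ℚ)], (b ∈ order (-1) 3 ∨ b - ⟨1/2, 1/2, 1/2, -1/2⟩ ∈ order (-1) 3) ∧ (⟨1, 1, 0, 0⟩ : ℍ[ℚ,((-1 : ℤ) : ℚ),((3 : ℤ) : ℚ)]) * a = b * (⟨1, 1, 0, 0⟩ : ℍ[ℚ,((-1 : ℤ) : ℚ),((3 : ℤ) : ℚ)])) ∧
    (∀ a : ℍ[ℚ,((-1 : ℤ) : ℚ),((3 : ℤ) : ℚ)], (a ∈ order (-1) 3 ∨ a - ⟨1/2, 1/2, 1/2, -1/2⟩ ∈ order (-1) 3) →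
      ∃ b : ℍ[ℚ,((-1 : ℤ) : ℚ),((3 : ℤ) : ℚ)], (b ∈ order (-1) 3 ∨ b - ⟨1/2, 1/2, 1/2, -1/2⟩ ∈ order (-1) 3) ∧ (⟨3, 0, 1, 1⟩ : ℍ[ℚ,((-1 : ℤ) : ℚ),((3 : ℤ) : ℚ)]) * a = b * (⟨3, 0, 1, 1⟩ : ℍ[ℚ,((-1 : ℤ) : ℚ),((3 : ℤ) : ℚ)])) := by
  have h1O : ((1 : ℍ[ℚ,((-1 : ℤ) : ℚ),((3 : ℤ) : ℚ)]) ∈ order (-1) 3 ∨ (1 : ℍ[ℚ,((-1 : ℤ) : ℚ),((3 : ℤ) : ℚ)]) - ⟨1/2, 1/2, 1/2, -1/2⟩ ∈ order (-1) 3) := Or.inl (Subring.one_mem _)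
  have h11 : (1 : ℍ[ℚ,((-1 : ℤ) : ℚ),((3 : ℤ) : ℚ)]) * star 1 = 1 := by rw [star_one, mul_one]
  have h2 := (normOne_mul_word_normalises h1O h11 1 0).2.1
  have h3 := (normOne_mul_word_normalises h1O h11 0 1).2.1
  simp only [pow_one, pow_zero, mul_one, one_mul] at h2 h3
  exact ⟨h2, h3⟩

end Helpers

/-! ## §1 The fibre of `Pt(t)/Γ₆ → Pt(t)/Γ₆⁺` through `[τ]`: the `W`-orbit -/

section Orbit

/-- **THE FIBRE OF `X₆ → X₆⁺` THROUGH `[τ]` ON `Z(t)` IS THE `W`-ORBIT `{[τ], [ρ(w₂)τ], [ρ(μ)τ], [ρ(w₂)ρ(μ)τ]}`**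
(`Γ₆⁺ = ℚ_{>0}Γ₆{1, w₂, μ, w₂μ}`; the orbit-level form of `…XSixSpecialPointsFibres`). [cite: BayerTravesa2007, §2 p. 318 («`Γ₆⁺/Γ₆ ≅ (ℤ/2ℤ)²` … `X₆⁺ = X₆/W`»)] [cite: KudlaRapoportYang2006, §3.4 Remark 3.4.7] [cite: VignerasLNM800, Ch. IV §3 B] -/
theorem factor_mk_eq_mk_iff_specialPointsPlus {t : ℤ} (p' p : {τ : ℂ // 0 < τ.im ∧ ∃ x : ℍ[ℚ,((-1 : ℤ) : ℚ),((3 : ℤ) : ℚ)],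
        x ∈ order (-1) 3 ∧ x.re = 0 ∧ (x * star x).re = t ∧ moebius (rho (-1) 3 (by norm_num) (castQ (-1) 3 x)) τ = τ}) :
    Quot.factor (fun p q : {τ : ℂ // 0 < τ.im ∧ ∃ x : ℍ[ℚ,((-1 : ℤ) : ℚ),((3 : ℤ) : ℚ)],
        x ∈ order (-1) 3 ∧ x.re = 0 ∧ (x * star x).re = t ∧ moebius (rho (-1) 3 (by norm_num) (castQ (-1) 3 x)) τ = τ} ↦
      ∃ v : ℍ[ℚ,((-1 : ℤ) : ℚ),((3 : ℤ) : ℚ)], (v ∈ order (-1) 3 ∨ v - ⟨1/2, 1/2, 1/2, -1/2⟩ ∈ order (-1) 3) ∧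
        v * star v = 1 ∧ moebius (rho (-1) 3 (by norm_num) (castQ (-1) 3 v)) p.1 = q.1)
      (fun p q : {τ : ℂ // 0 < τ.im ∧ ∃ x : ℍ[ℚ,((-1 : ℤ) : ℚ),((3 : ℤ) : ℚ)],
        x ∈ order (-1) 3 ∧ x.re = 0 ∧ (x * star x).re = t ∧ moebius (rho (-1) 3 (by norm_num) (castQ (-1) 3 x)) τ = τ} ↦
      ∃ g : ℍ[ℚ,((-1 : ℤ) : ℚ),((3 : ℤ) : ℚ)], g ≠ 0 ∧
        (∀ a : ℍ[ℚ,((-1 : ℤ) : ℚ),((3 : ℤ) : ℚ)], (a ∈ order (-1) 3 ∨ a - ⟨1/2, 1/2, 1/2, -1/2⟩ ∈ order (-1) 3) →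
          ∃ b : ℍ[ℚ,((-1 : ℤ) : ℚ),((3 : ℤ) : ℚ)], (b ∈ order (-1) 3 ∨ b - ⟨1/2, 1/2, 1/2, -1/2⟩ ∈ order (-1) 3) ∧
            g * a = b * g) ∧
        0 < (g * star g).re ∧ moebius (rho (-1) 3 (by norm_num) (castQ (-1) 3 g)) p.1 = q.1)
      (specialPointsPlus_rel_of_specialPoints_rel t) (Quot.mk _ p') = Quot.mk _ p ↔
    (Quot.mk (fun p q : {τ : ℂ // 0 < τ.im ∧ ∃ x : ℍ[ℚ,((-1 : ℤ) : ℚ),((3 : ℤ) : ℚ)],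
        x ∈ order (-1) 3 ∧ x.re = 0 ∧ (x * star x).re = t ∧ moebius (rho (-1) 3 (by norm_num) (castQ (-1) 3 x)) τ = τ} ↦
      ∃ v : ℍ[ℚ,((-1 : ℤ) : ℚ),((3 : ℤ) : ℚ)], (v ∈ order (-1) 3 ∨ v - ⟨1/2, 1/2, 1/2, -1/2⟩ ∈ order (-1) 3) ∧
        v * star v = 1 ∧ moebius (rho (-1) 3 (by norm_num) (castQ (-1) 3 v)) p.1 = q.1) p' = Quot.mk _ p ∨
      Quot.mk (fun p q : {τ : ℂ // 0 < τ.im ∧ ∃ x : ℍ[ℚ,((-1 : ℤ) : ℚ),((3 : ℤ) : ℚ)],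
        x ∈ order (-1) 3 ∧ x.re = 0 ∧ (x * star x).re = t ∧ moebius (rho (-1) 3 (by norm_num) (castQ (-1) 3 x)) τ = τ} ↦
      ∃ v : ℍ[ℚ,((-1 : ℤ) : ℚ),((3 : ℤ) : ℚ)], (v ∈ order (-1) 3 ∨ v - ⟨1/2, 1/2, 1/2, -1/2⟩ ∈ order (-1) 3) ∧
        v * star v = 1 ∧ moebius (rho (-1) 3 (by norm_num) (castQ (-1) 3 v)) p.1 = q.1) p' = Quot.mk _ (⟨moebius (rho (-1) 3 (by norm_num) (castQ (-1) 3 (⟨1, 1, 0, 0⟩ : ℍ[ℚ,((-1 : ℤ) : ℚ),((3 : ℤ) : ℚ)]))) p.1, moebius_w2_mem_specialPoints p.2.1 p.2.2⟩ : {τ : ℂ // 0 < τ.im ∧ ∃ x : ℍ[ℚ,((-1 : ℤ) : ℚ),((3 : ℤ) : ℚ)],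
        x ∈ order (-1) 3 ∧ x.re = 0 ∧ (x * star x).re = t ∧ moebius (rho (-1) 3 (by norm_num) (castQ (-1) 3 x)) τ = τ}) ∨
      Quot.mk (fun p q : {τ : ℂ // 0 < τ.im ∧ ∃ x : ℍ[ℚ,((-1 : ℤ) : ℚ),((3 : ℤ) : ℚ)],
        x ∈ order (-1) 3 ∧ x.re = 0 ∧ (x * star x).re = t ∧ moebius (rho (-1) 3 (by norm_num) (castQ (-1) 3 x)) τ = τ} ↦
      ∃ v : ℍ[ℚ,((-1 : ℤ) : ℚ),((3 : ℤ) : ℚ)], (v ∈ order (-1) 3 ∨ v - ⟨1/2, 1/2, 1/2, -1/2⟩ ∈ order (-1) 3) ∧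
        v * star v = 1 ∧ moebius (rho (-1) 3 (by norm_num) (castQ (-1) 3 v)) p.1 = q.1) p' = Quot.mk _ (⟨moebius (rho (-1) 3 (by norm_num) (castQ (-1) 3 (⟨3, 0, 1, 1⟩ : ℍ[ℚ,((-1 : ℤ) : ℚ),((3 : ℤ) : ℚ)]))) p.1, moebius_mu_mem_specialPoints p.2.1 p.2.2⟩ : {τ : ℂ // 0 < τ.im ∧ ∃ x : ℍ[ℚ,((-1 : ℤ) : ℚ),((3 : ℤ) : ℚ)],
        x ∈ order (-1) 3 ∧ x.re = 0 ∧ (x * star x).re = t ∧ moebius (rho (-1) 3 (by norm_num) (castQ (-1) 3 x)) τ = τ}) ∨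
      Quot.mk (fun p q : {τ : ℂ // 0 < τ.im ∧ ∃ x : ℍ[ℚ,((-1 : ℤ) : ℚ),((3 : ℤ) : ℚ)],
        x ∈ order (-1) 3 ∧ x.re = 0 ∧ (x * star x).re = t ∧ moebius (rho (-1) 3 (by norm_num) (castQ (-1) 3 x)) τ = τ} ↦
      ∃ v : ℍ[ℚ,((-1 : ℤ) : ℚ),((3 : ℤ) : ℚ)], (v ∈ order (-1) 3 ∨ v - ⟨1/2, 1/2, 1/2, -1/2⟩ ∈ order (-1) 3) ∧
        v * star v = 1 ∧ moebius (rho (-1) 3 (by norm_num) (castQ (-1) 3 v)) p.1 = q.1) p' = Quot.mk _ (⟨moebius (rho (-1) 3 (by norm_num) (castQ (-1) 3 (⟨1, 1, 0, 0⟩ : ℍ[ℚ,((-1 : ℤ) : ℚ),((3 : ℤ) : ℚ)]))) (⟨moebius (rho (-1) 3 (by norm_num) (castQ (-1) 3 (⟨3, 0, 1, 1⟩ : ℍ[ℚ,((-1 : ℤ) : ℚ),((3 : ℤ) : ℚ)]))) p.1, moebius_mu_mem_specialPoints p.2.1 p.2.2⟩ : {τ : ℂ // 0 < τ.im ∧ ∃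 x : ℍ[ℚ,((-1 : ℤ) : ℚ),((3 : ℤ) : ℚ)],
        x ∈ order (-1) 3 ∧ x.re = 0 ∧ (x * star x).re = t ∧ moebius (rho (-1) 3 (by norm_num) (castQ (-1) 3 x)) τ = τ}).1, moebius_w2_mem_specialPoints (⟨moebius (rho (-1) 3 (by norm_num) (castQ (-1) 3 (⟨3, 0, 1, 1⟩ : ℍ[ℚ,((-1 : ℤ) : ℚ),((3 : ℤ) : ℚ)]))) p.1, moebius_mu_mem_specialPoints p.2.1 p.2.2⟩ : {τ : ℂ // 0 < τ.im ∧ ∃ x : ℍ[ℚ,((-1 : ℤ) : ℚ),((3 : ℤ) : ℚ)],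
        x ∈ order (-1) 3 ∧ x.re = 0 ∧ (x * star x).re = t ∧ moebius (rho (-1) 3 (by norm_num) (castQ (-1) 3 x)) τ = τ}).2.1 (⟨moebius (rho (-1) 3 (by norm_num) (castQ (-1) 3 (⟨3, 0, 1, 1⟩ : ℍ[ℚ,((-1 : ℤ) : ℚ),((3 : ℤ) : ℚ)]))) p.1, moebius_mu_mem_specialPoints p.2.1 p.2.2⟩ : {τ : ℂ // 0 < τ.im ∧ ∃ x : ℍ[ℚ,((-1 : ℤ) : ℚ),((3 : ℤ) : ℚ)],
        x ∈ order (-1) 3 ∧ x.re = 0 ∧ (x * star x).re = t ∧ moebius (rho (-1) 3 (by norm_num) (castQ (-1) 3 x)) τ = τ}).2.2⟩ : {τ : ℂ // 0 < τ.im ∧ ∃ x : ℍ[ℚ,((-1 : ℤ) : ℚ),((3 : ℤ) : ℚ)],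
        x ∈ order (-1) 3 ∧ x.re = 0 ∧ (x * star x).re = t ∧ moebius (rho (-1) 3 (by norm_num) (castQ (-1) 3 x)) τ = τ})) := by
  have hiff := specialPoints_mk_eq_iff t
  have hiffP := specialPointsPlus_mk_eq_iff t
  have hEP := specialPointsPlus_equivalence t
  have hSP := specialPointsPlus_rel_of_specialPoints_rel t
  obtain ⟨hN2, hN3⟩ := normalises_w2_mu₂₂
  have hw0 : (⟨1, 1, 0, 0⟩ : ℍ[ℚ,((-1 : ℤ) : ℚ),((3 : ℤ) : ℚ)]) ≠ 0 := fun h ↦ by simpa using congrArg QuaternionAlgebra.re h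
  have hm0 : (⟨3, 0, 1, 1⟩ : ℍ[ℚ,((-1 : ℤ) : ℚ),((3 : ℤ) : ℚ)]) ≠ 0 := fun h ↦ by simpa using congrArg QuaternionAlgebra.re h
  -- `P p (ρ(w₂)p)`, `P p (ρ(μ)p)` for every `p`
  have PM : ∀ r : {τ : ℂ // 0 < τ.im ∧ ∃ x : ℍ[ℚ,((-1 : ℤ) : ℚ),((3 : ℤ) : ℚ)],
        x ∈ order (-1) 3 ∧ x.re = 0 ∧ (x * star x).re = t ∧ moebius (rho (-1) 3 (by norm_num) (castQ (-1) 3 x)) τ = τ}, Quot.mk (fun p q : {τ : ℂ // 0 < τ.im ∧ ∃ x : ℍ[ℚ,((-1 : ℤ) : ℚ),((3 : ℤ) : ℚ)],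
        x ∈ order (-1) 3 ∧ x.re = 0 ∧ (x * star x).re = t ∧ moebius (rho (-1) 3 (by norm_num) (castQ (-1) 3 x)) τ = τ} ↦
      ∃ g : ℍ[ℚ,((-1 : ℤ) : ℚ),((3 : ℤ) : ℚ)], g ≠ 0 ∧
        (∀ a : ℍ[ℚ,((-1 : ℤ) : ℚ),((3 : ℤ) : ℚ)], (a ∈ order (-1) 3 ∨ a - ⟨1/2, 1/2, 1/2, -1/2⟩ ∈ order (-1) 3) →
          ∃ b : ℍ[ℚ,((-1 : ℤ) : ℚ),((3 : ℤ) : ℚ)], (b ∈ order (-1) 3 ∨ b - ⟨1/2, 1/2, 1/2, -1/2⟩ ∈ order (-1) 3) ∧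
            g * a = b * g) ∧
        0 < (g * star g).re ∧ moebius (rho (-1) 3 (by norm_num) (castQ (-1) 3 g)) p.1 = q.1) r = Quot.mk _ (⟨moebius (rho (-1) 3 (by norm_num) (castQ (-1) 3 (⟨1, 1, 0, 0⟩ : ℍ[ℚ,((-1 : ℤ) : ℚ),((3 : ℤ) : ℚ)]))) r.1, moebius_w2_mem_specialPoints r.2.1 r.2.2⟩ : {τ : ℂ // 0 < τ.im ∧ ∃ x : ℍ[ℚ,((-1 : ℤ) : ℚ),((3 : ℤ) : ℚ)],
        x ∈ order (-1) 3 ∧ x.re = 0 ∧ (x * star x).re = t ∧ moebius (rho (-1) 3 (by norm_num) (castQ (-1) 3 x)) τ = τ}) := fun r ↦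
    (hiffP _ _).2 (specialPointsPlus_rel_of_moebius_eq hw0 (by rw [norm_w2₂₂]; norm_num) hN2 r (⟨moebius (rho (-1) 3 (by norm_num) (castQ (-1) 3 (⟨1, 1, 0, 0⟩ : ℍ[ℚ,((-1 : ℤ) : ℚ),((3 : ℤ) : ℚ)]))) r.1, moebius_w2_mem_specialPoints r.2.1 r.2.2⟩ : {τ : ℂ // 0 < τ.im ∧ ∃ x : ℍ[ℚ,((-1 : ℤ) : ℚ),((3 : ℤ) : ℚ)],
        x ∈ order (-1) 3 ∧ x.re = 0 ∧ (x * star x).re = t ∧ moebius (rho (-1) 3 (by norm_num) (castQ (-1) 3 x)) τ = τ}) rfl)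
  have PA : ∀ r : {τ : ℂ // 0 < τ.im ∧ ∃ x : ℍ[ℚ,((-1 : ℤ) : ℚ),((3 : ℤ) : ℚ)],
        x ∈ order (-1) 3 ∧ x.re = 0 ∧ (x * star x).re = t ∧ moebius (rho (-1) 3 (by norm_num) (castQ (-1) 3 x)) τ = τ}, Quot.mk (fun p q : {τ : ℂ // 0 < τ.im ∧ ∃ x : ℍ[ℚ,((-1 : ℤ) : ℚ),((3 : ℤ) : ℚ)],
        x ∈ order (-1) 3 ∧ x.re = 0 ∧ (x * star x).re = t ∧ moebius (rho (-1) 3 (by norm_num) (castQ (-1) 3 x)) τ = τ} ↦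
      ∃ g : ℍ[ℚ,((-1 : ℤ) : ℚ),((3 : ℤ) : ℚ)], g ≠ 0 ∧
        (∀ a : ℍ[ℚ,((-1 : ℤ) : ℚ),((3 : ℤ) : ℚ)], (a ∈ order (-1) 3 ∨ a - ⟨1/2, 1/2, 1/2, -1/2⟩ ∈ order (-1) 3) →
          ∃ b : ℍ[ℚ,((-1 : ℤ) : ℚ),((3 : ℤ) : ℚ)], (b ∈ order (-1) 3 ∨ b - ⟨1/2, 1/2, 1/2, -1/2⟩ ∈ order (-1) 3) ∧
            g * a = b * g) ∧
        0 < (g * star g).re ∧ moebius (rho (-1) 3 (by norm_num) (castQ (-1) 3 g)) p.1 = q.1) r = Quot.mk _ (⟨moebius (rho (-1) 3 (by norm_num) (castQ (-1) 3 (⟨3, 0, 1, 1⟩ : ℍ[ℚ,((-1 : ℤ) : ℚ),((3 : ℤ) : ℚ)]))) r.1, moebius_mu_mem_specialPoints r.2.1 r.2.2⟩ : {τ : ℂ // 0 < τ.im ∧ ∃ x : ℍ[ℚ,((-1 : ℤ) : ℚ),((3 : ℤ) : ℚ)],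
        x ∈ order (-1) 3 ∧ x.re = 0 ∧ (x * star x).re = t ∧ moebius (rho (-1) 3 (by norm_num) (castQ (-1) 3 x)) τ = τ}) := fun r ↦
    (hiffP _ _).2 (specialPointsPlus_rel_of_moebius_eq hm0 (by rw [norm_mu₂₂]; norm_num) hN3 r (⟨moebius (rho (-1) 3 (by norm_num) (castQ (-1) 3 (⟨3, 0, 1, 1⟩ : ℍ[ℚ,((-1 : ℤ) : ℚ),((3 : ℤ) : ℚ)]))) r.1, moebius_mu_mem_specialPoints r.2.1 r.2.2⟩ : {τ : ℂ // 0 < τ.im ∧ ∃ x : ℍ[ℚ,((-1 : ℤ) : ℚ),((3 : ℤ) : ℚ)],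
        x ∈ order (-1) 3 ∧ x.re = 0 ∧ (x * star x).re = t ∧ moebius (rho (-1) 3 (by norm_num) (castQ (-1) 3 x)) τ = τ}) rfl)
  have PS : ∀ r r' : {τ : ℂ // 0 < τ.im ∧ ∃ x : ℍ[ℚ,((-1 : ℤ) : ℚ),((3 : ℤ) : ℚ)],
        x ∈ order (-1) 3 ∧ x.re = 0 ∧ (x * star x).re = t ∧ moebius (rho (-1) 3 (by norm_num) (castQ (-1) 3 x)) τ = τ}, Quot.mk (fun p q : {τ : ℂ // 0 < τ.im ∧ ∃ x : ℍ[ℚ,((-1 : ℤ) : ℚ),((3 : ℤ) : ℚ)],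
        x ∈ order (-1) 3 ∧ x.re = 0 ∧ (x * star x).re = t ∧ moebius (rho (-1) 3 (by norm_num) (castQ (-1) 3 x)) τ = τ} ↦
      ∃ v : ℍ[ℚ,((-1 : ℤ) : ℚ),((3 : ℤ) : ℚ)], (v ∈ order (-1) 3 ∨ v - ⟨1/2, 1/2, 1/2, -1/2⟩ ∈ order (-1) 3) ∧
        v * star v = 1 ∧ moebius (rho (-1) 3 (by norm_num) (castQ (-1) 3 v)) p.1 = q.1) r = Quot.mk _ r' → Quot.mk (fun p q : {τ : ℂ // 0 < τ.im ∧ ∃ x : ℍ[ℚ,((-1 : ℤ) : ℚ),((3 : ℤ) : ℚ)],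
        x ∈ order (-1) 3 ∧ x.re = 0 ∧ (x * star x).re = t ∧ moebius (rho (-1) 3 (by norm_num) (castQ (-1) 3 x)) τ = τ} ↦
      ∃ g : ℍ[ℚ,((-1 : ℤ) : ℚ),((3 : ℤ) : ℚ)], g ≠ 0 ∧
        (∀ a : ℍ[ℚ,((-1 : ℤ) : ℚ),((3 : ℤ) : ℚ)], (a ∈ order (-1) 3 ∨ a - ⟨1/2, 1/2, 1/2, -1/2⟩ ∈ order (-1) 3) →
          ∃ b : ℍ[ℚ,((-1 : ℤ) : ℚ),((3 : ℤ) : ℚ)], (b ∈ order (-1) 3 ∨ b - ⟨1/2, 1/2, 1/2, -1/2⟩ ∈ order (-1) 3) ∧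
            g * a = b * g) ∧
        0 < (g * star g).re ∧ moebius (rho (-1) 3 (by norm_num) (castQ (-1) 3 g)) p.1 = q.1) r = Quot.mk _ r' := fun r r' h ↦
    (hiffP _ _).2 (hSP _ _ ((hiff _ _).1 h))
  show Quot.mk _ p' = Quot.mk _ p ↔ _
  constructor
  · intro h
    rw [hiffP, specialPointsPlus_rel_iff_exists_normOne_mul_word] at h
    obtain ⟨v, hv, hv1, k, l, hk, hl, h⟩ := h
    have hvn : (v * star v).re = 1 := by rw [hv1, QuaternionAlgebra.re_one]
    rw [moebius_rho_castQ_mul_apply (norm_atkinLehner_word_pos k l) (by rw [hvn]; exact one_pos) p'.2.1] at h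
    rcases Nat.le_one_iff_eq_zero_or_eq_one.1 hk with rfl | rfl <;>
      rcases Nat.le_one_iff_eq_zero_or_eq_one.1 hl with rfl | rfl
    · left
      rw [pow_zero, pow_zero, mul_one, moebius_rho_castQ_one_apply] at h
      exact (hiff _ _).2 ⟨v, hv, hv1, h⟩
    · right; right; left
      rw [pow_zero, pow_one, one_mul] at h
      rw [(specialPoints_mk_eq_mk_moebius_iff p' p).2, hiff]
      exact ⟨v, hv, hv1, h⟩
    · right; left
      rw [pow_one, pow_zero, mul_one] at h
      rw [(specialPoints_mk_eq_mk_moebius_iff p' p).1, hiff]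
      exact ⟨v, hv, hv1, h⟩
    · right; right; right
      rw [pow_one, pow_one, moebius_rho_castQ_mul_apply (by rw [norm_mu₂₂]; norm_num) (by rw [norm_w2₂₂]; norm_num) p'.2.1] at h
      -- `[ρ(w₂)ρ(μ)p'] = [p]` ⟹ `[ρ(μ)p'] = [ρ(w₂)p]` ⟹ `[p'] = [ρ(μ)ρ(w₂)p] = [ρ(w₂)ρ(μ)p]`
      have h1 : Quot.mk (fun p q : {τ : ℂ // 0 < τ.im ∧ ∃ x : ℍ[ℚ,((-1 : ℤ) : ℚ),((3 : ℤ) : ℚ)],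
        x ∈ order (-1) 3 ∧ x.re = 0 ∧ (x * star x).re = t ∧ moebius (rho (-1) 3 (by norm_num) (castQ (-1) 3 x)) τ = τ} ↦
      ∃ v : ℍ[ℚ,((-1 : ℤ) : ℚ),((3 : ℤ) : ℚ)], (v ∈ order (-1) 3 ∨ v - ⟨1/2, 1/2, 1/2, -1/2⟩ ∈ order (-1) 3) ∧
        v * star v = 1 ∧ moebius (rho (-1) 3 (by norm_num) (castQ (-1) 3 v)) p.1 = q.1) (⟨moebius (rho (-1) 3 (by norm_num) (castQ (-1) 3 (⟨1, 1, 0, 0⟩ : ℍ[ℚ,((-1 : ℤ) : ℚ),((3 : ℤ) : ℚ)]))) (⟨moebius (rho (-1) 3 (by norm_num) (castQ (-1) 3 (⟨3, 0, 1, 1⟩ : ℍ[ℚ,((-1 : ℤ) : ℚ),((3 : ℤ) : ℚ)]))) p'.1, moebius_mu_mem_specialPoints p'.2.1 p'.2.2⟩ : {τ : ℂ // 0 < τ.im ∧ ∃ x : ℍ[ℚ,((-1 : ℤ) : ℚ),((3 : ℤ) : ℚ)],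
        x ∈ order (-1) 3 ∧ x.re = 0 ∧ (x * star x).re = t ∧ moebius (rho (-1) 3 (by norm_num) (castQ (-1) 3 x)) τ = τ}).1, moebius_w2_mem_specialPoints (⟨moebius (rho (-1) 3 (by norm_num) (castQ (-1) 3 (⟨3, 0, 1, 1⟩ : ℍ[ℚ,((-1 : ℤ) : ℚ),((3 : ℤ) : ℚ)]))) p'.1, moebius_mu_mem_specialPoints p'.2.1 p'.2.2⟩ : {τ : ℂ // 0 < τ.im ∧ ∃ x : ℍ[ℚ,((-1 : ℤ) : ℚ),((3 : ℤ) : ℚ)],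
        x ∈ order (-1) 3 ∧ x.re = 0 ∧ (x * star x).re = t ∧ moebius (rho (-1) 3 (by norm_num) (castQ (-1) 3 x)) τ = τ}).2.1 (⟨moebius (rho (-1) 3 (by norm_num) (castQ (-1) 3 (⟨3, 0, 1, 1⟩ : ℍ[ℚ,((-1 : ℤ) : ℚ),((3 : ℤ) : ℚ)]))) p'.1, moebius_mu_mem_specialPoints p'.2.1 p'.2.2⟩ : {τ : ℂ // 0 < τ.im ∧ ∃ x : ℍ[ℚ,((-1 : ℤ) : ℚ),((3 : ℤ) : ℚ)],
        x ∈ order (-1) 3 ∧ x.re = 0 ∧ (x * star x).re = t ∧ moebius (rho (-1) 3 (by norm_num) (castQ (-1) 3 x)) τ = τ}).2.2⟩ : {τ : ℂ // 0 < τ.im ∧ ∃ x : ℍ[ℚ,((-1 : ℤ) : ℚ),((3 : ℤ) : ℚ)],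
        x ∈ order (-1) 3 ∧ x.re = 0 ∧ (x * star x).re = t ∧ moebius (rho (-1) 3 (by norm_num) (castQ (-1) 3 x)) τ = τ}) = Quot.mk _ p := (hiff _ _).2 ⟨v, hv, hv1, h⟩
      rw [← (specialPoints_mk_eq_mk_moebius_iff _ p).1, ← (specialPoints_mk_eq_mk_moebius_iff p' _).2] at h1
      rw [h1]
      exact ((specialPoints_mk_klein p).2.2.1).symm
  · rintro (h | h | h | h)
    · exact PS _ _ h
    · rw [PS _ _ h]; exact (PM p).symm
    · rw [PS _ _ h]; exact (PA p).symm
    · rw [PS _ _ h, ← PM, ← PA]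

end Orbit

/-! ## §2 The fibres of `Pt(t)/Γ₆^{(d)} → Pt(t)/Γ₆⁺`: `{[τ]_d, [ρ(w_{d′})τ]_d}`, one class exactly at the points of the other two involutions -/

section PlusFibres

/-- **THE FIBRE OF `X₆^{(2)} → X₆⁺` THROUGH `[τ]₂` ON `Z(t)` IS `{[τ]₂, [ρ(μ)τ]₂}`**: the `W/⟨ω₂⟩ ≅ ℤ/2ℤ`-orbit of
`[τ]₂`. [cite: BayerTravesa2007, §2 p. 318 («`X₆^{(2)} = X₆/⟨ω₂⟩` … `X₆⁺ = X₆/W`»)] [cite: Ogg1983RealPoints, §2 (2)–(3)] -/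
theorem factorPlus_mk_eq_mk_iff_atkinLehnerQuotientTwo {t : ℤ} (p' p : {τ : ℂ // 0 < τ.im ∧ ∃ x : ℍ[ℚ,((-1 : ℤ) : ℚ),((3 : ℤ) : ℚ)],
        x ∈ order (-1) 3 ∧ x.re = 0 ∧ (x * star x).re = t ∧ moebius (rho (-1) 3 (by norm_num) (castQ (-1) 3 x)) τ = τ}) :
    Quot.factor (fun p q : {τ : ℂ // 0 < τ.im ∧ ∃ x : ℍ[ℚ,((-1 : ℤ) : ℚ),((3 : ℤ) : ℚ)],
        x ∈ order (-1) 3 ∧ x.re = 0 ∧ (x * star x).re = t ∧ moebius (rho (-1) 3 (by norm_num) (castQ (-1) 3 x)) τ = τ} ↦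
      ∃ g : ℍ[ℚ,((-1 : ℤ) : ℚ),((3 : ℤ) : ℚ)], g ≠ 0 ∧
        (∀ a : ℍ[ℚ,((-1 : ℤ) : ℚ),((3 : ℤ) : ℚ)], (a ∈ order (-1) 3 ∨ a - ⟨1/2, 1/2, 1/2, -1/2⟩ ∈ order (-1) 3) →
          ∃ b : ℍ[ℚ,((-1 : ℤ) : ℚ),((3 : ℤ) : ℚ)], (b ∈ order (-1) 3 ∨ b - ⟨1/2, 1/2, 1/2, -1/2⟩ ∈ order (-1) 3) ∧
            g * a = b * g) ∧
        0 < (g * star g).re ∧ (∃ s : ℚ, (g * star g).re = s ^ 2 ∨ (g * star g).re = 2 * s ^ 2) ∧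
        moebius (rho (-1) 3 (by norm_num) (castQ (-1) 3 g)) p.1 = q.1)
      (fun p q : {τ : ℂ // 0 < τ.im ∧ ∃ x : ℍ[ℚ,((-1 : ℤ) : ℚ),((3 : ℤ) : ℚ)],
        x ∈ order (-1) 3 ∧ x.re = 0 ∧ (x * star x).re = t ∧ moebius (rho (-1) 3 (by norm_num) (castQ (-1) 3 x)) τ = τ} ↦
      ∃ g : ℍ[ℚ,((-1 : ℤ) : ℚ),((3 : ℤ) : ℚ)], g ≠ 0 ∧
        (∀ a : ℍ[ℚ,((-1 : ℤ) : ℚ),((3 : ℤ) : ℚ)], (a ∈ order (-1) 3 ∨ a - ⟨1/2, 1/2, 1/2, -1/2⟩ ∈ order (-1) 3) →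
          ∃ b : ℍ[ℚ,((-1 : ℤ) : ℚ),((3 : ℤ) : ℚ)], (b ∈ order (-1) 3 ∨ b - ⟨1/2, 1/2, 1/2, -1/2⟩ ∈ order (-1) 3) ∧
            g * a = b * g) ∧
        0 < (g * star g).re ∧ moebius (rho (-1) 3 (by norm_num) (castQ (-1) 3 g)) p.1 = q.1)
      (specialPointsPlus_rel_of_atkinLehnerQuotient_rel t 2) (Quot.mk _ p') = Quot.mk _ p ↔
    (Quot.mk (fun p q : {τ : ℂ // 0 < τ.im ∧ ∃ x : ℍ[ℚ,((-1 : ℤ) : ℚ),((3 : ℤ) : ℚ)],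
        x ∈ order (-1) 3 ∧ x.re = 0 ∧ (x * star x).re = t ∧ moebius (rho (-1) 3 (by norm_num) (castQ (-1) 3 x)) τ = τ} ↦
      ∃ g : ℍ[ℚ,((-1 : ℤ) : ℚ),((3 : ℤ) : ℚ)], g ≠ 0 ∧
        (∀ a : ℍ[ℚ,((-1 : ℤ) : ℚ),((3 : ℤ) : ℚ)], (a ∈ order (-1) 3 ∨ a - ⟨1/2, 1/2, 1/2, -1/2⟩ ∈ order (-1) 3) →
          ∃ b : ℍ[ℚ,((-1 : ℤ) : ℚ),((3 : ℤ) : ℚ)], (b ∈ order (-1) 3 ∨ b - ⟨1/2, 1/2, 1/2, -1/2⟩ ∈ order (-1) 3) ∧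
            g * a = b * g) ∧
        0 < (g * star g).re ∧ (∃ s : ℚ, (g * star g).re = s ^ 2 ∨ (g * star g).re = 2 * s ^ 2) ∧
        moebius (rho (-1) 3 (by norm_num) (castQ (-1) 3 g)) p.1 = q.1) p' = Quot.mk _ p ∨
      Quot.mk (fun p q : {τ : ℂ // 0 < τ.im ∧ ∃ x : ℍ[ℚ,((-1 : ℤ) : ℚ),((3 : ℤ) : ℚ)],
        x ∈ order (-1) 3 ∧ x.re = 0 ∧ (x * star x).re = t ∧ moebius (rho (-1) 3 (by norm_num) (castQ (-1) 3 x)) τ = τ} ↦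
      ∃ g : ℍ[ℚ,((-1 : ℤ) : ℚ),((3 : ℤ) : ℚ)], g ≠ 0 ∧
        (∀ a : ℍ[ℚ,((-1 : ℤ) : ℚ),((3 : ℤ) : ℚ)], (a ∈ order (-1) 3 ∨ a - ⟨1/2, 1/2, 1/2, -1/2⟩ ∈ order (-1) 3) →
          ∃ b : ℍ[ℚ,((-1 : ℤ) : ℚ),((3 : ℤ) : ℚ)], (b ∈ order (-1) 3 ∨ b - ⟨1/2, 1/2, 1/2, -1/2⟩ ∈ order (-1) 3) ∧
            g * a = b * g) ∧
        0 < (g * star g).re ∧ (∃ s : ℚ, (g * star g).re = s ^ 2 ∨ (g * star g).re = 2 * s ^ 2) ∧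
        moebius (rho (-1) 3 (by norm_num) (castQ (-1) 3 g)) p.1 = q.1) p' = Quot.mk _ (⟨moebius (rho (-1) 3 (by norm_num) (castQ (-1) 3 (⟨3, 0, 1, 1⟩ : ℍ[ℚ,((-1 : ℤ) : ℚ),((3 : ℤ) : ℚ)]))) p.1, moebius_mu_mem_specialPoints p.2.1 p.2.2⟩ : {τ : ℂ // 0 < τ.im ∧ ∃ x : ℍ[ℚ,((-1 : ℤ) : ℚ),((3 : ℤ) : ℚ)],
        x ∈ order (-1) 3 ∧ x.re = 0 ∧ (x * star x).re = t ∧ moebius (rho (-1) 3 (by norm_num) (castQ (-1) 3 x)) τ = τ})) := by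
  have hiffP := specialPointsPlus_mk_eq_iff t
  have hiffD := atkinLehnerQuotient_mk_eq_iff t 2
  have hEP := specialPointsPlus_equivalence t
  have hDP := specialPointsPlus_rel_of_atkinLehnerQuotient_rel t 2
  have h1O : ((1 : ℍ[ℚ,((-1 : ℤ) : ℚ),((3 : ℤ) : ℚ)]) ∈ order (-1) 3 ∨ (1 : ℍ[ℚ,((-1 : ℤ) : ℚ),((3 : ℤ) : ℚ)]) - ⟨1/2, 1/2, 1/2, -1/2⟩ ∈ order (-1) 3) := Or.inl (Subring.one_mem _)
  have h11 : (1 : ℍ[ℚ,((-1 : ℤ) : ℚ),((3 : ℤ) : ℚ)]) * star 1 = 1 := by rw [star_one, mul_one]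
  -- `[r]₂ = [ρ(w₂) r]₂` and `S`-classes map to `Γ₆^{(2)}`-classes
  have DW : ∀ r : {τ : ℂ // 0 < τ.im ∧ ∃ x : ℍ[ℚ,((-1 : ℤ) : ℚ),((3 : ℤ) : ℚ)],
        x ∈ order (-1) 3 ∧ x.re = 0 ∧ (x * star x).re = t ∧ moebius (rho (-1) 3 (by norm_num) (castQ (-1) 3 x)) τ = τ}, Quot.mk (fun p q : {τ : ℂ // 0 < τ.im ∧ ∃ x : ℍ[ℚ,((-1 : ℤ) : ℚ),((3 : ℤ) : ℚ)],
        x ∈ order (-1) 3 ∧ x.re = 0 ∧ (x * star x).re = t ∧ moebius (rho (-1) 3 (by norm_num) (castQ (-1) 3 x)) τ = τ} ↦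
      ∃ g : ℍ[ℚ,((-1 : ℤ) : ℚ),((3 : ℤ) : ℚ)], g ≠ 0 ∧
        (∀ a : ℍ[ℚ,((-1 : ℤ) : ℚ),((3 : ℤ) : ℚ)], (a ∈ order (-1) 3 ∨ a - ⟨1/2, 1/2, 1/2, -1/2⟩ ∈ order (-1) 3) →
          ∃ b : ℍ[ℚ,((-1 : ℤ) : ℚ),((3 : ℤ) : ℚ)], (b ∈ order (-1) 3 ∨ b - ⟨1/2, 1/2, 1/2, -1/2⟩ ∈ order (-1) 3) ∧
            g * a = b * g) ∧
        0 < (g * star g).re ∧ (∃ s : ℚ, (g * star g).re = s ^ 2 ∨ (g * star g).re = 2 * s ^ 2) ∧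
        moebius (rho (-1) 3 (by norm_num) (castQ (-1) 3 g)) p.1 = q.1) r = Quot.mk _ (⟨moebius (rho (-1) 3 (by norm_num) (castQ (-1) 3 (⟨1, 1, 0, 0⟩ : ℍ[ℚ,((-1 : ℤ) : ℚ),((3 : ℤ) : ℚ)]))) r.1, moebius_w2_mem_specialPoints r.2.1 r.2.2⟩ : {τ : ℂ // 0 < τ.im ∧ ∃ x : ℍ[ℚ,((-1 : ℤ) : ℚ),((3 : ℤ) : ℚ)],
        x ∈ order (-1) 3 ∧ x.re = 0 ∧ (x * star x).re = t ∧ moebius (rho (-1) 3 (by norm_num) (castQ (-1) 3 x)) τ = τ}) := fun r ↦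
    (hiffD _ _).2 ((atkinLehnerQuotientTwo_rel_iff _ _).2 ⟨1, h1O, h11, Or.inr (moebius_rho_castQ_one_apply _)⟩)
  have DS : ∀ r r' : {τ : ℂ // 0 < τ.im ∧ ∃ x : ℍ[ℚ,((-1 : ℤ) : ℚ),((3 : ℤ) : ℚ)],
        x ∈ order (-1) 3 ∧ x.re = 0 ∧ (x * star x).re = t ∧ moebius (rho (-1) 3 (by norm_num) (castQ (-1) 3 x)) τ = τ}, Quot.mk (fun p q : {τ : ℂ // 0 < τ.im ∧ ∃ x : ℍ[ℚ,((-1 : ℤ) : ℚ),((3 : ℤ) : ℚ)],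
        x ∈ order (-1) 3 ∧ x.re = 0 ∧ (x * star x).re = t ∧ moebius (rho (-1) 3 (by norm_num) (castQ (-1) 3 x)) τ = τ} ↦
      ∃ v : ℍ[ℚ,((-1 : ℤ) : ℚ),((3 : ℤ) : ℚ)], (v ∈ order (-1) 3 ∨ v - ⟨1/2, 1/2, 1/2, -1/2⟩ ∈ order (-1) 3) ∧
        v * star v = 1 ∧ moebius (rho (-1) 3 (by norm_num) (castQ (-1) 3 v)) p.1 = q.1) r = Quot.mk _ r' → Quot.mk (fun p q : {τ : ℂ // 0 < τ.im ∧ ∃ x : ℍ[ℚ,((-1 : ℤ) : ℚ),((3 : ℤ) : ℚ)],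
        x ∈ order (-1) 3 ∧ x.re = 0 ∧ (x * star x).re = t ∧ moebius (rho (-1) 3 (by norm_num) (castQ (-1) 3 x)) τ = τ} ↦
      ∃ g : ℍ[ℚ,((-1 : ℤ) : ℚ),((3 : ℤ) : ℚ)], g ≠ 0 ∧
        (∀ a : ℍ[ℚ,((-1 : ℤ) : ℚ),((3 : ℤ) : ℚ)], (a ∈ order (-1) 3 ∨ a - ⟨1/2, 1/2, 1/2, -1/2⟩ ∈ order (-1) 3) →
          ∃ b : ℍ[ℚ,((-1 : ℤ) : ℚ),((3 : ℤ) : ℚ)], (b ∈ order (-1) 3 ∨ b - ⟨1/2, 1/2, 1/2, -1/2⟩ ∈ order (-1) 3) ∧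
            g * a = b * g) ∧
        0 < (g * star g).re ∧ (∃ s : ℚ, (g * star g).re = s ^ 2 ∨ (g * star g).re = 2 * s ^ 2) ∧
        moebius (rho (-1) 3 (by norm_num) (castQ (-1) 3 g)) p.1 = q.1) r = Quot.mk _ r' := fun r r' h ↦
    (hiffD _ _).2 (atkinLehnerQuotient_rel_of_specialPoints_rel t 2 _ _ ((specialPoints_mk_eq_iff t _ _).1 h))
  have PO : Quot.mk (fun p q : {τ : ℂ // 0 < τ.im ∧ ∃ x : ℍ[ℚ,((-1 : ℤ) : ℚ),((3 : ℤ) : ℚ)],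
        x ∈ order (-1) 3 ∧ x.re = 0 ∧ (x * star x).re = t ∧ moebius (rho (-1) 3 (by norm_num) (castQ (-1) 3 x)) τ = τ} ↦
      ∃ g : ℍ[ℚ,((-1 : ℤ) : ℚ),((3 : ℤ) : ℚ)], g ≠ 0 ∧
        (∀ a : ℍ[ℚ,((-1 : ℤ) : ℚ),((3 : ℤ) : ℚ)], (a ∈ order (-1) 3 ∨ a - ⟨1/2, 1/2, 1/2, -1/2⟩ ∈ order (-1) 3) →
          ∃ b : ℍ[ℚ,((-1 : ℤ) : ℚ),((3 : ℤ) : ℚ)], (b ∈ order (-1) 3 ∨ b - ⟨1/2, 1/2, 1/2, -1/2⟩ ∈ order (-1) 3) ∧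
            g * a = b * g) ∧
        0 < (g * star g).re ∧ moebius (rho (-1) 3 (by norm_num) (castQ (-1) 3 g)) p.1 = q.1) (⟨moebius (rho (-1) 3 (by norm_num) (castQ (-1) 3 (⟨3, 0, 1, 1⟩ : ℍ[ℚ,((-1 : ℤ) : ℚ),((3 : ℤ) : ℚ)]))) p.1, moebius_mu_mem_specialPoints p.2.1 p.2.2⟩ : {τ : ℂ // 0 < τ.im ∧ ∃ x : ℍ[ℚ,((-1 : ℤ) : ℚ),((3 : ℤ) : ℚ)],
        x ∈ order (-1) 3 ∧ x.re = 0 ∧ (x * star x).re = t ∧ moebius (rho (-1) 3 (by norm_num) (castQ (-1) 3 x)) τ = τ}) = Quot.mk _ p :=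
    ((factor_mk_eq_mk_iff_specialPointsPlus _ p).2 (Or.inr (Or.inr (Or.inl rfl))))
  show Quot.mk _ p' = Quot.mk _ p ↔ _
  constructor
  · intro h
    have h4 := (factor_mk_eq_mk_iff_specialPointsPlus p' p).1 h
    rcases h4 with h4 | h4 | h4 | h4
    · exact Or.inl (DS _ _ h4)
    · exact Or.inl ((DS _ _ h4).trans (DW p).symm)
    · exact Or.inr (DS _ _ h4)
    · exact Or.inr ((DS _ _ h4).trans (DW _).symm)
  · rintro (h | h)
    · exact (hiffP _ _).2 (hDP _ _ ((hiffD _ _).1 h))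
    · rw [← PO]
      exact (hiffP _ _).2 (hDP _ _ ((hiffD _ _).1 h))

/-- **ONE CLASS IN THE FIBRE OF `X₆^{(2)} → X₆⁺` EXACTLY AT THE `Z(3)`- AND `Z(6)`-POINTS**: `[ρ(μ)τ]₂ = [τ]₂ ⟺
ρ(μ)τ ∼_{Γ₆} τ` or `ρ(w₂)ρ(μ)τ ∼_{Γ₆} τ ⟺ τ ∈ Pt(3) ∪ Pt(6)` — on `Z(t)` the cover `X₆^{(2)} → X₆⁺` ramifies exactly over
the images of the fixed points of the two OTHER involutions. [cite: BayerTravesa2007, §7 p. 332 («`P₀` is an elliptic point for `X₆^{(6)}` and `X₆⁺`, but it is not elliptic for `X₆`, `X₆^{(2)}` and `X₆^{(3)}`») and Table 9] [cite: Ogg1983RealPoints, §2 pp. 283–284] -/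
theorem card_plusFibre_atkinLehnerQuotientTwo_eq_one_iff {t : ℤ} (p : {τ : ℂ // 0 < τ.im ∧ ∃ x : ℍ[ℚ,((-1 : ℤ) : ℚ),((3 : ℤ) : ℚ)],
        x ∈ order (-1) 3 ∧ x.re = 0 ∧ (x * star x).re = t ∧ moebius (rho (-1) 3 (by norm_num) (castQ (-1) 3 x)) τ = τ}) :
    Nat.card {b : (Quot (fun p q : {τ : ℂ // 0 < τ.im ∧ ∃ x : ℍ[ℚ,((-1 : ℤ) : ℚ),((3 : ℤ) : ℚ)],
        x ∈ order (-1) 3 ∧ x.re = 0 ∧ (x * star x).re = t ∧ moebius (rho (-1) 3 (by norm_num) (castQ (-1) 3 x)) τ = τ} ↦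
      ∃ g : ℍ[ℚ,((-1 : ℤ) : ℚ),((3 : ℤ) : ℚ)], g ≠ 0 ∧
        (∀ a : ℍ[ℚ,((-1 : ℤ) : ℚ),((3 : ℤ) : ℚ)], (a ∈ order (-1) 3 ∨ a - ⟨1/2, 1/2, 1/2, -1/2⟩ ∈ order (-1) 3) →
          ∃ b : ℍ[ℚ,((-1 : ℤ) : ℚ),((3 : ℤ) : ℚ)], (b ∈ order (-1) 3 ∨ b - ⟨1/2, 1/2, 1/2, -1/2⟩ ∈ order (-1) 3) ∧
            g * a = b * g) ∧
        0 < (g * star g).re ∧ (∃ s : ℚ, (g * star g).re = s ^ 2 ∨ (g * star g).re = 2 * s ^ 2) ∧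
        moebius (rho (-1) 3 (by norm_num) (castQ (-1) 3 g)) p.1 = q.1)) //
      Quot.factor (fun p q : {τ : ℂ // 0 < τ.im ∧ ∃ x : ℍ[ℚ,((-1 : ℤ) : ℚ),((3 : ℤ) : ℚ)],
        x ∈ order (-1) 3 ∧ x.re = 0 ∧ (x * star x).re = t ∧ moebius (rho (-1) 3 (by norm_num) (castQ (-1) 3 x)) τ = τ} ↦
      ∃ g : ℍ[ℚ,((-1 : ℤ) : ℚ),((3 : ℤ) : ℚ)], g ≠ 0 ∧
        (∀ a : ℍ[ℚ,((-1 : ℤ) : ℚ),((3 : ℤ) : ℚ)], (a ∈ order (-1) 3 ∨ a - ⟨1/2, 1/2, 1/2, -1/2⟩ ∈ order (-1) 3) →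
          ∃ b : ℍ[ℚ,((-1 : ℤ) : ℚ),((3 : ℤ) : ℚ)], (b ∈ order (-1) 3 ∨ b - ⟨1/2, 1/2, 1/2, -1/2⟩ ∈ order (-1) 3) ∧
            g * a = b * g) ∧
        0 < (g * star g).re ∧ (∃ s : ℚ, (g * star g).re = s ^ 2 ∨ (g * star g).re = 2 * s ^ 2) ∧
        moebius (rho (-1) 3 (by norm_num) (castQ (-1) 3 g)) p.1 = q.1)
      (fun p q : {τ : ℂ // 0 < τ.im ∧ ∃ x : ℍ[ℚ,((-1 : ℤ) : ℚ),((3 : ℤ) : ℚ)],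
        x ∈ order (-1) 3 ∧ x.re = 0 ∧ (x * star x).re = t ∧ moebius (rho (-1) 3 (by norm_num) (castQ (-1) 3 x)) τ = τ} ↦
      ∃ g : ℍ[ℚ,((-1 : ℤ) : ℚ),((3 : ℤ) : ℚ)], g ≠ 0 ∧
        (∀ a : ℍ[ℚ,((-1 : ℤ) : ℚ),((3 : ℤ) : ℚ)], (a ∈ order (-1) 3 ∨ a - ⟨1/2, 1/2, 1/2, -1/2⟩ ∈ order (-1) 3) →
          ∃ b : ℍ[ℚ,((-1 : ℤ) : ℚ),((3 : ℤ) : ℚ)], (b ∈ order (-1) 3 ∨ b - ⟨1/2, 1/2, 1/2, -1/2⟩ ∈ order (-1) 3) ∧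
            g * a = b * g) ∧
        0 < (g * star g).re ∧ moebius (rho (-1) 3 (by norm_num) (castQ (-1) 3 g)) p.1 = q.1)
      (specialPointsPlus_rel_of_atkinLehnerQuotient_rel t 2) b = Quot.mk _ p} = 1 ↔
    ((∃ y : ℍ[ℚ,((-1 : ℤ) : ℚ),((3 : ℤ) : ℚ)], y ∈ order (-1) 3 ∧ y.re = 0 ∧ (y * star y).re = 3 ∧
        moebius (rho (-1) 3 (by norm_num) (castQ (-1) 3 y)) p.1 = p.1) ∨
      (∃ y : ℍ[ℚ,((-1 : ℤ) : ℚ),((3 : ℤ) : ℚ)], y ∈ order (-1) 3 ∧ y.re = 0 ∧ (y * star y).re = 6 ∧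
        moebius (rho (-1) 3 (by norm_num) (castQ (-1) 3 y)) p.1 = p.1)) := by
  have hF : ∀ b : (Quot (fun p q : {τ : ℂ // 0 < τ.im ∧ ∃ x : ℍ[ℚ,((-1 : ℤ) : ℚ),((3 : ℤ) : ℚ)],
        x ∈ order (-1) 3 ∧ x.re = 0 ∧ (x * star x).re = t ∧ moebius (rho (-1) 3 (by norm_num) (castQ (-1) 3 x)) τ = τ} ↦
      ∃ g : ℍ[ℚ,((-1 : ℤ) : ℚ),((3 : ℤ) : ℚ)], g ≠ 0 ∧
        (∀ a : ℍ[ℚ,((-1 : ℤ) : ℚ),((3 : ℤ) : ℚ)], (a ∈ order (-1) 3 ∨ a - ⟨1/2, 1/2, 1/2, -1/2⟩ ∈ order (-1) 3) →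
          ∃ b : ℍ[ℚ,((-1 : ℤ) : ℚ),((3 : ℤ) : ℚ)], (b ∈ order (-1) 3 ∨ b - ⟨1/2, 1/2, 1/2, -1/2⟩ ∈ order (-1) 3) ∧
            g * a = b * g) ∧
        0 < (g * star g).re ∧ (∃ s : ℚ, (g * star g).re = s ^ 2 ∨ (g * star g).re = 2 * s ^ 2) ∧
        moebius (rho (-1) 3 (by norm_num) (castQ (-1) 3 g)) p.1 = q.1)),
      Quot.factor (fun p q : {τ : ℂ // 0 < τ.im ∧ ∃ x : ℍ[ℚ,((-1 : ℤ) : ℚ),((3 : ℤ) : ℚ)],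
        x ∈ order (-1) 3 ∧ x.re = 0 ∧ (x * star x).re = t ∧ moebius (rho (-1) 3 (by norm_num) (castQ (-1) 3 x)) τ = τ} ↦
      ∃ g : ℍ[ℚ,((-1 : ℤ) : ℚ),((3 : ℤ) : ℚ)], g ≠ 0 ∧
        (∀ a : ℍ[ℚ,((-1 : ℤ) : ℚ),((3 : ℤ) : ℚ)], (a ∈ order (-1) 3 ∨ a - ⟨1/2, 1/2, 1/2, -1/2⟩ ∈ order (-1) 3) →
          ∃ b : ℍ[ℚ,((-1 : ℤ) : ℚ),((3 : ℤ) : ℚ)], (b ∈ order (-1) 3 ∨ b - ⟨1/2, 1/2, 1/2, -1/2⟩ ∈ order (-1) 3) ∧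
            g * a = b * g) ∧
        0 < (g * star g).re ∧ (∃ s : ℚ, (g * star g).re = s ^ 2 ∨ (g * star g).re = 2 * s ^ 2) ∧
        moebius (rho (-1) 3 (by norm_num) (castQ (-1) 3 g)) p.1 = q.1)
      (fun p q : {τ : ℂ // 0 < τ.im ∧ ∃ x : ℍ[ℚ,((-1 : ℤ) : ℚ),((3 : ℤ) : ℚ)],
        x ∈ order (-1) 3 ∧ x.re = 0 ∧ (x * star x).re = t ∧ moebius (rho (-1) 3 (by norm_num) (castQ (-1) 3 x)) τ = τ} ↦
      ∃ g : ℍ[ℚ,((-1 : ℤ) : ℚ),((3 : ℤ) : ℚ)], g ≠ 0 ∧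
        (∀ a : ℍ[ℚ,((-1 : ℤ) : ℚ),((3 : ℤ) : ℚ)], (a ∈ order (-1) 3 ∨ a - ⟨1/2, 1/2, 1/2, -1/2⟩ ∈ order (-1) 3) →
          ∃ b : ℍ[ℚ,((-1 : ℤ) : ℚ),((3 : ℤ) : ℚ)], (b ∈ order (-1) 3 ∨ b - ⟨1/2, 1/2, 1/2, -1/2⟩ ∈ order (-1) 3) ∧
            g * a = b * g) ∧
        0 < (g * star g).re ∧ moebius (rho (-1) 3 (by norm_num) (castQ (-1) 3 g)) p.1 = q.1)
      (specialPointsPlus_rel_of_atkinLehnerQuotient_rel t 2) b = Quot.mk _ p ↔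
      (b = Quot.mk _ p ∨ b = Quot.mk _ (⟨moebius (rho (-1) 3 (by norm_num) (castQ (-1) 3 (⟨3, 0, 1, 1⟩ : ℍ[ℚ,((-1 : ℤ) : ℚ),((3 : ℤ) : ℚ)]))) p.1, moebius_mu_mem_specialPoints p.2.1 p.2.2⟩ : {τ : ℂ // 0 < τ.im ∧ ∃ x : ℍ[ℚ,((-1 : ℤ) : ℚ),((3 : ℤ) : ℚ)],
        x ∈ order (-1) 3 ∧ x.re = 0 ∧ (x * star x).re = t ∧ moebius (rho (-1) 3 (by norm_num) (castQ (-1) 3 x)) τ = τ})) := by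
    intro b
    induction b using Quot.ind with
    | _ p' => exact factorPlus_mk_eq_mk_iff_atkinLehnerQuotientTwo p' p
  rw [(card_eq_one_iff_of_iff_eq_or_eq₂₂ hF).1, atkinLehnerQuotient_mk_eq_iff, atkinLehnerQuotientTwo_rel_iff,
    ← normOne_moebius_mu_fixed_iff p.2.1, ← normOne_moebius_w2_mu_fixed_iff p.2.1]
  constructor
  · rintro ⟨v, hv, hv1, h | h⟩
    · exact Or.inl ⟨v, hv, hv1, h⟩
    · exact Or.inr ⟨v, hv, hv1, h⟩
  · rintro (⟨v, hv, hv1, h⟩ | ⟨v, hv, hv1, h⟩)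
    · exact ⟨v, hv, hv1, Or.inl h⟩
    · exact ⟨v, hv, hv1, Or.inr h⟩

/-- **TWO CLASSES IN THE FIBRE OF `X₆^{(2)} → X₆⁺`** away from `Z(3) ∪ Z(6)`. [cite: BayerTravesa2007, §2 p. 318 and §7] [cite: Ogg1983RealPoints, §2 (2)–(4)] -/
theorem card_plusFibre_atkinLehnerQuotientTwo_eq_two_iff {t : ℤ} (p : {τ : ℂ // 0 < τ.im ∧ ∃ x : ℍ[ℚ,((-1 : ℤ) : ℚ),((3 : ℤ) : ℚ)],
        x ∈ order (-1) 3 ∧ x.re = 0 ∧ (x * star x).re = t ∧ moebius (rho (-1) 3 (by norm_num) (castQ (-1) 3 x)) τ = τ}) :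
    Nat.card {b : (Quot (fun p q : {τ : ℂ // 0 < τ.im ∧ ∃ x : ℍ[ℚ,((-1 : ℤ) : ℚ),((3 : ℤ) : ℚ)],
        x ∈ order (-1) 3 ∧ x.re = 0 ∧ (x * star x).re = t ∧ moebius (rho (-1) 3 (by norm_num) (castQ (-1) 3 x)) τ = τ} ↦
      ∃ g : ℍ[ℚ,((-1 : ℤ) : ℚ),((3 : ℤ) : ℚ)], g ≠ 0 ∧
        (∀ a : ℍ[ℚ,((-1 : ℤ) : ℚ),((3 : ℤ) : ℚ)], (a ∈ order (-1) 3 ∨ a - ⟨1/2, 1/2, 1/2, -1/2⟩ ∈ order (-1) 3) →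
          ∃ b : ℍ[ℚ,((-1 : ℤ) : ℚ),((3 : ℤ) : ℚ)], (b ∈ order (-1) 3 ∨ b - ⟨1/2, 1/2, 1/2, -1/2⟩ ∈ order (-1) 3) ∧
            g * a = b * g) ∧
        0 < (g * star g).re ∧ (∃ s : ℚ, (g * star g).re = s ^ 2 ∨ (g * star g).re = 2 * s ^ 2) ∧
        moebius (rho (-1) 3 (by norm_num) (castQ (-1) 3 g)) p.1 = q.1)) //
      Quot.factor (fun p q : {τ : ℂ // 0 < τ.im ∧ ∃ x : ℍ[ℚ,((-1 : ℤ) : ℚ),((3 : ℤ) : ℚ)],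
        x ∈ order (-1) 3 ∧ x.re = 0 ∧ (x * star x).re = t ∧ moebius (rho (-1) 3 (by norm_num) (castQ (-1) 3 x)) τ = τ} ↦
      ∃ g : ℍ[ℚ,((-1 : ℤ) : ℚ),((3 : ℤ) : ℚ)], g ≠ 0 ∧
        (∀ a : ℍ[ℚ,((-1 : ℤ) : ℚ),((3 : ℤ) : ℚ)], (a ∈ order (-1) 3 ∨ a - ⟨1/2, 1/2, 1/2, -1/2⟩ ∈ order (-1) 3) →
          ∃ b : ℍ[ℚ,((-1 : ℤ) : ℚ),((3 : ℤ) : ℚ)], (b ∈ order (-1) 3 ∨ b - ⟨1/2, 1/2, 1/2, -1/2⟩ ∈ order (-1) 3) ∧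
            g * a = b * g) ∧
        0 < (g * star g).re ∧ (∃ s : ℚ, (g * star g).re = s ^ 2 ∨ (g * star g).re = 2 * s ^ 2) ∧
        moebius (rho (-1) 3 (by norm_num) (castQ (-1) 3 g)) p.1 = q.1)
      (fun p q : {τ : ℂ // 0 < τ.im ∧ ∃ x : ℍ[ℚ,((-1 : ℤ) : ℚ),((3 : ℤ) : ℚ)],
        x ∈ order (-1) 3 ∧ x.re = 0 ∧ (x * star x).re = t ∧ moebius (rho (-1) 3 (by norm_num) (castQ (-1) 3 x)) τ = τ} ↦
      ∃ g : ℍ[ℚ,((-1 : ℤ) : ℚ),((3 : ℤ) : ℚ)], g ≠ 0 ∧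
        (∀ a : ℍ[ℚ,((-1 : ℤ) : ℚ),((3 : ℤ) : ℚ)], (a ∈ order (-1) 3 ∨ a - ⟨1/2, 1/2, 1/2, -1/2⟩ ∈ order (-1) 3) →
          ∃ b : ℍ[ℚ,((-1 : ℤ) : ℚ),((3 : ℤ) : ℚ)], (b ∈ order (-1) 3 ∨ b - ⟨1/2, 1/2, 1/2, -1/2⟩ ∈ order (-1) 3) ∧
            g * a = b * g) ∧
        0 < (g * star g).re ∧ moebius (rho (-1) 3 (by norm_num) (castQ (-1) 3 g)) p.1 = q.1)
      (specialPointsPlus_rel_of_atkinLehnerQuotient_rel t 2) b = Quot.mk _ p} = 2 ↔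
    ¬ ((∃ y : ℍ[ℚ,((-1 : ℤ) : ℚ),((3 : ℤ) : ℚ)], y ∈ order (-1) 3 ∧ y.re = 0 ∧ (y * star y).re = 3 ∧
        moebius (rho (-1) 3 (by norm_num) (castQ (-1) 3 y)) p.1 = p.1) ∨
      (∃ y : ℍ[ℚ,((-1 : ℤ) : ℚ),((3 : ℤ) : ℚ)], y ∈ order (-1) 3 ∧ y.re = 0 ∧ (y * star y).re = 6 ∧
        moebius (rho (-1) 3 (by norm_num) (castQ (-1) 3 y)) p.1 = p.1)) := by
  have hF : ∀ b : (Quot (fun p q : {τ : ℂ // 0 < τ.im ∧ ∃ x : ℍ[ℚ,((-1 : ℤ) : ℚ),((3 : ℤ) : ℚ)],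
        x ∈ order (-1) 3 ∧ x.re = 0 ∧ (x * star x).re = t ∧ moebius (rho (-1) 3 (by norm_num) (castQ (-1) 3 x)) τ = τ} ↦
      ∃ g : ℍ[ℚ,((-1 : ℤ) : ℚ),((3 : ℤ) : ℚ)], g ≠ 0 ∧
        (∀ a : ℍ[ℚ,((-1 : ℤ) : ℚ),((3 : ℤ) : ℚ)], (a ∈ order (-1) 3 ∨ a - ⟨1/2, 1/2, 1/2, -1/2⟩ ∈ order (-1) 3) →
          ∃ b : ℍ[ℚ,((-1 : ℤ) : ℚ),((3 : ℤ) : ℚ)], (b ∈ order (-1) 3 ∨ b - ⟨1/2, 1/2, 1/2, -1/2⟩ ∈ order (-1) 3) ∧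
            g * a = b * g) ∧
        0 < (g * star g).re ∧ (∃ s : ℚ, (g * star g).re = s ^ 2 ∨ (g * star g).re = 2 * s ^ 2) ∧
        moebius (rho (-1) 3 (by norm_num) (castQ (-1) 3 g)) p.1 = q.1)),
      Quot.factor (fun p q : {τ : ℂ // 0 < τ.im ∧ ∃ x : ℍ[ℚ,((-1 : ℤ) : ℚ),((3 : ℤ) : ℚ)],
        x ∈ order (-1) 3 ∧ x.re = 0 ∧ (x * star x).re = t ∧ moebius (rho (-1) 3 (by norm_num) (castQ (-1) 3 x)) τ = τ} ↦
      ∃ g : ℍ[ℚ,((-1 : ℤ) : ℚ),((3 : ℤ) : ℚ)], g ≠ 0 ∧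
        (∀ a : ℍ[ℚ,((-1 : ℤ) : ℚ),((3 : ℤ) : ℚ)], (a ∈ order (-1) 3 ∨ a - ⟨1/2, 1/2, 1/2, -1/2⟩ ∈ order (-1) 3) →
          ∃ b : ℍ[ℚ,((-1 : ℤ) : ℚ),((3 : ℤ) : ℚ)], (b ∈ order (-1) 3 ∨ b - ⟨1/2, 1/2, 1/2, -1/2⟩ ∈ order (-1) 3) ∧
            g * a = b * g) ∧
        0 < (g * star g).re ∧ (∃ s : ℚ, (g * star g).re = s ^ 2 ∨ (g * star g).re = 2 * s ^ 2) ∧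
        moebius (rho (-1) 3 (by norm_num) (castQ (-1) 3 g)) p.1 = q.1)
      (fun p q : {τ : ℂ // 0 < τ.im ∧ ∃ x : ℍ[ℚ,((-1 : ℤ) : ℚ),((3 : ℤ) : ℚ)],
        x ∈ order (-1) 3 ∧ x.re = 0 ∧ (x * star x).re = t ∧ moebius (rho (-1) 3 (by norm_num) (castQ (-1) 3 x)) τ = τ} ↦
      ∃ g : ℍ[ℚ,((-1 : ℤ) : ℚ),((3 : ℤ) : ℚ)], g ≠ 0 ∧
        (∀ a : ℍ[ℚ,((-1 : ℤ) : ℚ),((3 : ℤ) : ℚ)], (a ∈ order (-1) 3 ∨ a - ⟨1/2, 1/2, 1/2, -1/2⟩ ∈ order (-1) 3) →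
          ∃ b : ℍ[ℚ,((-1 : ℤ) : ℚ),((3 : ℤ) : ℚ)], (b ∈ order (-1) 3 ∨ b - ⟨1/2, 1/2, 1/2, -1/2⟩ ∈ order (-1) 3) ∧
            g * a = b * g) ∧
        0 < (g * star g).re ∧ moebius (rho (-1) 3 (by norm_num) (castQ (-1) 3 g)) p.1 = q.1)
      (specialPointsPlus_rel_of_atkinLehnerQuotient_rel t 2) b = Quot.mk _ p ↔
      (b = Quot.mk _ p ∨ b = Quot.mk _ (⟨moebius (rho (-1) 3 (by norm_num) (castQ (-1) 3 (⟨3, 0, 1, 1⟩ : ℍ[ℚ,((-1 : ℤ) : ℚ),((3 : ℤ) : ℚ)]))) p.1, moebius_mu_mem_specialPoints p.2.1 p.2.2⟩ : {τ : ℂ // 0 < τ.im ∧ ∃ x : ℍ[ℚ,((-1 : ℤ) : ℚ),((3 : ℤ) : ℚ)],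
        x ∈ order (-1) 3 ∧ x.re = 0 ∧ (x * star x).re = t ∧ moebius (rho (-1) 3 (by norm_num) (castQ (-1) 3 x)) τ = τ})) := by
    intro b
    induction b using Quot.ind with
    | _ p' => exact factorPlus_mk_eq_mk_iff_atkinLehnerQuotientTwo p' p
  rw [(card_eq_one_iff_of_iff_eq_or_eq₂₂ hF).2.1, ← card_plusFibre_atkinLehnerQuotientTwo_eq_one_iff p,
    (card_eq_one_iff_of_iff_eq_or_eq₂₂ hF).1]

/-- Every fibre of `X₆^{(2)} → X₆⁺` on `Z(t)` has one or two classes (a double cover). [cite: BayerTravesa2007, §2 p. 318] [cite: Ogg1983RealPoints, §2 (2)–(4)] -/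
theorem card_plusFibre_atkinLehnerQuotientTwo_eq_one_or_eq_two {t : ℤ} (c : (Quot (fun p q : {τ : ℂ // 0 < τ.im ∧ ∃ x : ℍ[ℚ,((-1 : ℤ) : ℚ),((3 : ℤ) : ℚ)],
        x ∈ order (-1) 3 ∧ x.re = 0 ∧ (x * star x).re = t ∧ moebius (rho (-1) 3 (by norm_num) (castQ (-1) 3 x)) τ = τ} ↦
      ∃ g : ℍ[ℚ,((-1 : ℤ) : ℚ),((3 : ℤ) : ℚ)], g ≠ 0 ∧
        (∀ a : ℍ[ℚ,((-1 : ℤ) : ℚ),((3 : ℤ) : ℚ)], (a ∈ order (-1) 3 ∨ a - ⟨1/2, 1/2, 1/2, -1/2⟩ ∈ order (-1) 3) →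
          ∃ b : ℍ[ℚ,((-1 : ℤ) : ℚ),((3 : ℤ) : ℚ)], (b ∈ order (-1) 3 ∨ b - ⟨1/2, 1/2, 1/2, -1/2⟩ ∈ order (-1) 3) ∧
            g * a = b * g) ∧
        0 < (g * star g).re ∧ moebius (rho (-1) 3 (by norm_num) (castQ (-1) 3 g)) p.1 = q.1))) :
    Nat.card {b : (Quot (fun p q : {τ : ℂ // 0 < τ.im ∧ ∃ x : ℍ[ℚ,((-1 : ℤ) : ℚ),((3 : ℤ) : ℚ)],
        x ∈ order (-1) 3 ∧ x.re = 0 ∧ (x * star x).re = t ∧ moebius (rho (-1) 3 (by norm_num) (castQ (-1) 3 x)) τ = τ} ↦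
      ∃ g : ℍ[ℚ,((-1 : ℤ) : ℚ),((3 : ℤ) : ℚ)], g ≠ 0 ∧
        (∀ a : ℍ[ℚ,((-1 : ℤ) : ℚ),((3 : ℤ) : ℚ)], (a ∈ order (-1) 3 ∨ a - ⟨1/2, 1/2, 1/2, -1/2⟩ ∈ order (-1) 3) →
          ∃ b : ℍ[ℚ,((-1 : ℤ) : ℚ),((3 : ℤ) : ℚ)], (b ∈ order (-1) 3 ∨ b - ⟨1/2, 1/2, 1/2, -1/2⟩ ∈ order (-1) 3) ∧
            g * a = b * g) ∧
        0 < (g * star g).re ∧ (∃ s : ℚ, (g * star g).re = s ^ 2 ∨ (g * star g).re = 2 * s ^ 2) ∧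
        moebius (rho (-1) 3 (by norm_num) (castQ (-1) 3 g)) p.1 = q.1)) //
      Quot.factor (fun p q : {τ : ℂ // 0 < τ.im ∧ ∃ x : ℍ[ℚ,((-1 : ℤ) : ℚ),((3 : ℤ) : ℚ)],
        x ∈ order (-1) 3 ∧ x.re = 0 ∧ (x * star x).re = t ∧ moebius (rho (-1) 3 (by norm_num) (castQ (-1) 3 x)) τ = τ} ↦
      ∃ g : ℍ[ℚ,((-1 : ℤ) : ℚ),((3 : ℤ) : ℚ)], g ≠ 0 ∧
        (∀ a : ℍ[ℚ,((-1 : ℤ) : ℚ),((3 : ℤ) : ℚ)], (a ∈ order (-1) 3 ∨ a - ⟨1/2, 1/2, 1/2, -1/2⟩ ∈ order (-1) 3) →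
          ∃ b : ℍ[ℚ,((-1 : ℤ) : ℚ),((3 : ℤ) : ℚ)], (b ∈ order (-1) 3 ∨ b - ⟨1/2, 1/2, 1/2, -1/2⟩ ∈ order (-1) 3) ∧
            g * a = b * g) ∧
        0 < (g * star g).re ∧ (∃ s : ℚ, (g * star g).re = s ^ 2 ∨ (g * star g).re = 2 * s ^ 2) ∧
        moebius (rho (-1) 3 (by norm_num) (castQ (-1) 3 g)) p.1 = q.1)
      (fun p q : {τ : ℂ // 0 < τ.im ∧ ∃ x : ℍ[ℚ,((-1 : ℤ) : ℚ),((3 : ℤ) : ℚ)],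
        x ∈ order (-1) 3 ∧ x.re = 0 ∧ (x * star x).re = t ∧ moebius (rho (-1) 3 (by norm_num) (castQ (-1) 3 x)) τ = τ} ↦
      ∃ g : ℍ[ℚ,((-1 : ℤ) : ℚ),((3 : ℤ) : ℚ)], g ≠ 0 ∧
        (∀ a : ℍ[ℚ,((-1 : ℤ) : ℚ),((3 : ℤ) : ℚ)], (a ∈ order (-1) 3 ∨ a - ⟨1/2, 1/2, 1/2, -1/2⟩ ∈ order (-1) 3) →
          ∃ b : ℍ[ℚ,((-1 : ℤ) : ℚ),((3 : ℤ) : ℚ)], (b ∈ order (-1) 3 ∨ b - ⟨1/2, 1/2, 1/2, -1/2⟩ ∈ order (-1) 3) ∧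
            g * a = b * g) ∧
        0 < (g * star g).re ∧ moebius (rho (-1) 3 (by norm_num) (castQ (-1) 3 g)) p.1 = q.1)
      (specialPointsPlus_rel_of_atkinLehnerQuotient_rel t 2) b = c} = 1 ∨
    Nat.card {b : (Quot (fun p q : {τ : ℂ // 0 < τ.im ∧ ∃ x : ℍ[ℚ,((-1 : ℤ) : ℚ),((3 : ℤ) : ℚ)],
        x ∈ order (-1) 3 ∧ x.re = 0 ∧ (x * star x).re = t ∧ moebius (rho (-1) 3 (by norm_num) (castQ (-1) 3 x)) τ = τ} ↦
      ∃ g : ℍ[ℚ,((-1 : ℤ) : ℚ),((3 : ℤ) : ℚ)], g ≠ 0 ∧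
        (∀ a : ℍ[ℚ,((-1 : ℤ) : ℚ),((3 : ℤ) : ℚ)], (a ∈ order (-1) 3 ∨ a - ⟨1/2, 1/2, 1/2, -1/2⟩ ∈ order (-1) 3) →
          ∃ b : ℍ[ℚ,((-1 : ℤ) : ℚ),((3 : ℤ) : ℚ)], (b ∈ order (-1) 3 ∨ b - ⟨1/2, 1/2, 1/2, -1/2⟩ ∈ order (-1) 3) ∧
            g * a = b * g) ∧
        0 < (g * star g).re ∧ (∃ s : ℚ, (g * star g).re = s ^ 2 ∨ (g * star g).re = 2 * s ^ 2) ∧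
        moebius (rho (-1) 3 (by norm_num) (castQ (-1) 3 g)) p.1 = q.1)) //
      Quot.factor (fun p q : {τ : ℂ // 0 < τ.im ∧ ∃ x : ℍ[ℚ,((-1 : ℤ) : ℚ),((3 : ℤ) : ℚ)],
        x ∈ order (-1) 3 ∧ x.re = 0 ∧ (x * star x).re = t ∧ moebius (rho (-1) 3 (by norm_num) (castQ (-1) 3 x)) τ = τ} ↦
      ∃ g : ℍ[ℚ,((-1 : ℤ) : ℚ),((3 : ℤ) : ℚ)], g ≠ 0 ∧
        (∀ a : ℍ[ℚ,((-1 : ℤ) : ℚ),((3 : ℤ) : ℚ)], (a ∈ order (-1) 3 ∨ a - ⟨1/2, 1/2, 1/2, -1/2⟩ ∈ order (-1) 3) →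
          ∃ b : ℍ[ℚ,((-1 : ℤ) : ℚ),((3 : ℤ) : ℚ)], (b ∈ order (-1) 3 ∨ b - ⟨1/2, 1/2, 1/2, -1/2⟩ ∈ order (-1) 3) ∧
            g * a = b * g) ∧
        0 < (g * star g).re ∧ (∃ s : ℚ, (g * star g).re = s ^ 2 ∨ (g * star g).re = 2 * s ^ 2) ∧
        moebius (rho (-1) 3 (by norm_num) (castQ (-1) 3 g)) p.1 = q.1)
      (fun p q : {τ : ℂ // 0 < τ.im ∧ ∃ x : ℍ[ℚ,((-1 : ℤ) : ℚ),((3 : ℤ) : ℚ)],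
        x ∈ order (-1) 3 ∧ x.re = 0 ∧ (x * star x).re = t ∧ moebius (rho (-1) 3 (by norm_num) (castQ (-1) 3 x)) τ = τ} ↦
      ∃ g : ℍ[ℚ,((-1 : ℤ) : ℚ),((3 : ℤ) : ℚ)], g ≠ 0 ∧
        (∀ a : ℍ[ℚ,((-1 : ℤ) : ℚ),((3 : ℤ) : ℚ)], (a ∈ order (-1) 3 ∨ a - ⟨1/2, 1/2, 1/2, -1/2⟩ ∈ order (-1) 3) →
          ∃ b : ℍ[ℚ,((-1 : ℤ) : ℚ),((3 : ℤ) : ℚ)], (b ∈ order (-1) 3 ∨ b - ⟨1/2, 1/2, 1/2, -1/2⟩ ∈ order (-1) 3) ∧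
            g * a = b * g) ∧
        0 < (g * star g).re ∧ moebius (rho (-1) 3 (by norm_num) (castQ (-1) 3 g)) p.1 = q.1)
      (specialPointsPlus_rel_of_atkinLehnerQuotient_rel t 2) b = c} = 2 := by
  induction c using Quot.ind with
  | _ p =>
    have hF : ∀ b : (Quot (fun p q : {τ : ℂ // 0 < τ.im ∧ ∃ x : ℍ[ℚ,((-1 : ℤ) : ℚ),((3 : ℤ) : ℚ)],
        x ∈ order (-1) 3 ∧ x.re = 0 ∧ (x * star x).re = t ∧ moebius (rho (-1) 3 (by norm_num) (castQ (-1) 3 x)) τ = τ} ↦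
      ∃ g : ℍ[ℚ,((-1 : ℤ) : ℚ),((3 : ℤ) : ℚ)], g ≠ 0 ∧
        (∀ a : ℍ[ℚ,((-1 : ℤ) : ℚ),((3 : ℤ) : ℚ)], (a ∈ order (-1) 3 ∨ a - ⟨1/2, 1/2, 1/2, -1/2⟩ ∈ order (-1) 3) →
          ∃ b : ℍ[ℚ,((-1 : ℤ) : ℚ),((3 : ℤ) : ℚ)], (b ∈ order (-1) 3 ∨ b - ⟨1/2, 1/2, 1/2, -1/2⟩ ∈ order (-1) 3) ∧
            g * a = b * g) ∧
        0 < (g * star g).re ∧ (∃ s : ℚ, (g * star g).re = s ^ 2 ∨ (g * star g).re = 2 * s ^ 2) ∧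
        moebius (rho (-1) 3 (by norm_num) (castQ (-1) 3 g)) p.1 = q.1)),
        Quot.factor (fun p q : {τ : ℂ // 0 < τ.im ∧ ∃ x : ℍ[ℚ,((-1 : ℤ) : ℚ),((3 : ℤ) : ℚ)],
        x ∈ order (-1) 3 ∧ x.re = 0 ∧ (x * star x).re = t ∧ moebius (rho (-1) 3 (by norm_num) (castQ (-1) 3 x)) τ = τ} ↦
      ∃ g : ℍ[ℚ,((-1 : ℤ) : ℚ),((3 : ℤ) : ℚ)], g ≠ 0 ∧
        (∀ a : ℍ[ℚ,((-1 : ℤ) : ℚ),((3 : ℤ) : ℚ)], (a ∈ order (-1) 3 ∨ a - ⟨1/2, 1/2, 1/2, -1/2⟩ ∈ order (-1) 3) →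
          ∃ b : ℍ[ℚ,((-1 : ℤ) : ℚ),((3 : ℤ) : ℚ)], (b ∈ order (-1) 3 ∨ b - ⟨1/2, 1/2, 1/2, -1/2⟩ ∈ order (-1) 3) ∧
            g * a = b * g) ∧
        0 < (g * star g).re ∧ (∃ s : ℚ, (g * star g).re = s ^ 2 ∨ (g * star g).re = 2 * s ^ 2) ∧
        moebius (rho (-1) 3 (by norm_num) (castQ (-1) 3 g)) p.1 = q.1)
      (fun p q : {τ : ℂ // 0 < τ.im ∧ ∃ x : ℍ[ℚ,((-1 : ℤ) : ℚ),((3 : ℤ) : ℚ)],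
        x ∈ order (-1) 3 ∧ x.re = 0 ∧ (x * star x).re = t ∧ moebius (rho (-1) 3 (by norm_num) (castQ (-1) 3 x)) τ = τ} ↦
      ∃ g : ℍ[ℚ,((-1 : ℤ) : ℚ),((3 : ℤ) : ℚ)], g ≠ 0 ∧
        (∀ a : ℍ[ℚ,((-1 : ℤ) : ℚ),((3 : ℤ) : ℚ)], (a ∈ order (-1) 3 ∨ a - ⟨1/2, 1/2, 1/2, -1/2⟩ ∈ order (-1) 3) →
          ∃ b : ℍ[ℚ,((-1 : ℤ) : ℚ),((3 : ℤ) : ℚ)], (b ∈ order (-1) 3 ∨ b - ⟨1/2, 1/2, 1/2, -1/2⟩ ∈ order (-1) 3) ∧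
            g * a = b * g) ∧
        0 < (g * star g).re ∧ moebius (rho (-1) 3 (by norm_num) (castQ (-1) 3 g)) p.1 = q.1)
      (specialPointsPlus_rel_of_atkinLehnerQuotient_rel t 2) b = Quot.mk _ p ↔
        (b = Quot.mk _ p ∨ b = Quot.mk _ (⟨moebius (rho (-1) 3 (by norm_num) (castQ (-1) 3 (⟨3, 0, 1, 1⟩ : ℍ[ℚ,((-1 : ℤ) : ℚ),((3 : ℤ) : ℚ)]))) p.1, moebius_mu_mem_specialPoints p.2.1 p.2.2⟩ : {τ : ℂ // 0 < τ.im ∧ ∃ x : ℍ[ℚ,((-1 : ℤ) : ℚ),((3 : ℤ) : ℚ)],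
        x ∈ order (-1) 3 ∧ x.re = 0 ∧ (x * star x).re = t ∧ moebius (rho (-1) 3 (by norm_num) (castQ (-1) 3 x)) τ = τ})) := by
      intro b
      induction b using Quot.ind with
      | _ p' => exact factorPlus_mk_eq_mk_iff_atkinLehnerQuotientTwo p' p
    exact (card_eq_one_iff_of_iff_eq_or_eq₂₂ hF).2.2

/-- **CLASS EQUATION OF `X₆^{(2)} → X₆⁺` ON `Z(t)`** (`t > 0`): `#(Pt(t)/Γ₆^{(2)}) + #{one-class fibres} = 2·#(Pt(t)/Γ₆⁺)`.
[cite: BayerTravesa2007, §2 p. 318 and §7] [cite: Ogg1983RealPoints, §2 (3)–(4)] -/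
theorem card_atkinLehnerQuotientTwo_add_card_onePlusFibres_eq_two_mul_card_specialPointsPlus {t : ℤ} (ht : 0 < t) :
    Nat.card (Quot (fun p q : {τ : ℂ // 0 < τ.im ∧ ∃ x : ℍ[ℚ,((-1 : ℤ) : ℚ),((3 : ℤ) : ℚ)],
        x ∈ order (-1) 3 ∧ x.re = 0 ∧ (x * star x).re = t ∧ moebius (rho (-1) 3 (by norm_num) (castQ (-1) 3 x)) τ = τ} ↦
      ∃ g : ℍ[ℚ,((-1 : ℤ) : ℚ),((3 : ℤ) : ℚ)], g ≠ 0 ∧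
        (∀ a : ℍ[ℚ,((-1 : ℤ) : ℚ),((3 : ℤ) : ℚ)], (a ∈ order (-1) 3 ∨ a - ⟨1/2, 1/2, 1/2, -1/2⟩ ∈ order (-1) 3) →
          ∃ b : ℍ[ℚ,((-1 : ℤ) : ℚ),((3 : ℤ) : ℚ)], (b ∈ order (-1) 3 ∨ b - ⟨1/2, 1/2, 1/2, -1/2⟩ ∈ order (-1) 3) ∧
            g * a = b * g) ∧
        0 < (g * star g).re ∧ (∃ s : ℚ, (g * star g).re = s ^ 2 ∨ (g * star g).re = 2 * s ^ 2) ∧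
        moebius (rho (-1) 3 (by norm_num) (castQ (-1) 3 g)) p.1 = q.1)) +
    Nat.card {c : (Quot (fun p q : {τ : ℂ // 0 < τ.im ∧ ∃ x : ℍ[ℚ,((-1 : ℤ) : ℚ),((3 : ℤ) : ℚ)],
        x ∈ order (-1) 3 ∧ x.re = 0 ∧ (x * star x).re = t ∧ moebius (rho (-1) 3 (by norm_num) (castQ (-1) 3 x)) τ = τ} ↦
      ∃ g : ℍ[ℚ,((-1 : ℤ) : ℚ),((3 : ℤ) : ℚ)], g ≠ 0 ∧
        (∀ a : ℍ[ℚ,((-1 : ℤ) : ℚ),((3 : ℤ) : ℚ)], (a ∈ order (-1) 3 ∨ a - ⟨1/2, 1/2, 1/2, -1/2⟩ ∈ order (-1) 3) →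
          ∃ b : ℍ[ℚ,((-1 : ℤ) : ℚ),((3 : ℤ) : ℚ)], (b ∈ order (-1) 3 ∨ b - ⟨1/2, 1/2, 1/2, -1/2⟩ ∈ order (-1) 3) ∧
            g * a = b * g) ∧
        0 < (g * star g).re ∧ moebius (rho (-1) 3 (by norm_num) (castQ (-1) 3 g)) p.1 = q.1)) //
      Nat.card {b : (Quot (fun p q : {τ : ℂ // 0 < τ.im ∧ ∃ x : ℍ[ℚ,((-1 : ℤ) : ℚ),((3 : ℤ) : ℚ)],
        x ∈ order (-1) 3 ∧ x.re = 0 ∧ (x * star x).re = t ∧ moebius (rho (-1) 3 (by norm_num) (castQ (-1) 3 x)) τ = τ} ↦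
      ∃ g : ℍ[ℚ,((-1 : ℤ) : ℚ),((3 : ℤ) : ℚ)], g ≠ 0 ∧
        (∀ a : ℍ[ℚ,((-1 : ℤ) : ℚ),((3 : ℤ) : ℚ)], (a ∈ order (-1) 3 ∨ a - ⟨1/2, 1/2, 1/2, -1/2⟩ ∈ order (-1) 3) →
          ∃ b : ℍ[ℚ,((-1 : ℤ) : ℚ),((3 : ℤ) : ℚ)], (b ∈ order (-1) 3 ∨ b - ⟨1/2, 1/2, 1/2, -1/2⟩ ∈ order (-1) 3) ∧
            g * a = b * g) ∧
        0 < (g * star g).re ∧ (∃ s : ℚ, (g * star g).re = s ^ 2 ∨ (g * star g).re = 2 * s ^ 2) ∧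
        moebius (rho (-1) 3 (by norm_num) (castQ (-1) 3 g)) p.1 = q.1)) //
        Quot.factor (fun p q : {τ : ℂ // 0 < τ.im ∧ ∃ x : ℍ[ℚ,((-1 : ℤ) : ℚ),((3 : ℤ) : ℚ)],
        x ∈ order (-1) 3 ∧ x.re = 0 ∧ (x * star x).re = t ∧ moebius (rho (-1) 3 (by norm_num) (castQ (-1) 3 x)) τ = τ} ↦
      ∃ g : ℍ[ℚ,((-1 : ℤ) : ℚ),((3 : ℤ) : ℚ)], g ≠ 0 ∧
        (∀ a : ℍ[ℚ,((-1 : ℤ) : ℚ),((3 : ℤ) : ℚ)], (a ∈ order (-1) 3 ∨ a - ⟨1/2, 1/2, 1/2, -1/2⟩ ∈ order (-1) 3) →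
          ∃ b : ℍ[ℚ,((-1 : ℤ) : ℚ),((3 : ℤ) : ℚ)], (b ∈ order (-1) 3 ∨ b - ⟨1/2, 1/2, 1/2, -1/2⟩ ∈ order (-1) 3) ∧
            g * a = b * g) ∧
        0 < (g * star g).re ∧ (∃ s : ℚ, (g * star g).re = s ^ 2 ∨ (g * star g).re = 2 * s ^ 2) ∧
        moebius (rho (-1) 3 (by norm_num) (castQ (-1) 3 g)) p.1 = q.1)
      (fun p q : {τ : ℂ // 0 < τ.im ∧ ∃ x : ℍ[ℚ,((-1 : ℤ) : ℚ),((3 : ℤ) : ℚ)],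
        x ∈ order (-1) 3 ∧ x.re = 0 ∧ (x * star x).re = t ∧ moebius (rho (-1) 3 (by norm_num) (castQ (-1) 3 x)) τ = τ} ↦
      ∃ g : ℍ[ℚ,((-1 : ℤ) : ℚ),((3 : ℤ) : ℚ)], g ≠ 0 ∧
        (∀ a : ℍ[ℚ,((-1 : ℤ) : ℚ),((3 : ℤ) : ℚ)], (a ∈ order (-1) 3 ∨ a - ⟨1/2, 1/2, 1/2, -1/2⟩ ∈ order (-1) 3) →
          ∃ b : ℍ[ℚ,((-1 : ℤ) : ℚ),((3 : ℤ) : ℚ)], (b ∈ order (-1) 3 ∨ b - ⟨1/2, 1/2, 1/2, -1/2⟩ ∈ order (-1) 3) ∧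
            g * a = b * g) ∧
        0 < (g * star g).re ∧ moebius (rho (-1) 3 (by norm_num) (castQ (-1) 3 g)) p.1 = q.1)
      (specialPointsPlus_rel_of_atkinLehnerQuotient_rel t 2) b = c} = 1} =
    2 * Nat.card (Quot (fun p q : {τ : ℂ // 0 < τ.im ∧ ∃ x : ℍ[ℚ,((-1 : ℤ) : ℚ),((3 : ℤ) : ℚ)],
        x ∈ order (-1) 3 ∧ x.re = 0 ∧ (x * star x).re = t ∧ moebius (rho (-1) 3 (by norm_num) (castQ (-1) 3 x)) τ = τ} ↦
      ∃ g : ℍ[ℚ,((-1 : ℤ) : ℚ),((3 : ℤ) : ℚ)], g ≠ 0 ∧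
        (∀ a : ℍ[ℚ,((-1 : ℤ) : ℚ),((3 : ℤ) : ℚ)], (a ∈ order (-1) 3 ∨ a - ⟨1/2, 1/2, 1/2, -1/2⟩ ∈ order (-1) 3) →
          ∃ b : ℍ[ℚ,((-1 : ℤ) : ℚ),((3 : ℤ) : ℚ)], (b ∈ order (-1) 3 ∨ b - ⟨1/2, 1/2, 1/2, -1/2⟩ ∈ order (-1) 3) ∧
            g * a = b * g) ∧
        0 < (g * star g).re ∧ moebius (rho (-1) 3 (by norm_num) (castQ (-1) 3 g)) p.1 = q.1)) := by
  haveI := finite_atkinLehnerQuotient ht 2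
  haveI := finite_specialPointsPlus ht
  exact card_add_card_eq_two_mul₂₂ _ card_plusFibre_atkinLehnerQuotientTwo_eq_one_or_eq_two

/-- **THE FIBRE OF `X₆^{(3)} → X₆⁺` THROUGH `[τ]₃` ON `Z(t)` IS `{[τ]₃, [ρ(w₂)τ]₃}`**: the `W/⟨ω₃⟩ ≅ ℤ/2ℤ`-orbit of
`[τ]₃`. [cite: BayerTravesa2007, §2 p. 318 («`X₆^{(3)} = X₆/⟨ω₃⟩` … `X₆⁺ = X₆/W`»)] [cite: Ogg1983RealPoints, §2 (2)–(3)] -/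
theorem factorPlus_mk_eq_mk_iff_atkinLehnerQuotientThree {t : ℤ} (p' p : {τ : ℂ // 0 < τ.im ∧ ∃ x : ℍ[ℚ,((-1 : ℤ) : ℚ),((3 : ℤ) : ℚ)],
        x ∈ order (-1) 3 ∧ x.re = 0 ∧ (x * star x).re = t ∧ moebius (rho (-1) 3 (by norm_num) (castQ (-1) 3 x)) τ = τ}) :
    Quot.factor (fun p q : {τ : ℂ // 0 < τ.im ∧ ∃ x : ℍ[ℚ,((-1 : ℤ) : ℚ),((3 : ℤ) : ℚ)],
        x ∈ order (-1) 3 ∧ x.re = 0 ∧ (x * star x).re = t ∧ moebius (rho (-1) 3 (by norm_num) (castQ (-1) 3 x)) τ = τ} ↦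
      ∃ g : ℍ[ℚ,((-1 : ℤ) : ℚ),((3 : ℤ) : ℚ)], g ≠ 0 ∧
        (∀ a : ℍ[ℚ,((-1 : ℤ) : ℚ),((3 : ℤ) : ℚ)], (a ∈ order (-1) 3 ∨ a - ⟨1/2, 1/2, 1/2, -1/2⟩ ∈ order (-1) 3) →
          ∃ b : ℍ[ℚ,((-1 : ℤ) : ℚ),((3 : ℤ) : ℚ)], (b ∈ order (-1) 3 ∨ b - ⟨1/2, 1/2, 1/2, -1/2⟩ ∈ order (-1) 3) ∧
            g * a = b * g) ∧
        0 < (g * star g).re ∧ (∃ s : ℚ, (g * star g).re = s ^ 2 ∨ (g * star g).re = 3 * s ^ 2) ∧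
        moebius (rho (-1) 3 (by norm_num) (castQ (-1) 3 g)) p.1 = q.1)
      (fun p q : {τ : ℂ // 0 < τ.im ∧ ∃ x : ℍ[ℚ,((-1 : ℤ) : ℚ),((3 : ℤ) : ℚ)],
        x ∈ order (-1) 3 ∧ x.re = 0 ∧ (x * star x).re = t ∧ moebius (rho (-1) 3 (by norm_num) (castQ (-1) 3 x)) τ = τ} ↦
      ∃ g : ℍ[ℚ,((-1 : ℤ) : ℚ),((3 : ℤ) : ℚ)], g ≠ 0 ∧
        (∀ a : ℍ[ℚ,((-1 : ℤ) : ℚ),((3 : ℤ) : ℚ)], (a ∈ order (-1) 3 ∨ a - ⟨1/2, 1/2, 1/2, -1/2⟩ ∈ order (-1) 3) →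
          ∃ b : ℍ[ℚ,((-1 : ℤ) : ℚ),((3 : ℤ) : ℚ)], (b ∈ order (-1) 3 ∨ b - ⟨1/2, 1/2, 1/2, -1/2⟩ ∈ order (-1) 3) ∧
            g * a = b * g) ∧
        0 < (g * star g).re ∧ moebius (rho (-1) 3 (by norm_num) (castQ (-1) 3 g)) p.1 = q.1)
      (specialPointsPlus_rel_of_atkinLehnerQuotient_rel t 3) (Quot.mk _ p') = Quot.mk _ p ↔
    (Quot.mk (fun p q : {τ : ℂ // 0 < τ.im ∧ ∃ x : ℍ[ℚ,((-1 : ℤ) : ℚ),((3 : ℤ) : ℚ)],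
        x ∈ order (-1) 3 ∧ x.re = 0 ∧ (x * star x).re = t ∧ moebius (rho (-1) 3 (by norm_num) (castQ (-1) 3 x)) τ = τ} ↦
      ∃ g : ℍ[ℚ,((-1 : ℤ) : ℚ),((3 : ℤ) : ℚ)], g ≠ 0 ∧
        (∀ a : ℍ[ℚ,((-1 : ℤ) : ℚ),((3 : ℤ) : ℚ)], (a ∈ order (-1) 3 ∨ a - ⟨1/2, 1/2, 1/2, -1/2⟩ ∈ order (-1) 3) →
          ∃ b : ℍ[ℚ,((-1 : ℤ) : ℚ),((3 : ℤ) : ℚ)], (b ∈ order (-1) 3 ∨ b - ⟨1/2, 1/2, 1/2, -1/2⟩ ∈ order (-1) 3) ∧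
            g * a = b * g) ∧
        0 < (g * star g).re ∧ (∃ s : ℚ, (g * star g).re = s ^ 2 ∨ (g * star g).re = 3 * s ^ 2) ∧
        moebius (rho (-1) 3 (by norm_num) (castQ (-1) 3 g)) p.1 = q.1) p' = Quot.mk _ p ∨
      Quot.mk (fun p q : {τ : ℂ // 0 < τ.im ∧ ∃ x : ℍ[ℚ,((-1 : ℤ) : ℚ),((3 : ℤ) : ℚ)],
        x ∈ order (-1) 3 ∧ x.re = 0 ∧ (x * star x).re = t ∧ moebius (rho (-1) 3 (by norm_num) (castQ (-1) 3 x)) τ = τ} ↦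
      ∃ g : ℍ[ℚ,((-1 : ℤ) : ℚ),((3 : ℤ) : ℚ)], g ≠ 0 ∧
        (∀ a : ℍ[ℚ,((-1 : ℤ) : ℚ),((3 : ℤ) : ℚ)], (a ∈ order (-1) 3 ∨ a - ⟨1/2, 1/2, 1/2, -1/2⟩ ∈ order (-1) 3) →
          ∃ b : ℍ[ℚ,((-1 : ℤ) : ℚ),((3 : ℤ) : ℚ)], (b ∈ order (-1) 3 ∨ b - ⟨1/2, 1/2, 1/2, -1/2⟩ ∈ order (-1) 3) ∧
            g * a = b * g) ∧
        0 < (g * star g).re ∧ (∃ s : ℚ, (g * star g).re = s ^ 2 ∨ (g * star g).re = 3 * s ^ 2) ∧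
        moebius (rho (-1) 3 (by norm_num) (castQ (-1) 3 g)) p.1 = q.1) p' = Quot.mk _ (⟨moebius (rho (-1) 3 (by norm_num) (castQ (-1) 3 (⟨1, 1, 0, 0⟩ : ℍ[ℚ,((-1 : ℤ) : ℚ),((3 : ℤ) : ℚ)]))) p.1, moebius_w2_mem_specialPoints p.2.1 p.2.2⟩ : {τ : ℂ // 0 < τ.im ∧ ∃ x : ℍ[ℚ,((-1 : ℤ) : ℚ),((3 : ℤ) : ℚ)],
        x ∈ order (-1) 3 ∧ x.re = 0 ∧ (x * star x).re = t ∧ moebius (rho (-1) 3 (by norm_num) (castQ (-1) 3 x)) τ = τ})) := by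
  have hiffP := specialPointsPlus_mk_eq_iff t
  have hiffD := atkinLehnerQuotient_mk_eq_iff t 3
  have hEP := specialPointsPlus_equivalence t
  have hDP := specialPointsPlus_rel_of_atkinLehnerQuotient_rel t 3
  have h1O : ((1 : ℍ[ℚ,((-1 : ℤ) : ℚ),((3 : ℤ) : ℚ)]) ∈ order (-1) 3 ∨ (1 : ℍ[ℚ,((-1 : ℤ) : ℚ),((3 : ℤ) : ℚ)]) - ⟨1/2, 1/2, 1/2, -1/2⟩ ∈ order (-1) 3) := Or.inl (Subring.one_mem _)
  have h11 : (1 : ℍ[ℚ,((-1 : ℤ) : ℚ),((3 : ℤ) : ℚ)]) * star 1 = 1 := by rw [star_one, mul_one]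
  -- `[r]₃ = [ρ(μ) r]₃` and `S`-classes map to `Γ₆^{(3)}`-classes
  have DW : ∀ r : {τ : ℂ // 0 < τ.im ∧ ∃ x : ℍ[ℚ,((-1 : ℤ) : ℚ),((3 : ℤ) : ℚ)],
        x ∈ order (-1) 3 ∧ x.re = 0 ∧ (x * star x).re = t ∧ moebius (rho (-1) 3 (by norm_num) (castQ (-1) 3 x)) τ = τ}, Quot.mk (fun p q : {τ : ℂ // 0 < τ.im ∧ ∃ x : ℍ[ℚ,((-1 : ℤ) : ℚ),((3 : ℤ) : ℚ)],
        x ∈ order (-1) 3 ∧ x.re = 0 ∧ (x * star x).re = t ∧ moebius (rho (-1) 3 (by norm_num) (castQ (-1) 3 x)) τ = τ} ↦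
      ∃ g : ℍ[ℚ,((-1 : ℤ) : ℚ),((3 : ℤ) : ℚ)], g ≠ 0 ∧
        (∀ a : ℍ[ℚ,((-1 : ℤ) : ℚ),((3 : ℤ) : ℚ)], (a ∈ order (-1) 3 ∨ a - ⟨1/2, 1/2, 1/2, -1/2⟩ ∈ order (-1) 3) →
          ∃ b : ℍ[ℚ,((-1 : ℤ) : ℚ),((3 : ℤ) : ℚ)], (b ∈ order (-1) 3 ∨ b - ⟨1/2, 1/2, 1/2, -1/2⟩ ∈ order (-1) 3) ∧
            g * a = b * g) ∧
        0 < (g * star g).re ∧ (∃ s : ℚ, (g * star g).re = s ^ 2 ∨ (g * star g).re = 3 * s ^ 2) ∧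
        moebius (rho (-1) 3 (by norm_num) (castQ (-1) 3 g)) p.1 = q.1) r = Quot.mk _ (⟨moebius (rho (-1) 3 (by norm_num) (castQ (-1) 3 (⟨3, 0, 1, 1⟩ : ℍ[ℚ,((-1 : ℤ) : ℚ),((3 : ℤ) : ℚ)]))) r.1, moebius_mu_mem_specialPoints r.2.1 r.2.2⟩ : {τ : ℂ // 0 < τ.im ∧ ∃ x : ℍ[ℚ,((-1 : ℤ) : ℚ),((3 : ℤ) : ℚ)],
        x ∈ order (-1) 3 ∧ x.re = 0 ∧ (x * star x).re = t ∧ moebius (rho (-1) 3 (by norm_num) (castQ (-1) 3 x)) τ = τ}) := fun r ↦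
    (hiffD _ _).2 ((atkinLehnerQuotientThree_rel_iff _ _).2 ⟨1, h1O, h11, Or.inr (moebius_rho_castQ_one_apply _)⟩)
  have DS : ∀ r r' : {τ : ℂ // 0 < τ.im ∧ ∃ x : ℍ[ℚ,((-1 : ℤ) : ℚ),((3 : ℤ) : ℚ)],
        x ∈ order (-1) 3 ∧ x.re = 0 ∧ (x * star x).re = t ∧ moebius (rho (-1) 3 (by norm_num) (castQ (-1) 3 x)) τ = τ}, Quot.mk (fun p q : {τ : ℂ // 0 < τ.im ∧ ∃ x : ℍ[ℚ,((-1 : ℤ) : ℚ),((3 : ℤ) : ℚ)],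
        x ∈ order (-1) 3 ∧ x.re = 0 ∧ (x * star x).re = t ∧ moebius (rho (-1) 3 (by norm_num) (castQ (-1) 3 x)) τ = τ} ↦
      ∃ v : ℍ[ℚ,((-1 : ℤ) : ℚ),((3 : ℤ) : ℚ)], (v ∈ order (-1) 3 ∨ v - ⟨1/2, 1/2, 1/2, -1/2⟩ ∈ order (-1) 3) ∧
        v * star v = 1 ∧ moebius (rho (-1) 3 (by norm_num) (castQ (-1) 3 v)) p.1 = q.1) r = Quot.mk _ r' → Quot.mk (fun p q : {τ : ℂ // 0 < τ.im ∧ ∃ x : ℍ[ℚ,((-1 : ℤ) : ℚ),((3 : ℤ) : ℚ)],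
        x ∈ order (-1) 3 ∧ x.re = 0 ∧ (x * star x).re = t ∧ moebius (rho (-1) 3 (by norm_num) (castQ (-1) 3 x)) τ = τ} ↦
      ∃ g : ℍ[ℚ,((-1 : ℤ) : ℚ),((3 : ℤ) : ℚ)], g ≠ 0 ∧
        (∀ a : ℍ[ℚ,((-1 : ℤ) : ℚ),((3 : ℤ) : ℚ)], (a ∈ order (-1) 3 ∨ a - ⟨1/2, 1/2, 1/2, -1/2⟩ ∈ order (-1) 3) →
          ∃ b : ℍ[ℚ,((-1 : ℤ) : ℚ),((3 : ℤ) : ℚ)], (b ∈ order (-1) 3 ∨ b - ⟨1/2, 1/2, 1/2, -1/2⟩ ∈ order (-1) 3) ∧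
            g * a = b * g) ∧
        0 < (g * star g).re ∧ (∃ s : ℚ, (g * star g).re = s ^ 2 ∨ (g * star g).re = 3 * s ^ 2) ∧
        moebius (rho (-1) 3 (by norm_num) (castQ (-1) 3 g)) p.1 = q.1) r = Quot.mk _ r' := fun r r' h ↦
    (hiffD _ _).2 (atkinLehnerQuotient_rel_of_specialPoints_rel t 3 _ _ ((specialPoints_mk_eq_iff t _ _).1 h))
  have PO : Quot.mk (fun p q : {τ : ℂ // 0 < τ.im ∧ ∃ x : ℍ[ℚ,((-1 : ℤ) : ℚ),((3 : ℤ) : ℚ)],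
        x ∈ order (-1) 3 ∧ x.re = 0 ∧ (x * star x).re = t ∧ moebius (rho (-1) 3 (by norm_num) (castQ (-1) 3 x)) τ = τ} ↦
      ∃ g : ℍ[ℚ,((-1 : ℤ) : ℚ),((3 : ℤ) : ℚ)], g ≠ 0 ∧
        (∀ a : ℍ[ℚ,((-1 : ℤ) : ℚ),((3 : ℤ) : ℚ)], (a ∈ order (-1) 3 ∨ a - ⟨1/2, 1/2, 1/2, -1/2⟩ ∈ order (-1) 3) →
          ∃ b : ℍ[ℚ,((-1 : ℤ) : ℚ),((3 : ℤ) : ℚ)], (b ∈ order (-1) 3 ∨ b - ⟨1/2, 1/2, 1/2, -1/2⟩ ∈ order (-1) 3) ∧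
            g * a = b * g) ∧
        0 < (g * star g).re ∧ moebius (rho (-1) 3 (by norm_num) (castQ (-1) 3 g)) p.1 = q.1) (⟨moebius (rho (-1) 3 (by norm_num) (castQ (-1) 3 (⟨1, 1, 0, 0⟩ : ℍ[ℚ,((-1 : ℤ) : ℚ),((3 : ℤ) : ℚ)]))) p.1, moebius_w2_mem_specialPoints p.2.1 p.2.2⟩ : {τ : ℂ // 0 < τ.im ∧ ∃ x : ℍ[ℚ,((-1 : ℤ) : ℚ),((3 : ℤ) : ℚ)],
        x ∈ order (-1) 3 ∧ x.re = 0 ∧ (x * star x).re = t ∧ moebius (rho (-1) 3 (by norm_num) (castQ (-1) 3 x)) τ = τ}) = Quot.mk _ p :=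
    ((factor_mk_eq_mk_iff_specialPointsPlus _ p).2 (Or.inr (Or.inl rfl)))
  show Quot.mk _ p' = Quot.mk _ p ↔ _
  constructor
  · intro h
    have h4 := (factor_mk_eq_mk_iff_specialPointsPlus p' p).1 h
    rcases h4 with h4 | h4 | h4 | h4
    · exact Or.inl (DS _ _ h4)
    · exact Or.inr (DS _ _ h4)
    · exact Or.inl ((DS _ _ h4).trans (DW p).symm)
    · right
      rw [DS _ _ (h4.trans (specialPoints_mk_klein p).2.2.1), ← DW]
  · rintro (h | h)
    · exact (hiffP _ _).2 (hDP _ _ ((hiffD _ _).1 h))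
    · rw [← PO]
      exact (hiffP _ _).2 (hDP _ _ ((hiffD _ _).1 h))

/-- **ONE CLASS IN THE FIBRE OF `X₆^{(3)} → X₆⁺` EXACTLY AT THE `Z(1)`- AND `Z(6)`-POINTS**: `[ρ(w₂)τ]₃ = [τ]₃ ⟺
ρ(w₂)τ ∼_{Γ₆} τ` or `ρ(μ)ρ(w₂)τ ∼_{Γ₆} τ ⟺ τ ∈ Pt(1) ∪ Pt(6)` — on `Z(t)` the cover `X₆^{(3)} → X₆⁺` ramifies exactly over
the images of the fixed points of the two OTHER involutions. [cite: BayerTravesa2007, §7 p. 332 («`P₀` is an elliptic point for `X₆^{(6)}` and `X₆⁺`, but it is not elliptic for `X₆`, `X₆^{(2)}` and `X₆^{(3)}`») and Table 9] [cite: Ogg1983RealPoints, §2 pp. 283–284] -/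
theorem card_plusFibre_atkinLehnerQuotientThree_eq_one_iff {t : ℤ} (p : {τ : ℂ // 0 < τ.im ∧ ∃ x : ℍ[ℚ,((-1 : ℤ) : ℚ),((3 : ℤ) : ℚ)],
        x ∈ order (-1) 3 ∧ x.re = 0 ∧ (x * star x).re = t ∧ moebius (rho (-1) 3 (by norm_num) (castQ (-1) 3 x)) τ = τ}) :
    Nat.card {b : (Quot (fun p q : {τ : ℂ // 0 < τ.im ∧ ∃ x : ℍ[ℚ,((-1 : ℤ) : ℚ),((3 : ℤ) : ℚ)],
        x ∈ order (-1) 3 ∧ x.re = 0 ∧ (x * star x).re = t ∧ moebius (rho (-1) 3 (by norm_num) (castQ (-1) 3 x)) τ = τ} ↦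
      ∃ g : ℍ[ℚ,((-1 : ℤ) : ℚ),((3 : ℤ) : ℚ)], g ≠ 0 ∧
        (∀ a : ℍ[ℚ,((-1 : ℤ) : ℚ),((3 : ℤ) : ℚ)], (a ∈ order (-1) 3 ∨ a - ⟨1/2, 1/2, 1/2, -1/2⟩ ∈ order (-1) 3) →
          ∃ b : ℍ[ℚ,((-1 : ℤ) : ℚ),((3 : ℤ) : ℚ)], (b ∈ order (-1) 3 ∨ b - ⟨1/2, 1/2, 1/2, -1/2⟩ ∈ order (-1) 3) ∧
            g * a = b * g) ∧
        0 < (g * star g).re ∧ (∃ s : ℚ, (g * star g).re = s ^ 2 ∨ (g * star g).re = 3 * s ^ 2) ∧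
        moebius (rho (-1) 3 (by norm_num) (castQ (-1) 3 g)) p.1 = q.1)) //
      Quot.factor (fun p q : {τ : ℂ // 0 < τ.im ∧ ∃ x : ℍ[ℚ,((-1 : ℤ) : ℚ),((3 : ℤ) : ℚ)],
        x ∈ order (-1) 3 ∧ x.re = 0 ∧ (x * star x).re = t ∧ moebius (rho (-1) 3 (by norm_num) (castQ (-1) 3 x)) τ = τ} ↦
      ∃ g : ℍ[ℚ,((-1 : ℤ) : ℚ),((3 : ℤ) : ℚ)], g ≠ 0 ∧
        (∀ a : ℍ[ℚ,((-1 : ℤ) : ℚ),((3 : ℤ) : ℚ)], (a ∈ order (-1) 3 ∨ a - ⟨1/2, 1/2, 1/2, -1/2⟩ ∈ order (-1) 3) →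
          ∃ b : ℍ[ℚ,((-1 : ℤ) : ℚ),((3 : ℤ) : ℚ)], (b ∈ order (-1) 3 ∨ b - ⟨1/2, 1/2, 1/2, -1/2⟩ ∈ order (-1) 3) ∧
            g * a = b * g) ∧
        0 < (g * star g).re ∧ (∃ s : ℚ, (g * star g).re = s ^ 2 ∨ (g * star g).re = 3 * s ^ 2) ∧
        moebius (rho (-1) 3 (by norm_num) (castQ (-1) 3 g)) p.1 = q.1)
      (fun p q : {τ : ℂ // 0 < τ.im ∧ ∃ x : ℍ[ℚ,((-1 : ℤ) : ℚ),((3 : ℤ) : ℚ)],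
        x ∈ order (-1) 3 ∧ x.re = 0 ∧ (x * star x).re = t ∧ moebius (rho (-1) 3 (by norm_num) (castQ (-1) 3 x)) τ = τ} ↦
      ∃ g : ℍ[ℚ,((-1 : ℤ) : ℚ),((3 : ℤ) : ℚ)], g ≠ 0 ∧
        (∀ a : ℍ[ℚ,((-1 : ℤ) : ℚ),((3 : ℤ) : ℚ)], (a ∈ order (-1) 3 ∨ a - ⟨1/2, 1/2, 1/2, -1/2⟩ ∈ order (-1) 3) →
          ∃ b : ℍ[ℚ,((-1 : ℤ) : ℚ),((3 : ℤ) : ℚ)], (b ∈ order (-1) 3 ∨ b - ⟨1/2, 1/2, 1/2, -1/2⟩ ∈ order (-1) 3) ∧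
            g * a = b * g) ∧
        0 < (g * star g).re ∧ moebius (rho (-1) 3 (by norm_num) (castQ (-1) 3 g)) p.1 = q.1)
      (specialPointsPlus_rel_of_atkinLehnerQuotient_rel t 3) b = Quot.mk _ p} = 1 ↔
    ((∃ y : ℍ[ℚ,((-1 : ℤ) : ℚ),((3 : ℤ) : ℚ)], y ∈ order (-1) 3 ∧ y.re = 0 ∧ (y * star y).re = 1 ∧
        moebius (rho (-1) 3 (by norm_num) (castQ (-1) 3 y)) p.1 = p.1) ∨
      (∃ y : ℍ[ℚ,((-1 : ℤ) : ℚ),((3 : ℤ) : ℚ)], y ∈ order (-1) 3 ∧ y.re = 0 ∧ (y * star y).re = 6 ∧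
        moebius (rho (-1) 3 (by norm_num) (castQ (-1) 3 y)) p.1 = p.1)) := by
  have hF : ∀ b : (Quot (fun p q : {τ : ℂ // 0 < τ.im ∧ ∃ x : ℍ[ℚ,((-1 : ℤ) : ℚ),((3 : ℤ) : ℚ)],
        x ∈ order (-1) 3 ∧ x.re = 0 ∧ (x * star x).re = t ∧ moebius (rho (-1) 3 (by norm_num) (castQ (-1) 3 x)) τ = τ} ↦
      ∃ g : ℍ[ℚ,((-1 : ℤ) : ℚ),((3 : ℤ) : ℚ)], g ≠ 0 ∧
        (∀ a : ℍ[ℚ,((-1 : ℤ) : ℚ),((3 : ℤ) : ℚ)], (a ∈ order (-1) 3 ∨ a - ⟨1/2, 1/2, 1/2, -1/2⟩ ∈ order (-1) 3) →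
          ∃ b : ℍ[ℚ,((-1 : ℤ) : ℚ),((3 : ℤ) : ℚ)], (b ∈ order (-1) 3 ∨ b - ⟨1/2, 1/2, 1/2, -1/2⟩ ∈ order (-1) 3) ∧
            g * a = b * g) ∧
        0 < (g * star g).re ∧ (∃ s : ℚ, (g * star g).re = s ^ 2 ∨ (g * star g).re = 3 * s ^ 2) ∧
        moebius (rho (-1) 3 (by norm_num) (castQ (-1) 3 g)) p.1 = q.1)),
      Quot.factor (fun p q : {τ : ℂ // 0 < τ.im ∧ ∃ x : ℍ[ℚ,((-1 : ℤ) : ℚ),((3 : ℤ) : ℚ)],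
        x ∈ order (-1) 3 ∧ x.re = 0 ∧ (x * star x).re = t ∧ moebius (rho (-1) 3 (by norm_num) (castQ (-1) 3 x)) τ = τ} ↦
      ∃ g : ℍ[ℚ,((-1 : ℤ) : ℚ),((3 : ℤ) : ℚ)], g ≠ 0 ∧
        (∀ a : ℍ[ℚ,((-1 : ℤ) : ℚ),((3 : ℤ) : ℚ)], (a ∈ order (-1) 3 ∨ a - ⟨1/2, 1/2, 1/2, -1/2⟩ ∈ order (-1) 3) →
          ∃ b : ℍ[ℚ,((-1 : ℤ) : ℚ),((3 : ℤ) : ℚ)], (b ∈ order (-1) 3 ∨ b - ⟨1/2, 1/2, 1/2, -1/2⟩ ∈ order (-1) 3) ∧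
            g * a = b * g) ∧
        0 < (g * star g).re ∧ (∃ s : ℚ, (g * star g).re = s ^ 2 ∨ (g * star g).re = 3 * s ^ 2) ∧
        moebius (rho (-1) 3 (by norm_num) (castQ (-1) 3 g)) p.1 = q.1)
      (fun p q : {τ : ℂ // 0 < τ.im ∧ ∃ x : ℍ[ℚ,((-1 : ℤ) : ℚ),((3 : ℤ) : ℚ)],
        x ∈ order (-1) 3 ∧ x.re = 0 ∧ (x * star x).re = t ∧ moebius (rho (-1) 3 (by norm_num) (castQ (-1) 3 x)) τ = τ} ↦
      ∃ g : ℍ[ℚ,((-1 : ℤ) : ℚ),((3 : ℤ) : ℚ)], g ≠ 0 ∧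
        (∀ a : ℍ[ℚ,((-1 : ℤ) : ℚ),((3 : ℤ) : ℚ)], (a ∈ order (-1) 3 ∨ a - ⟨1/2, 1/2, 1/2, -1/2⟩ ∈ order (-1) 3) →
          ∃ b : ℍ[ℚ,((-1 : ℤ) : ℚ),((3 : ℤ) : ℚ)], (b ∈ order (-1) 3 ∨ b - ⟨1/2, 1/2, 1/2, -1/2⟩ ∈ order (-1) 3) ∧
            g * a = b * g) ∧
        0 < (g * star g).re ∧ moebius (rho (-1) 3 (by norm_num) (castQ (-1) 3 g)) p.1 = q.1)
      (specialPointsPlus_rel_of_atkinLehnerQuotient_rel t 3) b = Quot.mk _ p ↔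
      (b = Quot.mk _ p ∨ b = Quot.mk _ (⟨moebius (rho (-1) 3 (by norm_num) (castQ (-1) 3 (⟨1, 1, 0, 0⟩ : ℍ[ℚ,((-1 : ℤ) : ℚ),((3 : ℤ) : ℚ)]))) p.1, moebius_w2_mem_specialPoints p.2.1 p.2.2⟩ : {τ : ℂ // 0 < τ.im ∧ ∃ x : ℍ[ℚ,((-1 : ℤ) : ℚ),((3 : ℤ) : ℚ)],
        x ∈ order (-1) 3 ∧ x.re = 0 ∧ (x * star x).re = t ∧ moebius (rho (-1) 3 (by norm_num) (castQ (-1) 3 x)) τ = τ})) := by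
    intro b
    induction b using Quot.ind with
    | _ p' => exact factorPlus_mk_eq_mk_iff_atkinLehnerQuotientThree p' p
  rw [(card_eq_one_iff_of_iff_eq_or_eq₂₂ hF).1, atkinLehnerQuotient_mk_eq_iff, atkinLehnerQuotientThree_rel_iff,
    ← normOne_moebius_w2_fixed_iff p.2.1, ← normOne_moebius_mu_w2_fixed_iff p]
  constructor
  · rintro ⟨v, hv, hv1, h | h⟩
    · exact Or.inl ⟨v, hv, hv1, h⟩
    · exact Or.inr ⟨v, hv, hv1, h⟩
  · rintro (⟨v, hv, hv1, h⟩ | ⟨v, hv, hv1, h⟩)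
    · exact ⟨v, hv, hv1, Or.inl h⟩
    · exact ⟨v, hv, hv1, Or.inr h⟩

/-- **TWO CLASSES IN THE FIBRE OF `X₆^{(3)} → X₆⁺`** away from `Z(1) ∪ Z(6)`. [cite: BayerTravesa2007, §2 p. 318 and §7] [cite: Ogg1983RealPoints, §2 (2)–(4)] -/
theorem card_plusFibre_atkinLehnerQuotientThree_eq_two_iff {t : ℤ} (p : {τ : ℂ // 0 < τ.im ∧ ∃ x : ℍ[ℚ,((-1 : ℤ) : ℚ),((3 : ℤ) : ℚ)],
        x ∈ order (-1) 3 ∧ x.re = 0 ∧ (x * star x).re = t ∧ moebius (rho (-1) 3 (by norm_num) (castQ (-1) 3 x)) τ = τ}) :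
    Nat.card {b : (Quot (fun p q : {τ : ℂ // 0 < τ.im ∧ ∃ x : ℍ[ℚ,((-1 : ℤ) : ℚ),((3 : ℤ) : ℚ)],
        x ∈ order (-1) 3 ∧ x.re = 0 ∧ (x * star x).re = t ∧ moebius (rho (-1) 3 (by norm_num) (castQ (-1) 3 x)) τ = τ} ↦
      ∃ g : ℍ[ℚ,((-1 : ℤ) : ℚ),((3 : ℤ) : ℚ)], g ≠ 0 ∧
        (∀ a : ℍ[ℚ,((-1 : ℤ) : ℚ),((3 : ℤ) : ℚ)], (a ∈ order (-1) 3 ∨ a - ⟨1/2, 1/2, 1/2, -1/2⟩ ∈ order (-1) 3) →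
          ∃ b : ℍ[ℚ,((-1 : ℤ) : ℚ),((3 : ℤ) : ℚ)], (b ∈ order (-1) 3 ∨ b - ⟨1/2, 1/2, 1/2, -1/2⟩ ∈ order (-1) 3) ∧
            g * a = b * g) ∧
        0 < (g * star g).re ∧ (∃ s : ℚ, (g * star g).re = s ^ 2 ∨ (g * star g).re = 3 * s ^ 2) ∧
        moebius (rho (-1) 3 (by norm_num) (castQ (-1) 3 g)) p.1 = q.1)) //
      Quot.factor (fun p q : {τ : ℂ // 0 < τ.im ∧ ∃ x : ℍ[ℚ,((-1 : ℤ) : ℚ),((3 : ℤ) : ℚ)],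
        x ∈ order (-1) 3 ∧ x.re = 0 ∧ (x * star x).re = t ∧ moebius (rho (-1) 3 (by norm_num) (castQ (-1) 3 x)) τ = τ} ↦
      ∃ g : ℍ[ℚ,((-1 : ℤ) : ℚ),((3 : ℤ) : ℚ)], g ≠ 0 ∧
        (∀ a : ℍ[ℚ,((-1 : ℤ) : ℚ),((3 : ℤ) : ℚ)], (a ∈ order (-1) 3 ∨ a - ⟨1/2, 1/2, 1/2, -1/2⟩ ∈ order (-1) 3) →
          ∃ b : ℍ[ℚ,((-1 : ℤ) : ℚ),((3 : ℤ) : ℚ)], (b ∈ order (-1) 3 ∨ b - ⟨1/2, 1/2, 1/2, -1/2⟩ ∈ order (-1) 3) ∧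
            g * a = b * g) ∧
        0 < (g * star g).re ∧ (∃ s : ℚ, (g * star g).re = s ^ 2 ∨ (g * star g).re = 3 * s ^ 2) ∧
        moebius (rho (-1) 3 (by norm_num) (castQ (-1) 3 g)) p.1 = q.1)
      (fun p q : {τ : ℂ // 0 < τ.im ∧ ∃ x : ℍ[ℚ,((-1 : ℤ) : ℚ),((3 : ℤ) : ℚ)],
        x ∈ order (-1) 3 ∧ x.re = 0 ∧ (x * star x).re = t ∧ moebius (rho (-1) 3 (by norm_num) (castQ (-1) 3 x)) τ = τ} ↦
      ∃ g : ℍ[ℚ,((-1 : ℤ) : ℚ),((3 : ℤ) : ℚ)], g ≠ 0 ∧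
        (∀ a : ℍ[ℚ,((-1 : ℤ) : ℚ),((3 : ℤ) : ℚ)], (a ∈ order (-1) 3 ∨ a - ⟨1/2, 1/2, 1/2, -1/2⟩ ∈ order (-1) 3) →
          ∃ b : ℍ[ℚ,((-1 : ℤ) : ℚ),((3 : ℤ) : ℚ)], (b ∈ order (-1) 3 ∨ b - ⟨1/2, 1/2, 1/2, -1/2⟩ ∈ order (-1) 3) ∧
            g * a = b * g) ∧
        0 < (g * star g).re ∧ moebius (rho (-1) 3 (by norm_num) (castQ (-1) 3 g)) p.1 = q.1)
      (specialPointsPlus_rel_of_atkinLehnerQuotient_rel t 3) b = Quot.mk _ p} = 2 ↔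
    ¬ ((∃ y : ℍ[ℚ,((-1 : ℤ) : ℚ),((3 : ℤ) : ℚ)], y ∈ order (-1) 3 ∧ y.re = 0 ∧ (y * star y).re = 1 ∧
        moebius (rho (-1) 3 (by norm_num) (castQ (-1) 3 y)) p.1 = p.1) ∨
      (∃ y : ℍ[ℚ,((-1 : ℤ) : ℚ),((3 : ℤ) : ℚ)], y ∈ order (-1) 3 ∧ y.re = 0 ∧ (y * star y).re = 6 ∧
        moebius (rho (-1) 3 (by norm_num) (castQ (-1) 3 y)) p.1 = p.1)) := by
  have hF : ∀ b : (Quot (fun p q : {τ : ℂ // 0 < τ.im ∧ ∃ x : ℍ[ℚ,((-1 : ℤ) : ℚ),((3 : ℤ) : ℚ)],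
        x ∈ order (-1) 3 ∧ x.re = 0 ∧ (x * star x).re = t ∧ moebius (rho (-1) 3 (by norm_num) (castQ (-1) 3 x)) τ = τ} ↦
      ∃ g : ℍ[ℚ,((-1 : ℤ) : ℚ),((3 : ℤ) : ℚ)], g ≠ 0 ∧
        (∀ a : ℍ[ℚ,((-1 : ℤ) : ℚ),((3 : ℤ) : ℚ)], (a ∈ order (-1) 3 ∨ a - ⟨1/2, 1/2, 1/2, -1/2⟩ ∈ order (-1) 3) →
          ∃ b : ℍ[ℚ,((-1 : ℤ) : ℚ),((3 : ℤ) : ℚ)], (b ∈ order (-1) 3 ∨ b - ⟨1/2, 1/2, 1/2, -1/2⟩ ∈ order (-1) 3) ∧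
            g * a = b * g) ∧
        0 < (g * star g).re ∧ (∃ s : ℚ, (g * star g).re = s ^ 2 ∨ (g * star g).re = 3 * s ^ 2) ∧
        moebius (rho (-1) 3 (by norm_num) (castQ (-1) 3 g)) p.1 = q.1)),
      Quot.factor (fun p q : {τ : ℂ // 0 < τ.im ∧ ∃ x : ℍ[ℚ,((-1 : ℤ) : ℚ),((3 : ℤ) : ℚ)],
        x ∈ order (-1) 3 ∧ x.re = 0 ∧ (x * star x).re = t ∧ moebius (rho (-1) 3 (by norm_num) (castQ (-1) 3 x)) τ = τ} ↦
      ∃ g : ℍ[ℚ,((-1 : ℤ) : ℚ),((3 : ℤ) : ℚ)], g ≠ 0 ∧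
        (∀ a : ℍ[ℚ,((-1 : ℤ) : ℚ),((3 : ℤ) : ℚ)], (a ∈ order (-1) 3 ∨ a - ⟨1/2, 1/2, 1/2, -1/2⟩ ∈ order (-1) 3) →
          ∃ b : ℍ[ℚ,((-1 : ℤ) : ℚ),((3 : ℤ) : ℚ)], (b ∈ order (-1) 3 ∨ b - ⟨1/2, 1/2, 1/2, -1/2⟩ ∈ order (-1) 3) ∧
            g * a = b * g) ∧
        0 < (g * star g).re ∧ (∃ s : ℚ, (g * star g).re = s ^ 2 ∨ (g * star g).re = 3 * s ^ 2) ∧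
        moebius (rho (-1) 3 (by norm_num) (castQ (-1) 3 g)) p.1 = q.1)
      (fun p q : {τ : ℂ // 0 < τ.im ∧ ∃ x : ℍ[ℚ,((-1 : ℤ) : ℚ),((3 : ℤ) : ℚ)],
        x ∈ order (-1) 3 ∧ x.re = 0 ∧ (x * star x).re = t ∧ moebius (rho (-1) 3 (by norm_num) (castQ (-1) 3 x)) τ = τ} ↦
      ∃ g : ℍ[ℚ,((-1 : ℤ) : ℚ),((3 : ℤ) : ℚ)], g ≠ 0 ∧
        (∀ a : ℍ[ℚ,((-1 : ℤ) : ℚ),((3 : ℤ) : ℚ)], (a ∈ order (-1) 3 ∨ a - ⟨1/2, 1/2, 1/2, -1/2⟩ ∈ order (-1) 3) →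
          ∃ b : ℍ[ℚ,((-1 : ℤ) : ℚ),((3 : ℤ) : ℚ)], (b ∈ order (-1) 3 ∨ b - ⟨1/2, 1/2, 1/2, -1/2⟩ ∈ order (-1) 3) ∧
            g * a = b * g) ∧
        0 < (g * star g).re ∧ moebius (rho (-1) 3 (by norm_num) (castQ (-1) 3 g)) p.1 = q.1)
      (specialPointsPlus_rel_of_atkinLehnerQuotient_rel t 3) b = Quot.mk _ p ↔
      (b = Quot.mk _ p ∨ b = Quot.mk _ (⟨moebius (rho (-1) 3 (by norm_num) (castQ (-1) 3 (⟨1, 1, 0, 0⟩ : ℍ[ℚ,((-1 : ℤ) : ℚ),((3 : ℤ) : ℚ)]))) p.1, moebius_w2_mem_specialPoints p.2.1 p.2.2⟩ : {τ : ℂ // 0 < τ.im ∧ ∃ x : ℍ[ℚ,((-1 : ℤ) : ℚ),((3 : ℤ) : ℚ)],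
        x ∈ order (-1) 3 ∧ x.re = 0 ∧ (x * star x).re = t ∧ moebius (rho (-1) 3 (by norm_num) (castQ (-1) 3 x)) τ = τ})) := by
    intro b
    induction b using Quot.ind with
    | _ p' => exact factorPlus_mk_eq_mk_iff_atkinLehnerQuotientThree p' p
  rw [(card_eq_one_iff_of_iff_eq_or_eq₂₂ hF).2.1, ← card_plusFibre_atkinLehnerQuotientThree_eq_one_iff p,
    (card_eq_one_iff_of_iff_eq_or_eq₂₂ hF).1]

/-- Every fibre of `X₆^{(3)} → X₆⁺` on `Z(t)` has one or two classes (a double cover). [cite: BayerTravesa2007, §2 p. 318] [cite: Ogg1983RealPoints, §2 (2)–(4)] -/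
theorem card_plusFibre_atkinLehnerQuotientThree_eq_one_or_eq_two {t : ℤ} (c : (Quot (fun p q : {τ : ℂ // 0 < τ.im ∧ ∃ x : ℍ[ℚ,((-1 : ℤ) : ℚ),((3 : ℤ) : ℚ)],
        x ∈ order (-1) 3 ∧ x.re = 0 ∧ (x * star x).re = t ∧ moebius (rho (-1) 3 (by norm_num) (castQ (-1) 3 x)) τ = τ} ↦
      ∃ g : ℍ[ℚ,((-1 : ℤ) : ℚ),((3 : ℤ) : ℚ)], g ≠ 0 ∧
        (∀ a : ℍ[ℚ,((-1 : ℤ) : ℚ),((3 : ℤ) : ℚ)], (a ∈ order (-1) 3 ∨ a - ⟨1/2, 1/2, 1/2, -1/2⟩ ∈ order (-1) 3) →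
          ∃ b : ℍ[ℚ,((-1 : ℤ) : ℚ),((3 : ℤ) : ℚ)], (b ∈ order (-1) 3 ∨ b - ⟨1/2, 1/2, 1/2, -1/2⟩ ∈ order (-1) 3) ∧
            g * a = b * g) ∧
        0 < (g * star g).re ∧ moebius (rho (-1) 3 (by norm_num) (castQ (-1) 3 g)) p.1 = q.1))) :
    Nat.card {b : (Quot (fun p q : {τ : ℂ // 0 < τ.im ∧ ∃ x : ℍ[ℚ,((-1 : ℤ) : ℚ),((3 : ℤ) : ℚ)],
        x ∈ order (-1) 3 ∧ x.re = 0 ∧ (x * star x).re = t ∧ moebius (rho (-1) 3 (by norm_num) (castQ (-1) 3 x)) τ = τ} ↦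
      ∃ g : ℍ[ℚ,((-1 : ℤ) : ℚ),((3 : ℤ) : ℚ)], g ≠ 0 ∧
        (∀ a : ℍ[ℚ,((-1 : ℤ) : ℚ),((3 : ℤ) : ℚ)], (a ∈ order (-1) 3 ∨ a - ⟨1/2, 1/2, 1/2, -1/2⟩ ∈ order (-1) 3) →
          ∃ b : ℍ[ℚ,((-1 : ℤ) : ℚ),((3 : ℤ) : ℚ)], (b ∈ order (-1) 3 ∨ b - ⟨1/2, 1/2, 1/2, -1/2⟩ ∈ order (-1) 3) ∧
            g * a = b * g) ∧
        0 < (g * star g).re ∧ (∃ s : ℚ, (g * star g).re = s ^ 2 ∨ (g * star g).re = 3 * s ^ 2) ∧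
        moebius (rho (-1) 3 (by norm_num) (castQ (-1) 3 g)) p.1 = q.1)) //
      Quot.factor (fun p q : {τ : ℂ // 0 < τ.im ∧ ∃ x : ℍ[ℚ,((-1 : ℤ) : ℚ),((3 : ℤ) : ℚ)],
        x ∈ order (-1) 3 ∧ x.re = 0 ∧ (x * star x).re = t ∧ moebius (rho (-1) 3 (by norm_num) (castQ (-1) 3 x)) τ = τ} ↦
      ∃ g : ℍ[ℚ,((-1 : ℤ) : ℚ),((3 : ℤ) : ℚ)], g ≠ 0 ∧
        (∀ a : ℍ[ℚ,((-1 : ℤ) : ℚ),((3 : ℤ) : ℚ)], (a ∈ order (-1) 3 ∨ a - ⟨1/2, 1/2, 1/2, -1/2⟩ ∈ order (-1) 3) →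
          ∃ b : ℍ[ℚ,((-1 : ℤ) : ℚ),((3 : ℤ) : ℚ)], (b ∈ order (-1) 3 ∨ b - ⟨1/2, 1/2, 1/2, -1/2⟩ ∈ order (-1) 3) ∧
            g * a = b * g) ∧
        0 < (g * star g).re ∧ (∃ s : ℚ, (g * star g).re = s ^ 2 ∨ (g * star g).re = 3 * s ^ 2) ∧
        moebius (rho (-1) 3 (by norm_num) (castQ (-1) 3 g)) p.1 = q.1)
      (fun p q : {τ : ℂ // 0 < τ.im ∧ ∃ x : ℍ[ℚ,((-1 : ℤ) : ℚ),((3 : ℤ) : ℚ)],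
        x ∈ order (-1) 3 ∧ x.re = 0 ∧ (x * star x).re = t ∧ moebius (rho (-1) 3 (by norm_num) (castQ (-1) 3 x)) τ = τ} ↦
      ∃ g : ℍ[ℚ,((-1 : ℤ) : ℚ),((3 : ℤ) : ℚ)], g ≠ 0 ∧
        (∀ a : ℍ[ℚ,((-1 : ℤ) : ℚ),((3 : ℤ) : ℚ)], (a ∈ order (-1) 3 ∨ a - ⟨1/2, 1/2, 1/2, -1/2⟩ ∈ order (-1) 3) →
          ∃ b : ℍ[ℚ,((-1 : ℤ) : ℚ),((3 : ℤ) : ℚ)], (b ∈ order (-1) 3 ∨ b - ⟨1/2, 1/2, 1/2, -1/2⟩ ∈ order (-1) 3) ∧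
            g * a = b * g) ∧
        0 < (g * star g).re ∧ moebius (rho (-1) 3 (by norm_num) (castQ (-1) 3 g)) p.1 = q.1)
      (specialPointsPlus_rel_of_atkinLehnerQuotient_rel t 3) b = c} = 1 ∨
    Nat.card {b : (Quot (fun p q : {τ : ℂ // 0 < τ.im ∧ ∃ x : ℍ[ℚ,((-1 : ℤ) : ℚ),((3 : ℤ) : ℚ)],
        x ∈ order (-1) 3 ∧ x.re = 0 ∧ (x * star x).re = t ∧ moebius (rho (-1) 3 (by norm_num) (castQ (-1) 3 x)) τ = τ} ↦
      ∃ g : ℍ[ℚ,((-1 : ℤ) : ℚ),((3 : ℤ) : ℚ)], g ≠ 0 ∧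
        (∀ a : ℍ[ℚ,((-1 : ℤ) : ℚ),((3 : ℤ) : ℚ)], (a ∈ order (-1) 3 ∨ a - ⟨1/2, 1/2, 1/2, -1/2⟩ ∈ order (-1) 3) →
          ∃ b : ℍ[ℚ,((-1 : ℤ) : ℚ),((3 : ℤ) : ℚ)], (b ∈ order (-1) 3 ∨ b - ⟨1/2, 1/2, 1/2, -1/2⟩ ∈ order (-1) 3) ∧
            g * a = b * g) ∧
        0 < (g * star g).re ∧ (∃ s : ℚ, (g * star g).re = s ^ 2 ∨ (g * star g).re = 3 * s ^ 2) ∧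
        moebius (rho (-1) 3 (by norm_num) (castQ (-1) 3 g)) p.1 = q.1)) //
      Quot.factor (fun p q : {τ : ℂ // 0 < τ.im ∧ ∃ x : ℍ[ℚ,((-1 : ℤ) : ℚ),((3 : ℤ) : ℚ)],
        x ∈ order (-1) 3 ∧ x.re = 0 ∧ (x * star x).re = t ∧ moebius (rho (-1) 3 (by norm_num) (castQ (-1) 3 x)) τ = τ} ↦
      ∃ g : ℍ[ℚ,((-1 : ℤ) : ℚ),((3 : ℤ) : ℚ)], g ≠ 0 ∧
        (∀ a : ℍ[ℚ,((-1 : ℤ) : ℚ),((3 : ℤ) : ℚ)], (a ∈ order (-1) 3 ∨ a - ⟨1/2, 1/2, 1/2, -1/2⟩ ∈ order (-1) 3) →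
          ∃ b : ℍ[ℚ,((-1 : ℤ) : ℚ),((3 : ℤ) : ℚ)], (b ∈ order (-1) 3 ∨ b - ⟨1/2, 1/2, 1/2, -1/2⟩ ∈ order (-1) 3) ∧
            g * a = b * g) ∧
        0 < (g * star g).re ∧ (∃ s : ℚ, (g * star g).re = s ^ 2 ∨ (g * star g).re = 3 * s ^ 2) ∧
        moebius (rho (-1) 3 (by norm_num) (castQ (-1) 3 g)) p.1 = q.1)
      (fun p q : {τ : ℂ // 0 < τ.im ∧ ∃ x : ℍ[ℚ,((-1 : ℤ) : ℚ),((3 : ℤ) : ℚ)],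
        x ∈ order (-1) 3 ∧ x.re = 0 ∧ (x * star x).re = t ∧ moebius (rho (-1) 3 (by norm_num) (castQ (-1) 3 x)) τ = τ} ↦
      ∃ g : ℍ[ℚ,((-1 : ℤ) : ℚ),((3 : ℤ) : ℚ)], g ≠ 0 ∧
        (∀ a : ℍ[ℚ,((-1 : ℤ) : ℚ),((3 : ℤ) : ℚ)], (a ∈ order (-1) 3 ∨ a - ⟨1/2, 1/2, 1/2, -1/2⟩ ∈ order (-1) 3) →
          ∃ b : ℍ[ℚ,((-1 : ℤ) : ℚ),((3 : ℤ) : ℚ)], (b ∈ order (-1) 3 ∨ b - ⟨1/2, 1/2, 1/2, -1/2⟩ ∈ order (-1) 3) ∧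
            g * a = b * g) ∧
        0 < (g * star g).re ∧ moebius (rho (-1) 3 (by norm_num) (castQ (-1) 3 g)) p.1 = q.1)
      (specialPointsPlus_rel_of_atkinLehnerQuotient_rel t 3) b = c} = 2 := by
  induction c using Quot.ind with
  | _ p =>
    have hF : ∀ b : (Quot (fun p q : {τ : ℂ // 0 < τ.im ∧ ∃ x : ℍ[ℚ,((-1 : ℤ) : ℚ),((3 : ℤ) : ℚ)],
        x ∈ order (-1) 3 ∧ x.re = 0 ∧ (x * star x).re = t ∧ moebius (rho (-1) 3 (by norm_num) (castQ (-1) 3 x)) τ = τ} ↦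
      ∃ g : ℍ[ℚ,((-1 : ℤ) : ℚ),((3 : ℤ) : ℚ)], g ≠ 0 ∧
        (∀ a : ℍ[ℚ,((-1 : ℤ) : ℚ),((3 : ℤ) : ℚ)], (a ∈ order (-1) 3 ∨ a - ⟨1/2, 1/2, 1/2, -1/2⟩ ∈ order (-1) 3) →
          ∃ b : ℍ[ℚ,((-1 : ℤ) : ℚ),((3 : ℤ) : ℚ)], (b ∈ order (-1) 3 ∨ b - ⟨1/2, 1/2, 1/2, -1/2⟩ ∈ order (-1) 3) ∧
            g * a = b * g) ∧
        0 < (g * star g).re ∧ (∃ s : ℚ, (g * star g).re = s ^ 2 ∨ (g * star g).re = 3 * s ^ 2) ∧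
        moebius (rho (-1) 3 (by norm_num) (castQ (-1) 3 g)) p.1 = q.1)),
        Quot.factor (fun p q : {τ : ℂ // 0 < τ.im ∧ ∃ x : ℍ[ℚ,((-1 : ℤ) : ℚ),((3 : ℤ) : ℚ)],
        x ∈ order (-1) 3 ∧ x.re = 0 ∧ (x * star x).re = t ∧ moebius (rho (-1) 3 (by norm_num) (castQ (-1) 3 x)) τ = τ} ↦
      ∃ g : ℍ[ℚ,((-1 : ℤ) : ℚ),((3 : ℤ) : ℚ)], g ≠ 0 ∧
        (∀ a : ℍ[ℚ,((-1 : ℤ) : ℚ),((3 : ℤ) : ℚ)], (a ∈ order (-1) 3 ∨ a - ⟨1/2, 1/2, 1/2, -1/2⟩ ∈ order (-1) 3) →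
          ∃ b : ℍ[ℚ,((-1 : ℤ) : ℚ),((3 : ℤ) : ℚ)], (b ∈ order (-1) 3 ∨ b - ⟨1/2, 1/2, 1/2, -1/2⟩ ∈ order (-1) 3) ∧
            g * a = b * g) ∧
        0 < (g * star g).re ∧ (∃ s : ℚ, (g * star g).re = s ^ 2 ∨ (g * star g).re = 3 * s ^ 2) ∧
        moebius (rho (-1) 3 (by norm_num) (castQ (-1) 3 g)) p.1 = q.1)
      (fun p q : {τ : ℂ // 0 < τ.im ∧ ∃ x : ℍ[ℚ,((-1 : ℤ) : ℚ),((3 : ℤ) : ℚ)],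
        x ∈ order (-1) 3 ∧ x.re = 0 ∧ (x * star x).re = t ∧ moebius (rho (-1) 3 (by norm_num) (castQ (-1) 3 x)) τ = τ} ↦
      ∃ g : ℍ[ℚ,((-1 : ℤ) : ℚ),((3 : ℤ) : ℚ)], g ≠ 0 ∧
        (∀ a : ℍ[ℚ,((-1 : ℤ) : ℚ),((3 : ℤ) : ℚ)], (a ∈ order (-1) 3 ∨ a - ⟨1/2, 1/2, 1/2, -1/2⟩ ∈ order (-1) 3) →
          ∃ b : ℍ[ℚ,((-1 : ℤ) : ℚ),((3 : ℤ) : ℚ)], (b ∈ order (-1) 3 ∨ b - ⟨1/2, 1/2, 1/2, -1/2⟩ ∈ order (-1) 3) ∧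
            g * a = b * g) ∧
        0 < (g * star g).re ∧ moebius (rho (-1) 3 (by norm_num) (castQ (-1) 3 g)) p.1 = q.1)
      (specialPointsPlus_rel_of_atkinLehnerQuotient_rel t 3) b = Quot.mk _ p ↔
        (b = Quot.mk _ p ∨ b = Quot.mk _ (⟨moebius (rho (-1) 3 (by norm_num) (castQ (-1) 3 (⟨1, 1, 0, 0⟩ : ℍ[ℚ,((-1 : ℤ) : ℚ),((3 : ℤ) : ℚ)]))) p.1, moebius_w2_mem_specialPoints p.2.1 p.2.2⟩ : {τ : ℂ // 0 < τ.im ∧ ∃ x : ℍ[ℚ,((-1 : ℤ) : ℚ),((3 : ℤ) : ℚ)],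
        x ∈ order (-1) 3 ∧ x.re = 0 ∧ (x * star x).re = t ∧ moebius (rho (-1) 3 (by norm_num) (castQ (-1) 3 x)) τ = τ})) := by
      intro b
      induction b using Quot.ind with
      | _ p' => exact factorPlus_mk_eq_mk_iff_atkinLehnerQuotientThree p' p
    exact (card_eq_one_iff_of_iff_eq_or_eq₂₂ hF).2.2

/-- **CLASS EQUATION OF `X₆^{(3)} → X₆⁺` ON `Z(t)`** (`t > 0`): `#(Pt(t)/Γ₆^{(3)}) + #{one-class fibres} = 2·#(Pt(t)/Γ₆⁺)`.
[cite: BayerTravesa2007, §2 p. 318 and §7] [cite: Ogg1983RealPoints, §2 (3)–(4)] -/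
theorem card_atkinLehnerQuotientThree_add_card_onePlusFibres_eq_two_mul_card_specialPointsPlus {t : ℤ} (ht : 0 < t) :
    Nat.card (Quot (fun p q : {τ : ℂ // 0 < τ.im ∧ ∃ x : ℍ[ℚ,((-1 : ℤ) : ℚ),((3 : ℤ) : ℚ)],
        x ∈ order (-1) 3 ∧ x.re = 0 ∧ (x * star x).re = t ∧ moebius (rho (-1) 3 (by norm_num) (castQ (-1) 3 x)) τ = τ} ↦
      ∃ g : ℍ[ℚ,((-1 : ℤ) : ℚ),((3 : ℤ) : ℚ)], g ≠ 0 ∧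
        (∀ a : ℍ[ℚ,((-1 : ℤ) : ℚ),((3 : ℤ) : ℚ)], (a ∈ order (-1) 3 ∨ a - ⟨1/2, 1/2, 1/2, -1/2⟩ ∈ order (-1) 3) →
          ∃ b : ℍ[ℚ,((-1 : ℤ) : ℚ),((3 : ℤ) : ℚ)], (b ∈ order (-1) 3 ∨ b - ⟨1/2, 1/2, 1/2, -1/2⟩ ∈ order (-1) 3) ∧
            g * a = b * g) ∧
        0 < (g * star g).re ∧ (∃ s : ℚ, (g * star g).re = s ^ 2 ∨ (g * star g).re = 3 * s ^ 2) ∧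
        moebius (rho (-1) 3 (by norm_num) (castQ (-1) 3 g)) p.1 = q.1)) +
    Nat.card {c : (Quot (fun p q : {τ : ℂ // 0 < τ.im ∧ ∃ x : ℍ[ℚ,((-1 : ℤ) : ℚ),((3 : ℤ) : ℚ)],
        x ∈ order (-1) 3 ∧ x.re = 0 ∧ (x * star x).re = t ∧ moebius (rho (-1) 3 (by norm_num) (castQ (-1) 3 x)) τ = τ} ↦
      ∃ g : ℍ[ℚ,((-1 : ℤ) : ℚ),((3 : ℤ) : ℚ)], g ≠ 0 ∧
        (∀ a : ℍ[ℚ,((-1 : ℤ) : ℚ),((3 : ℤ) : ℚ)], (a ∈ order (-1) 3 ∨ a - ⟨1/2, 1/2, 1/2, -1/2⟩ ∈ order (-1) 3) →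
          ∃ b : ℍ[ℚ,((-1 : ℤ) : ℚ),((3 : ℤ) : ℚ)], (b ∈ order (-1) 3 ∨ b - ⟨1/2, 1/2, 1/2, -1/2⟩ ∈ order (-1) 3) ∧
            g * a = b * g) ∧
        0 < (g * star g).re ∧ moebius (rho (-1) 3 (by norm_num) (castQ (-1) 3 g)) p.1 = q.1)) //
      Nat.card {b : (Quot (fun p q : {τ : ℂ // 0 < τ.im ∧ ∃ x : ℍ[ℚ,((-1 : ℤ) : ℚ),((3 : ℤ) : ℚ)],
        x ∈ order (-1) 3 ∧ x.re = 0 ∧ (x * star x).re = t ∧ moebius (rho (-1) 3 (by norm_num) (castQ (-1) 3 x)) τ = τ} ↦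
      ∃ g : ℍ[ℚ,((-1 : ℤ) : ℚ),((3 : ℤ) : ℚ)], g ≠ 0 ∧
        (∀ a : ℍ[ℚ,((-1 : ℤ) : ℚ),((3 : ℤ) : ℚ)], (a ∈ order (-1) 3 ∨ a - ⟨1/2, 1/2, 1/2, -1/2⟩ ∈ order (-1) 3) →
          ∃ b : ℍ[ℚ,((-1 : ℤ) : ℚ),((3 : ℤ) : ℚ)], (b ∈ order (-1) 3 ∨ b - ⟨1/2, 1/2, 1/2, -1/2⟩ ∈ order (-1) 3) ∧
            g * a = b * g) ∧
        0 < (g * star g).re ∧ (∃ s : ℚ, (g * star g).re = s ^ 2 ∨ (g * star g).re = 3 * s ^ 2) ∧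
        moebius (rho (-1) 3 (by norm_num) (castQ (-1) 3 g)) p.1 = q.1)) //
        Quot.factor (fun p q : {τ : ℂ // 0 < τ.im ∧ ∃ x : ℍ[ℚ,((-1 : ℤ) : ℚ),((3 : ℤ) : ℚ)],
        x ∈ order (-1) 3 ∧ x.re = 0 ∧ (x * star x).re = t ∧ moebius (rho (-1) 3 (by norm_num) (castQ (-1) 3 x)) τ = τ} ↦
      ∃ g : ℍ[ℚ,((-1 : ℤ) : ℚ),((3 : ℤ) : ℚ)], g ≠ 0 ∧
        (∀ a : ℍ[ℚ,((-1 : ℤ) : ℚ),((3 : ℤ) : ℚ)], (a ∈ order (-1) 3 ∨ a - ⟨1/2, 1/2, 1/2, -1/2⟩ ∈ order (-1) 3) →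
          ∃ b : ℍ[ℚ,((-1 : ℤ) : ℚ),((3 : ℤ) : ℚ)], (b ∈ order (-1) 3 ∨ b - ⟨1/2, 1/2, 1/2, -1/2⟩ ∈ order (-1) 3) ∧
            g * a = b * g) ∧
        0 < (g * star g).re ∧ (∃ s : ℚ, (g * star g).re = s ^ 2 ∨ (g * star g).re = 3 * s ^ 2) ∧
        moebius (rho (-1) 3 (by norm_num) (castQ (-1) 3 g)) p.1 = q.1)
      (fun p q : {τ : ℂ // 0 < τ.im ∧ ∃ x : ℍ[ℚ,((-1 : ℤ) : ℚ),((3 : ℤ) : ℚ)],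
        x ∈ order (-1) 3 ∧ x.re = 0 ∧ (x * star x).re = t ∧ moebius (rho (-1) 3 (by norm_num) (castQ (-1) 3 x)) τ = τ} ↦
      ∃ g : ℍ[ℚ,((-1 : ℤ) : ℚ),((3 : ℤ) : ℚ)], g ≠ 0 ∧
        (∀ a : ℍ[ℚ,((-1 : ℤ) : ℚ),((3 : ℤ) : ℚ)], (a ∈ order (-1) 3 ∨ a - ⟨1/2, 1/2, 1/2, -1/2⟩ ∈ order (-1) 3) →
          ∃ b : ℍ[ℚ,((-1 : ℤ) : ℚ),((3 : ℤ) : ℚ)], (b ∈ order (-1) 3 ∨ b - ⟨1/2, 1/2, 1/2, -1/2⟩ ∈ order (-1) 3) ∧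
            g * a = b * g) ∧
        0 < (g * star g).re ∧ moebius (rho (-1) 3 (by norm_num) (castQ (-1) 3 g)) p.1 = q.1)
      (specialPointsPlus_rel_of_atkinLehnerQuotient_rel t 3) b = c} = 1} =
    2 * Nat.card (Quot (fun p q : {τ : ℂ // 0 < τ.im ∧ ∃ x : ℍ[ℚ,((-1 : ℤ) : ℚ),((3 : ℤ) : ℚ)],
        x ∈ order (-1) 3 ∧ x.re = 0 ∧ (x * star x).re = t ∧ moebius (rho (-1) 3 (by norm_num) (castQ (-1) 3 x)) τ = τ} ↦
      ∃ g : ℍ[ℚ,((-1 : ℤ) : ℚ),((3 : ℤ) : ℚ)], g ≠ 0 ∧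
        (∀ a : ℍ[ℚ,((-1 : ℤ) : ℚ),((3 : ℤ) : ℚ)], (a ∈ order (-1) 3 ∨ a - ⟨1/2, 1/2, 1/2, -1/2⟩ ∈ order (-1) 3) →
          ∃ b : ℍ[ℚ,((-1 : ℤ) : ℚ),((3 : ℤ) : ℚ)], (b ∈ order (-1) 3 ∨ b - ⟨1/2, 1/2, 1/2, -1/2⟩ ∈ order (-1) 3) ∧
            g * a = b * g) ∧
        0 < (g * star g).re ∧ moebius (rho (-1) 3 (by norm_num) (castQ (-1) 3 g)) p.1 = q.1)) := by
  haveI := finite_atkinLehnerQuotient ht 3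
  haveI := finite_specialPointsPlus ht
  exact card_add_card_eq_two_mul₂₂ _ card_plusFibre_atkinLehnerQuotientThree_eq_one_or_eq_two

/-- **THE FIBRE OF `X₆^{(6)} → X₆⁺` THROUGH `[τ]₆` ON `Z(t)` IS `{[τ]₆, [ρ(w₂)τ]₆}`**: the `W/⟨ω₆⟩ ≅ ℤ/2ℤ`-orbit of
`[τ]₆`. [cite: BayerTravesa2007, §2 p. 318 («`X₆^{(6)} = X₆/⟨ω₆⟩` … `X₆⁺ = X₆/W`»)] [cite: Ogg1983RealPoints, §2 (2)–(3)] -/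
theorem factorPlus_mk_eq_mk_iff_atkinLehnerQuotientSix {t : ℤ} (p' p : {τ : ℂ // 0 < τ.im ∧ ∃ x : ℍ[ℚ,((-1 : ℤ) : ℚ),((3 : ℤ) : ℚ)],
        x ∈ order (-1) 3 ∧ x.re = 0 ∧ (x * star x).re = t ∧ moebius (rho (-1) 3 (by norm_num) (castQ (-1) 3 x)) τ = τ}) :
    Quot.factor (fun p q : {τ : ℂ // 0 < τ.im ∧ ∃ x : ℍ[ℚ,((-1 : ℤ) : ℚ),((3 : ℤ) : ℚ)],
        x ∈ order (-1) 3 ∧ x.re = 0 ∧ (x * star x).re = t ∧ moebius (rho (-1) 3 (by norm_num) (castQ (-1) 3 x)) τ = τ} ↦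
      ∃ g : ℍ[ℚ,((-1 : ℤ) : ℚ),((3 : ℤ) : ℚ)], g ≠ 0 ∧
        (∀ a : ℍ[ℚ,((-1 : ℤ) : ℚ),((3 : ℤ) : ℚ)], (a ∈ order (-1) 3 ∨ a - ⟨1/2, 1/2, 1/2, -1/2⟩ ∈ order (-1) 3) →
          ∃ b : ℍ[ℚ,((-1 : ℤ) : ℚ),((3 : ℤ) : ℚ)], (b ∈ order (-1) 3 ∨ b - ⟨1/2, 1/2, 1/2, -1/2⟩ ∈ order (-1) 3) ∧
            g * a = b * g) ∧
        0 < (g * star g).re ∧ (∃ s : ℚ, (g * star g).re = s ^ 2 ∨ (g * star g).re = 6 * s ^ 2) ∧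
        moebius (rho (-1) 3 (by norm_num) (castQ (-1) 3 g)) p.1 = q.1)
      (fun p q : {τ : ℂ // 0 < τ.im ∧ ∃ x : ℍ[ℚ,((-1 : ℤ) : ℚ),((3 : ℤ) : ℚ)],
        x ∈ order (-1) 3 ∧ x.re = 0 ∧ (x * star x).re = t ∧ moebius (rho (-1) 3 (by norm_num) (castQ (-1) 3 x)) τ = τ} ↦
      ∃ g : ℍ[ℚ,((-1 : ℤ) : ℚ),((3 : ℤ) : ℚ)], g ≠ 0 ∧
        (∀ a : ℍ[ℚ,((-1 : ℤ) : ℚ),((3 : ℤ) : ℚ)], (a ∈ order (-1) 3 ∨ a - ⟨1/2, 1/2, 1/2, -1/2⟩ ∈ order (-1) 3) →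
          ∃ b : ℍ[ℚ,((-1 : ℤ) : ℚ),((3 : ℤ) : ℚ)], (b ∈ order (-1) 3 ∨ b - ⟨1/2, 1/2, 1/2, -1/2⟩ ∈ order (-1) 3) ∧
            g * a = b * g) ∧
        0 < (g * star g).re ∧ moebius (rho (-1) 3 (by norm_num) (castQ (-1) 3 g)) p.1 = q.1)
      (specialPointsPlus_rel_of_atkinLehnerQuotient_rel t 6) (Quot.mk _ p') = Quot.mk _ p ↔
    (Quot.mk (fun p q : {τ : ℂ // 0 < τ.im ∧ ∃ x : ℍ[ℚ,((-1 : ℤ) : ℚ),((3 : ℤ) : ℚ)],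
        x ∈ order (-1) 3 ∧ x.re = 0 ∧ (x * star x).re = t ∧ moebius (rho (-1) 3 (by norm_num) (castQ (-1) 3 x)) τ = τ} ↦
      ∃ g : ℍ[ℚ,((-1 : ℤ) : ℚ),((3 : ℤ) : ℚ)], g ≠ 0 ∧
        (∀ a : ℍ[ℚ,((-1 : ℤ) : ℚ),((3 : ℤ) : ℚ)], (a ∈ order (-1) 3 ∨ a - ⟨1/2, 1/2, 1/2, -1/2⟩ ∈ order (-1) 3) →
          ∃ b : ℍ[ℚ,((-1 : ℤ) : ℚ),((3 : ℤ) : ℚ)], (b ∈ order (-1) 3 ∨ b - ⟨1/2, 1/2, 1/2, -1/2⟩ ∈ order (-1) 3) ∧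
            g * a = b * g) ∧
        0 < (g * star g).re ∧ (∃ s : ℚ, (g * star g).re = s ^ 2 ∨ (g * star g).re = 6 * s ^ 2) ∧
        moebius (rho (-1) 3 (by norm_num) (castQ (-1) 3 g)) p.1 = q.1) p' = Quot.mk _ p ∨
      Quot.mk (fun p q : {τ : ℂ // 0 < τ.im ∧ ∃ x : ℍ[ℚ,((-1 : ℤ) : ℚ),((3 : ℤ) : ℚ)],
        x ∈ order (-1) 3 ∧ x.re = 0 ∧ (x * star x).re = t ∧ moebius (rho (-1) 3 (by norm_num) (castQ (-1) 3 x)) τ = τ} ↦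
      ∃ g : ℍ[ℚ,((-1 : ℤ) : ℚ),((3 : ℤ) : ℚ)], g ≠ 0 ∧
        (∀ a : ℍ[ℚ,((-1 : ℤ) : ℚ),((3 : ℤ) : ℚ)], (a ∈ order (-1) 3 ∨ a - ⟨1/2, 1/2, 1/2, -1/2⟩ ∈ order (-1) 3) →
          ∃ b : ℍ[ℚ,((-1 : ℤ) : ℚ),((3 : ℤ) : ℚ)], (b ∈ order (-1) 3 ∨ b - ⟨1/2, 1/2, 1/2, -1/2⟩ ∈ order (-1) 3) ∧
            g * a = b * g) ∧
        0 < (g * star g).re ∧ (∃ s : ℚ, (g * star g).re = s ^ 2 ∨ (g * star g).re = 6 * s ^ 2) ∧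
        moebius (rho (-1) 3 (by norm_num) (castQ (-1) 3 g)) p.1 = q.1) p' = Quot.mk _ (⟨moebius (rho (-1) 3 (by norm_num) (castQ (-1) 3 (⟨1, 1, 0, 0⟩ : ℍ[ℚ,((-1 : ℤ) : ℚ),((3 : ℤ) : ℚ)]))) p.1, moebius_w2_mem_specialPoints p.2.1 p.2.2⟩ : {τ : ℂ // 0 < τ.im ∧ ∃ x : ℍ[ℚ,((-1 : ℤ) : ℚ),((3 : ℤ) : ℚ)],
        x ∈ order (-1) 3 ∧ x.re = 0 ∧ (x * star x).re = t ∧ moebius (rho (-1) 3 (by norm_num) (castQ (-1) 3 x)) τ = τ})) := by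
  have hiffP := specialPointsPlus_mk_eq_iff t
  have hiffD := atkinLehnerQuotient_mk_eq_iff t 6
  have hEP := specialPointsPlus_equivalence t
  have hDP := specialPointsPlus_rel_of_atkinLehnerQuotient_rel t 6
  have h1O : ((1 : ℍ[ℚ,((-1 : ℤ) : ℚ),((3 : ℤ) : ℚ)]) ∈ order (-1) 3 ∨ (1 : ℍ[ℚ,((-1 : ℤ) : ℚ),((3 : ℤ) : ℚ)]) - ⟨1/2, 1/2, 1/2, -1/2⟩ ∈ order (-1) 3) := Or.inl (Subring.one_mem _)
  have h11 : (1 : ℍ[ℚ,((-1 : ℤ) : ℚ),((3 : ℤ) : ℚ)]) * star 1 = 1 := by rw [star_one, mul_one]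
  -- `[r]₆ = [ρ(w₆) r]₆` and `S`-classes map to `Γ₆^{(6)}`-classes
  have DW : ∀ r : {τ : ℂ // 0 < τ.im ∧ ∃ x : ℍ[ℚ,((-1 : ℤ) : ℚ),((3 : ℤ) : ℚ)],
        x ∈ order (-1) 3 ∧ x.re = 0 ∧ (x * star x).re = t ∧ moebius (rho (-1) 3 (by norm_num) (castQ (-1) 3 x)) τ = τ}, Quot.mk (fun p q : {τ : ℂ // 0 < τ.im ∧ ∃ x : ℍ[ℚ,((-1 : ℤ) : ℚ),((3 : ℤ) : ℚ)],
        x ∈ order (-1) 3 ∧ x.re = 0 ∧ (x * star x).re = t ∧ moebius (rho (-1) 3 (by norm_num) (castQ (-1) 3 x)) τ = τ} ↦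
      ∃ g : ℍ[ℚ,((-1 : ℤ) : ℚ),((3 : ℤ) : ℚ)], g ≠ 0 ∧
        (∀ a : ℍ[ℚ,((-1 : ℤ) : ℚ),((3 : ℤ) : ℚ)], (a ∈ order (-1) 3 ∨ a - ⟨1/2, 1/2, 1/2, -1/2⟩ ∈ order (-1) 3) →
          ∃ b : ℍ[ℚ,((-1 : ℤ) : ℚ),((3 : ℤ) : ℚ)], (b ∈ order (-1) 3 ∨ b - ⟨1/2, 1/2, 1/2, -1/2⟩ ∈ order (-1) 3) ∧
            g * a = b * g) ∧
        0 < (g * star g).re ∧ (∃ s : ℚ, (g * star g).re = s ^ 2 ∨ (g * star g).re = 6 * s ^ 2) ∧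
        moebius (rho (-1) 3 (by norm_num) (castQ (-1) 3 g)) p.1 = q.1) r = Quot.mk _ (⟨moebius (rho (-1) 3 (by norm_num) (castQ (-1) 3 (⟨3, 3, 0, 2⟩ : ℍ[ℚ,((-1 : ℤ) : ℚ),((3 : ℤ) : ℚ)]))) r.1, moebius_w6_mem_specialPoints r.2.1 r.2.2⟩ : {τ : ℂ // 0 < τ.im ∧ ∃ x : ℍ[ℚ,((-1 : ℤ) : ℚ),((3 : ℤ) : ℚ)],
        x ∈ order (-1) 3 ∧ x.re = 0 ∧ (x * star x).re = t ∧ moebius (rho (-1) 3 (by norm_num) (castQ (-1) 3 x)) τ = τ}) := fun r ↦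
    (hiffD _ _).2 ((atkinLehnerQuotientSix_rel_iff _ _).2 ⟨1, h1O, h11, Or.inr (moebius_rho_castQ_one_apply _)⟩)
  have DS : ∀ r r' : {τ : ℂ // 0 < τ.im ∧ ∃ x : ℍ[ℚ,((-1 : ℤ) : ℚ),((3 : ℤ) : ℚ)],
        x ∈ order (-1) 3 ∧ x.re = 0 ∧ (x * star x).re = t ∧ moebius (rho (-1) 3 (by norm_num) (castQ (-1) 3 x)) τ = τ}, Quot.mk (fun p q : {τ : ℂ // 0 < τ.im ∧ ∃ x : ℍ[ℚ,((-1 : ℤ) : ℚ),((3 : ℤ) : ℚ)],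
        x ∈ order (-1) 3 ∧ x.re = 0 ∧ (x * star x).re = t ∧ moebius (rho (-1) 3 (by norm_num) (castQ (-1) 3 x)) τ = τ} ↦
      ∃ v : ℍ[ℚ,((-1 : ℤ) : ℚ),((3 : ℤ) : ℚ)], (v ∈ order (-1) 3 ∨ v - ⟨1/2, 1/2, 1/2, -1/2⟩ ∈ order (-1) 3) ∧
        v * star v = 1 ∧ moebius (rho (-1) 3 (by norm_num) (castQ (-1) 3 v)) p.1 = q.1) r = Quot.mk _ r' → Quot.mk (fun p q : {τ : ℂ // 0 < τ.im ∧ ∃ x : ℍ[ℚ,((-1 : ℤ) : ℚ),((3 : ℤ) : ℚ)],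
        x ∈ order (-1) 3 ∧ x.re = 0 ∧ (x * star x).re = t ∧ moebius (rho (-1) 3 (by norm_num) (castQ (-1) 3 x)) τ = τ} ↦
      ∃ g : ℍ[ℚ,((-1 : ℤ) : ℚ),((3 : ℤ) : ℚ)], g ≠ 0 ∧
        (∀ a : ℍ[ℚ,((-1 : ℤ) : ℚ),((3 : ℤ) : ℚ)], (a ∈ order (-1) 3 ∨ a - ⟨1/2, 1/2, 1/2, -1/2⟩ ∈ order (-1) 3) →
          ∃ b : ℍ[ℚ,((-1 : ℤ) : ℚ),((3 : ℤ) : ℚ)], (b ∈ order (-1) 3 ∨ b - ⟨1/2, 1/2, 1/2, -1/2⟩ ∈ order (-1) 3) ∧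
            g * a = b * g) ∧
        0 < (g * star g).re ∧ (∃ s : ℚ, (g * star g).re = s ^ 2 ∨ (g * star g).re = 6 * s ^ 2) ∧
        moebius (rho (-1) 3 (by norm_num) (castQ (-1) 3 g)) p.1 = q.1) r = Quot.mk _ r' := fun r r' h ↦
    (hiffD _ _).2 (atkinLehnerQuotient_rel_of_specialPoints_rel t 6 _ _ ((specialPoints_mk_eq_iff t _ _).1 h))
  have PO : Quot.mk (fun p q : {τ : ℂ // 0 < τ.im ∧ ∃ x : ℍ[ℚ,((-1 : ℤ) : ℚ),((3 : ℤ) : ℚ)],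
        x ∈ order (-1) 3 ∧ x.re = 0 ∧ (x * star x).re = t ∧ moebius (rho (-1) 3 (by norm_num) (castQ (-1) 3 x)) τ = τ} ↦
      ∃ g : ℍ[ℚ,((-1 : ℤ) : ℚ),((3 : ℤ) : ℚ)], g ≠ 0 ∧
        (∀ a : ℍ[ℚ,((-1 : ℤ) : ℚ),((3 : ℤ) : ℚ)], (a ∈ order (-1) 3 ∨ a - ⟨1/2, 1/2, 1/2, -1/2⟩ ∈ order (-1) 3) →
          ∃ b : ℍ[ℚ,((-1 : ℤ) : ℚ),((3 : ℤ) : ℚ)], (b ∈ order (-1) 3 ∨ b - ⟨1/2, 1/2, 1/2, -1/2⟩ ∈ order (-1) 3) ∧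
            g * a = b * g) ∧
        0 < (g * star g).re ∧ moebius (rho (-1) 3 (by norm_num) (castQ (-1) 3 g)) p.1 = q.1) (⟨moebius (rho (-1) 3 (by norm_num) (castQ (-1) 3 (⟨1, 1, 0, 0⟩ : ℍ[ℚ,((-1 : ℤ) : ℚ),((3 : ℤ) : ℚ)]))) p.1, moebius_w2_mem_specialPoints p.2.1 p.2.2⟩ : {τ : ℂ // 0 < τ.im ∧ ∃ x : ℍ[ℚ,((-1 : ℤ) : ℚ),((3 : ℤ) : ℚ)],
        x ∈ order (-1) 3 ∧ x.re = 0 ∧ (x * star x).re = t ∧ moebius (rho (-1) 3 (by norm_num) (castQ (-1) 3 x)) τ = τ}) = Quot.mk _ p :=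
    ((factor_mk_eq_mk_iff_specialPointsPlus _ p).2 (Or.inr (Or.inl rfl)))
  show Quot.mk _ p' = Quot.mk _ p ↔ _
  constructor
  · intro h
    have h4 := (factor_mk_eq_mk_iff_specialPointsPlus p' p).1 h
    rcases h4 with h4 | h4 | h4 | h4
    · exact Or.inl (DS _ _ h4)
    · exact Or.inr (DS _ _ h4)
    · right
      rw [DS _ _ h4, DW, (specialPoints_mk_klein _).2.2.2]
      exact DS _ _ ((specialPoints_mk_eq_iff t _ _).2 ((specialPoints_rel_map_w2_mu_w6 t).1 _ _
        ((specialPoints_mk_eq_iff t _ _).1 (specialPoints_mk_klein p).2.1)))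
    · left
      rw [DS _ _ h4, ← (specialPoints_mk_klein p).2.2.2, ← DW]
  · rintro (h | h)
    · exact (hiffP _ _).2 (hDP _ _ ((hiffD _ _).1 h))
    · rw [← PO]
      exact (hiffP _ _).2 (hDP _ _ ((hiffD _ _).1 h))

/-- **ONE CLASS IN THE FIBRE OF `X₆^{(6)} → X₆⁺` EXACTLY AT THE `Z(1)`- AND `Z(3)`-POINTS**: `[ρ(w₂)τ]₆ = [τ]₆ ⟺
ρ(w₂)τ ∼_{Γ₆} τ` or `ρ(w₆)ρ(w₂)τ ∼_{Γ₆} τ ⟺ τ ∈ Pt(1) ∪ Pt(3)` — on `Z(t)` the cover `X₆^{(6)} → X₆⁺` ramifies exactly over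
the images of the fixed points of the two OTHER involutions. [cite: BayerTravesa2007, §7 p. 332 («`P₀` is an elliptic point for `X₆^{(6)}` and `X₆⁺`, but it is not elliptic for `X₆`, `X₆^{(2)}` and `X₆^{(3)}`») and Table 9] [cite: Ogg1983RealPoints, §2 pp. 283–284] -/
theorem card_plusFibre_atkinLehnerQuotientSix_eq_one_iff {t : ℤ} (p : {τ : ℂ // 0 < τ.im ∧ ∃ x : ℍ[ℚ,((-1 : ℤ) : ℚ),((3 : ℤ) : ℚ)],
        x ∈ order (-1) 3 ∧ x.re = 0 ∧ (x * star x).re = t ∧ moebius (rho (-1) 3 (by norm_num) (castQ (-1) 3 x)) τ = τ}) :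
    Nat.card {b : (Quot (fun p q : {τ : ℂ // 0 < τ.im ∧ ∃ x : ℍ[ℚ,((-1 : ℤ) : ℚ),((3 : ℤ) : ℚ)],
        x ∈ order (-1) 3 ∧ x.re = 0 ∧ (x * star x).re = t ∧ moebius (rho (-1) 3 (by norm_num) (castQ (-1) 3 x)) τ = τ} ↦
      ∃ g : ℍ[ℚ,((-1 : ℤ) : ℚ),((3 : ℤ) : ℚ)], g ≠ 0 ∧
        (∀ a : ℍ[ℚ,((-1 : ℤ) : ℚ),((3 : ℤ) : ℚ)], (a ∈ order (-1) 3 ∨ a - ⟨1/2, 1/2, 1/2, -1/2⟩ ∈ order (-1) 3) →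
          ∃ b : ℍ[ℚ,((-1 : ℤ) : ℚ),((3 : ℤ) : ℚ)], (b ∈ order (-1) 3 ∨ b - ⟨1/2, 1/2, 1/2, -1/2⟩ ∈ order (-1) 3) ∧
            g * a = b * g) ∧
        0 < (g * star g).re ∧ (∃ s : ℚ, (g * star g).re = s ^ 2 ∨ (g * star g).re = 6 * s ^ 2) ∧
        moebius (rho (-1) 3 (by norm_num) (castQ (-1) 3 g)) p.1 = q.1)) //
      Quot.factor (fun p q : {τ : ℂ // 0 < τ.im ∧ ∃ x : ℍ[ℚ,((-1 : ℤ) : ℚ),((3 : ℤ) : ℚ)],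
        x ∈ order (-1) 3 ∧ x.re = 0 ∧ (x * star x).re = t ∧ moebius (rho (-1) 3 (by norm_num) (castQ (-1) 3 x)) τ = τ} ↦
      ∃ g : ℍ[ℚ,((-1 : ℤ) : ℚ),((3 : ℤ) : ℚ)], g ≠ 0 ∧
        (∀ a : ℍ[ℚ,((-1 : ℤ) : ℚ),((3 : ℤ) : ℚ)], (a ∈ order (-1) 3 ∨ a - ⟨1/2, 1/2, 1/2, -1/2⟩ ∈ order (-1) 3) →
          ∃ b : ℍ[ℚ,((-1 : ℤ) : ℚ),((3 : ℤ) : ℚ)], (b ∈ order (-1) 3 ∨ b - ⟨1/2, 1/2, 1/2, -1/2⟩ ∈ order (-1) 3) ∧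
            g * a = b * g) ∧
        0 < (g * star g).re ∧ (∃ s : ℚ, (g * star g).re = s ^ 2 ∨ (g * star g).re = 6 * s ^ 2) ∧
        moebius (rho (-1) 3 (by norm_num) (castQ (-1) 3 g)) p.1 = q.1)
      (fun p q : {τ : ℂ // 0 < τ.im ∧ ∃ x : ℍ[ℚ,((-1 : ℤ) : ℚ),((3 : ℤ) : ℚ)],
        x ∈ order (-1) 3 ∧ x.re = 0 ∧ (x * star x).re = t ∧ moebius (rho (-1) 3 (by norm_num) (castQ (-1) 3 x)) τ = τ} ↦
      ∃ g : ℍ[ℚ,((-1 : ℤ) : ℚ),((3 : ℤ) : ℚ)], g ≠ 0 ∧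
        (∀ a : ℍ[ℚ,((-1 : ℤ) : ℚ),((3 : ℤ) : ℚ)], (a ∈ order (-1) 3 ∨ a - ⟨1/2, 1/2, 1/2, -1/2⟩ ∈ order (-1) 3) →
          ∃ b : ℍ[ℚ,((-1 : ℤ) : ℚ),((3 : ℤ) : ℚ)], (b ∈ order (-1) 3 ∨ b - ⟨1/2, 1/2, 1/2, -1/2⟩ ∈ order (-1) 3) ∧
            g * a = b * g) ∧
        0 < (g * star g).re ∧ moebius (rho (-1) 3 (by norm_num) (castQ (-1) 3 g)) p.1 = q.1)
      (specialPointsPlus_rel_of_atkinLehnerQuotient_rel t 6) b = Quot.mk _ p} = 1 ↔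
    ((∃ y : ℍ[ℚ,((-1 : ℤ) : ℚ),((3 : ℤ) : ℚ)], y ∈ order (-1) 3 ∧ y.re = 0 ∧ (y * star y).re = 1 ∧
        moebius (rho (-1) 3 (by norm_num) (castQ (-1) 3 y)) p.1 = p.1) ∨
      (∃ y : ℍ[ℚ,((-1 : ℤ) : ℚ),((3 : ℤ) : ℚ)], y ∈ order (-1) 3 ∧ y.re = 0 ∧ (y * star y).re = 3 ∧
        moebius (rho (-1) 3 (by norm_num) (castQ (-1) 3 y)) p.1 = p.1)) := by
  have hF : ∀ b : (Quot (fun p q : {τ : ℂ // 0 < τ.im ∧ ∃ x : ℍ[ℚ,((-1 : ℤ) : ℚ),((3 : ℤ) : ℚ)],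
        x ∈ order (-1) 3 ∧ x.re = 0 ∧ (x * star x).re = t ∧ moebius (rho (-1) 3 (by norm_num) (castQ (-1) 3 x)) τ = τ} ↦
      ∃ g : ℍ[ℚ,((-1 : ℤ) : ℚ),((3 : ℤ) : ℚ)], g ≠ 0 ∧
        (∀ a : ℍ[ℚ,((-1 : ℤ) : ℚ),((3 : ℤ) : ℚ)], (a ∈ order (-1) 3 ∨ a - ⟨1/2, 1/2, 1/2, -1/2⟩ ∈ order (-1) 3) →
          ∃ b : ℍ[ℚ,((-1 : ℤ) : ℚ),((3 : ℤ) : ℚ)], (b ∈ order (-1) 3 ∨ b - ⟨1/2, 1/2, 1/2, -1/2⟩ ∈ order (-1) 3) ∧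
            g * a = b * g) ∧
        0 < (g * star g).re ∧ (∃ s : ℚ, (g * star g).re = s ^ 2 ∨ (g * star g).re = 6 * s ^ 2) ∧
        moebius (rho (-1) 3 (by norm_num) (castQ (-1) 3 g)) p.1 = q.1)),
      Quot.factor (fun p q : {τ : ℂ // 0 < τ.im ∧ ∃ x : ℍ[ℚ,((-1 : ℤ) : ℚ),((3 : ℤ) : ℚ)],
        x ∈ order (-1) 3 ∧ x.re = 0 ∧ (x * star x).re = t ∧ moebius (rho (-1) 3 (by norm_num) (castQ (-1) 3 x)) τ = τ} ↦
      ∃ g : ℍ[ℚ,((-1 : ℤ) : ℚ),((3 : ℤ) : ℚ)], g ≠ 0 ∧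
        (∀ a : ℍ[ℚ,((-1 : ℤ) : ℚ),((3 : ℤ) : ℚ)], (a ∈ order (-1) 3 ∨ a - ⟨1/2, 1/2, 1/2, -1/2⟩ ∈ order (-1) 3) →
          ∃ b : ℍ[ℚ,((-1 : ℤ) : ℚ),((3 : ℤ) : ℚ)], (b ∈ order (-1) 3 ∨ b - ⟨1/2, 1/2, 1/2, -1/2⟩ ∈ order (-1) 3) ∧
            g * a = b * g) ∧
        0 < (g * star g).re ∧ (∃ s : ℚ, (g * star g).re = s ^ 2 ∨ (g * star g).re = 6 * s ^ 2) ∧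
        moebius (rho (-1) 3 (by norm_num) (castQ (-1) 3 g)) p.1 = q.1)
      (fun p q : {τ : ℂ // 0 < τ.im ∧ ∃ x : ℍ[ℚ,((-1 : ℤ) : ℚ),((3 : ℤ) : ℚ)],
        x ∈ order (-1) 3 ∧ x.re = 0 ∧ (x * star x).re = t ∧ moebius (rho (-1) 3 (by norm_num) (castQ (-1) 3 x)) τ = τ} ↦
      ∃ g : ℍ[ℚ,((-1 : ℤ) : ℚ),((3 : ℤ) : ℚ)], g ≠ 0 ∧
        (∀ a : ℍ[ℚ,((-1 : ℤ) : ℚ),((3 : ℤ) : ℚ)], (a ∈ order (-1) 3 ∨ a - ⟨1/2, 1/2, 1/2, -1/2⟩ ∈ order (-1) 3) →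
          ∃ b : ℍ[ℚ,((-1 : ℤ) : ℚ),((3 : ℤ) : ℚ)], (b ∈ order (-1) 3 ∨ b - ⟨1/2, 1/2, 1/2, -1/2⟩ ∈ order (-1) 3) ∧
            g * a = b * g) ∧
        0 < (g * star g).re ∧ moebius (rho (-1) 3 (by norm_num) (castQ (-1) 3 g)) p.1 = q.1)
      (specialPointsPlus_rel_of_atkinLehnerQuotient_rel t 6) b = Quot.mk _ p ↔
      (b = Quot.mk _ p ∨ b = Quot.mk _ (⟨moebius (rho (-1) 3 (by norm_num) (castQ (-1) 3 (⟨1, 1, 0, 0⟩ : ℍ[ℚ,((-1 : ℤ) : ℚ),((3 : ℤ) : ℚ)]))) p.1, moebius_w2_mem_specialPoints p.2.1 p.2.2⟩ : {τ : ℂ // 0 < τ.im ∧ ∃ x : ℍ[ℚ,((-1 : ℤ) : ℚ),((3 : ℤ) : ℚ)],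
        x ∈ order (-1) 3 ∧ x.re = 0 ∧ (x * star x).re = t ∧ moebius (rho (-1) 3 (by norm_num) (castQ (-1) 3 x)) τ = τ})) := by
    intro b
    induction b using Quot.ind with
    | _ p' => exact factorPlus_mk_eq_mk_iff_atkinLehnerQuotientSix p' p
  rw [(card_eq_one_iff_of_iff_eq_or_eq₂₂ hF).1, atkinLehnerQuotient_mk_eq_iff, atkinLehnerQuotientSix_rel_iff,
    ← normOne_moebius_w2_fixed_iff p.2.1, ← normOne_moebius_w6_w2_fixed_iff p]
  constructor
  · rintro ⟨v, hv, hv1, h | h⟩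
    · exact Or.inl ⟨v, hv, hv1, h⟩
    · exact Or.inr ⟨v, hv, hv1, h⟩
  · rintro (⟨v, hv, hv1, h⟩ | ⟨v, hv, hv1, h⟩)
    · exact ⟨v, hv, hv1, Or.inl h⟩
    · exact ⟨v, hv, hv1, Or.inr h⟩

/-- **TWO CLASSES IN THE FIBRE OF `X₆^{(6)} → X₆⁺`** away from `Z(1) ∪ Z(3)`. [cite: BayerTravesa2007, §2 p. 318 and §7] [cite: Ogg1983RealPoints, §2 (2)–(4)] -/
theorem card_plusFibre_atkinLehnerQuotientSix_eq_two_iff {t : ℤ} (p : {τ : ℂ // 0 < τ.im ∧ ∃ x : ℍ[ℚ,((-1 : ℤ) : ℚ),((3 : ℤ) : ℚ)],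
        x ∈ order (-1) 3 ∧ x.re = 0 ∧ (x * star x).re = t ∧ moebius (rho (-1) 3 (by norm_num) (castQ (-1) 3 x)) τ = τ}) :
    Nat.card {b : (Quot (fun p q : {τ : ℂ // 0 < τ.im ∧ ∃ x : ℍ[ℚ,((-1 : ℤ) : ℚ),((3 : ℤ) : ℚ)],
        x ∈ order (-1) 3 ∧ x.re = 0 ∧ (x * star x).re = t ∧ moebius (rho (-1) 3 (by norm_num) (castQ (-1) 3 x)) τ = τ} ↦
      ∃ g : ℍ[ℚ,((-1 : ℤ) : ℚ),((3 : ℤ) : ℚ)], g ≠ 0 ∧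
        (∀ a : ℍ[ℚ,((-1 : ℤ) : ℚ),((3 : ℤ) : ℚ)], (a ∈ order (-1) 3 ∨ a - ⟨1/2, 1/2, 1/2, -1/2⟩ ∈ order (-1) 3) →
          ∃ b : ℍ[ℚ,((-1 : ℤ) : ℚ),((3 : ℤ) : ℚ)], (b ∈ order (-1) 3 ∨ b - ⟨1/2, 1/2, 1/2, -1/2⟩ ∈ order (-1) 3) ∧
            g * a = b * g) ∧
        0 < (g * star g).re ∧ (∃ s : ℚ, (g * star g).re = s ^ 2 ∨ (g * star g).re = 6 * s ^ 2) ∧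
        moebius (rho (-1) 3 (by norm_num) (castQ (-1) 3 g)) p.1 = q.1)) //
      Quot.factor (fun p q : {τ : ℂ // 0 < τ.im ∧ ∃ x : ℍ[ℚ,((-1 : ℤ) : ℚ),((3 : ℤ) : ℚ)],
        x ∈ order (-1) 3 ∧ x.re = 0 ∧ (x * star x).re = t ∧ moebius (rho (-1) 3 (by norm_num) (castQ (-1) 3 x)) τ = τ} ↦
      ∃ g : ℍ[ℚ,((-1 : ℤ) : ℚ),((3 : ℤ) : ℚ)], g ≠ 0 ∧
        (∀ a : ℍ[ℚ,((-1 : ℤ) : ℚ),((3 : ℤ) : ℚ)], (a ∈ order (-1) 3 ∨ a - ⟨1/2, 1/2, 1/2, -1/2⟩ ∈ order (-1) 3) →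
          ∃ b : ℍ[ℚ,((-1 : ℤ) : ℚ),((3 : ℤ) : ℚ)], (b ∈ order (-1) 3 ∨ b - ⟨1/2, 1/2, 1/2, -1/2⟩ ∈ order (-1) 3) ∧
            g * a = b * g) ∧
        0 < (g * star g).re ∧ (∃ s : ℚ, (g * star g).re = s ^ 2 ∨ (g * star g).re = 6 * s ^ 2) ∧
        moebius (rho (-1) 3 (by norm_num) (castQ (-1) 3 g)) p.1 = q.1)
      (fun p q : {τ : ℂ // 0 < τ.im ∧ ∃ x : ℍ[ℚ,((-1 : ℤ) : ℚ),((3 : ℤ) : ℚ)],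
        x ∈ order (-1) 3 ∧ x.re = 0 ∧ (x * star x).re = t ∧ moebius (rho (-1) 3 (by norm_num) (castQ (-1) 3 x)) τ = τ} ↦
      ∃ g : ℍ[ℚ,((-1 : ℤ) : ℚ),((3 : ℤ) : ℚ)], g ≠ 0 ∧
        (∀ a : ℍ[ℚ,((-1 : ℤ) : ℚ),((3 : ℤ) : ℚ)], (a ∈ order (-1) 3 ∨ a - ⟨1/2, 1/2, 1/2, -1/2⟩ ∈ order (-1) 3) →
          ∃ b : ℍ[ℚ,((-1 : ℤ) : ℚ),((3 : ℤ) : ℚ)], (b ∈ order (-1) 3 ∨ b - ⟨1/2, 1/2, 1/2, -1/2⟩ ∈ order (-1) 3) ∧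
            g * a = b * g) ∧
        0 < (g * star g).re ∧ moebius (rho (-1) 3 (by norm_num) (castQ (-1) 3 g)) p.1 = q.1)
      (specialPointsPlus_rel_of_atkinLehnerQuotient_rel t 6) b = Quot.mk _ p} = 2 ↔
    ¬ ((∃ y : ℍ[ℚ,((-1 : ℤ) : ℚ),((3 : ℤ) : ℚ)], y ∈ order (-1) 3 ∧ y.re = 0 ∧ (y * star y).re = 1 ∧
        moebius (rho (-1) 3 (by norm_num) (castQ (-1) 3 y)) p.1 = p.1) ∨
      (∃ y : ℍ[ℚ,((-1 : ℤ) : ℚ),((3 : ℤ) : ℚ)], y ∈ order (-1) 3 ∧ y.re = 0 ∧ (y * star y).re = 3 ∧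
        moebius (rho (-1) 3 (by norm_num) (castQ (-1) 3 y)) p.1 = p.1)) := by
  have hF : ∀ b : (Quot (fun p q : {τ : ℂ // 0 < τ.im ∧ ∃ x : ℍ[ℚ,((-1 : ℤ) : ℚ),((3 : ℤ) : ℚ)],
        x ∈ order (-1) 3 ∧ x.re = 0 ∧ (x * star x).re = t ∧ moebius (rho (-1) 3 (by norm_num) (castQ (-1) 3 x)) τ = τ} ↦
      ∃ g : ℍ[ℚ,((-1 : ℤ) : ℚ),((3 : ℤ) : ℚ)], g ≠ 0 ∧
        (∀ a : ℍ[ℚ,((-1 : ℤ) : ℚ),((3 : ℤ) : ℚ)], (a ∈ order (-1) 3 ∨ a - ⟨1/2, 1/2, 1/2, -1/2⟩ ∈ order (-1) 3) →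
          ∃ b : ℍ[ℚ,((-1 : ℤ) : ℚ),((3 : ℤ) : ℚ)], (b ∈ order (-1) 3 ∨ b - ⟨1/2, 1/2, 1/2, -1/2⟩ ∈ order (-1) 3) ∧
            g * a = b * g) ∧
        0 < (g * star g).re ∧ (∃ s : ℚ, (g * star g).re = s ^ 2 ∨ (g * star g).re = 6 * s ^ 2) ∧
        moebius (rho (-1) 3 (by norm_num) (castQ (-1) 3 g)) p.1 = q.1)),
      Quot.factor (fun p q : {τ : ℂ // 0 < τ.im ∧ ∃ x : ℍ[ℚ,((-1 : ℤ) : ℚ),((3 : ℤ) : ℚ)],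
        x ∈ order (-1) 3 ∧ x.re = 0 ∧ (x * star x).re = t ∧ moebius (rho (-1) 3 (by norm_num) (castQ (-1) 3 x)) τ = τ} ↦
      ∃ g : ℍ[ℚ,((-1 : ℤ) : ℚ),((3 : ℤ) : ℚ)], g ≠ 0 ∧
        (∀ a : ℍ[ℚ,((-1 : ℤ) : ℚ),((3 : ℤ) : ℚ)], (a ∈ order (-1) 3 ∨ a - ⟨1/2, 1/2, 1/2, -1/2⟩ ∈ order (-1) 3) →
          ∃ b : ℍ[ℚ,((-1 : ℤ) : ℚ),((3 : ℤ) : ℚ)], (b ∈ order (-1) 3 ∨ b - ⟨1/2, 1/2, 1/2, -1/2⟩ ∈ order (-1) 3) ∧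
            g * a = b * g) ∧
        0 < (g * star g).re ∧ (∃ s : ℚ, (g * star g).re = s ^ 2 ∨ (g * star g).re = 6 * s ^ 2) ∧
        moebius (rho (-1) 3 (by norm_num) (castQ (-1) 3 g)) p.1 = q.1)
      (fun p q : {τ : ℂ // 0 < τ.im ∧ ∃ x : ℍ[ℚ,((-1 : ℤ) : ℚ),((3 : ℤ) : ℚ)],
        x ∈ order (-1) 3 ∧ x.re = 0 ∧ (x * star x).re = t ∧ moebius (rho (-1) 3 (by norm_num) (castQ (-1) 3 x)) τ = τ} ↦
      ∃ g : ℍ[ℚ,((-1 : ℤ) : ℚ),((3 : ℤ) : ℚ)], g ≠ 0 ∧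
        (∀ a : ℍ[ℚ,((-1 : ℤ) : ℚ),((3 : ℤ) : ℚ)], (a ∈ order (-1) 3 ∨ a - ⟨1/2, 1/2, 1/2, -1/2⟩ ∈ order (-1) 3) →
          ∃ b : ℍ[ℚ,((-1 : ℤ) : ℚ),((3 : ℤ) : ℚ)], (b ∈ order (-1) 3 ∨ b - ⟨1/2, 1/2, 1/2, -1/2⟩ ∈ order (-1) 3) ∧
            g * a = b * g) ∧
        0 < (g * star g).re ∧ moebius (rho (-1) 3 (by norm_num) (castQ (-1) 3 g)) p.1 = q.1)
      (specialPointsPlus_rel_of_atkinLehnerQuotient_rel t 6) b = Quot.mk _ p ↔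
      (b = Quot.mk _ p ∨ b = Quot.mk _ (⟨moebius (rho (-1) 3 (by norm_num) (castQ (-1) 3 (⟨1, 1, 0, 0⟩ : ℍ[ℚ,((-1 : ℤ) : ℚ),((3 : ℤ) : ℚ)]))) p.1, moebius_w2_mem_specialPoints p.2.1 p.2.2⟩ : {τ : ℂ // 0 < τ.im ∧ ∃ x : ℍ[ℚ,((-1 : ℤ) : ℚ),((3 : ℤ) : ℚ)],
        x ∈ order (-1) 3 ∧ x.re = 0 ∧ (x * star x).re = t ∧ moebius (rho (-1) 3 (by norm_num) (castQ (-1) 3 x)) τ = τ})) := by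
    intro b
    induction b using Quot.ind with
    | _ p' => exact factorPlus_mk_eq_mk_iff_atkinLehnerQuotientSix p' p
  rw [(card_eq_one_iff_of_iff_eq_or_eq₂₂ hF).2.1, ← card_plusFibre_atkinLehnerQuotientSix_eq_one_iff p,
    (card_eq_one_iff_of_iff_eq_or_eq₂₂ hF).1]

/-- Every fibre of `X₆^{(6)} → X₆⁺` on `Z(t)` has one or two classes (a double cover). [cite: BayerTravesa2007, §2 p. 318] [cite: Ogg1983RealPoints, §2 (2)–(4)] -/
theorem card_plusFibre_atkinLehnerQuotientSix_eq_one_or_eq_two {t : ℤ} (c : (Quot (fun p q : {τ : ℂ // 0 < τ.im ∧ ∃ x : ℍ[ℚ,((-1 : ℤ) : ℚ),((3 : ℤ) : ℚ)],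
        x ∈ order (-1) 3 ∧ x.re = 0 ∧ (x * star x).re = t ∧ moebius (rho (-1) 3 (by norm_num) (castQ (-1) 3 x)) τ = τ} ↦
      ∃ g : ℍ[ℚ,((-1 : ℤ) : ℚ),((3 : ℤ) : ℚ)], g ≠ 0 ∧
        (∀ a : ℍ[ℚ,((-1 : ℤ) : ℚ),((3 : ℤ) : ℚ)], (a ∈ order (-1) 3 ∨ a - ⟨1/2, 1/2, 1/2, -1/2⟩ ∈ order (-1) 3) →
          ∃ b : ℍ[ℚ,((-1 : ℤ) : ℚ),((3 : ℤ) : ℚ)], (b ∈ order (-1) 3 ∨ b - ⟨1/2, 1/2, 1/2, -1/2⟩ ∈ order (-1) 3) ∧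
            g * a = b * g) ∧
        0 < (g * star g).re ∧ moebius (rho (-1) 3 (by norm_num) (castQ (-1) 3 g)) p.1 = q.1))) :
    Nat.card {b : (Quot (fun p q : {τ : ℂ // 0 < τ.im ∧ ∃ x : ℍ[ℚ,((-1 : ℤ) : ℚ),((3 : ℤ) : ℚ)],
        x ∈ order (-1) 3 ∧ x.re = 0 ∧ (x * star x).re = t ∧ moebius (rho (-1) 3 (by norm_num) (castQ (-1) 3 x)) τ = τ} ↦
      ∃ g : ℍ[ℚ,((-1 : ℤ) : ℚ),((3 : ℤ) : ℚ)], g ≠ 0 ∧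
        (∀ a : ℍ[ℚ,((-1 : ℤ) : ℚ),((3 : ℤ) : ℚ)], (a ∈ order (-1) 3 ∨ a - ⟨1/2, 1/2, 1/2, -1/2⟩ ∈ order (-1) 3) →
          ∃ b : ℍ[ℚ,((-1 : ℤ) : ℚ),((3 : ℤ) : ℚ)], (b ∈ order (-1) 3 ∨ b - ⟨1/2, 1/2, 1/2, -1/2⟩ ∈ order (-1) 3) ∧
            g * a = b * g) ∧
        0 < (g * star g).re ∧ (∃ s : ℚ, (g * star g).re = s ^ 2 ∨ (g * star g).re = 6 * s ^ 2) ∧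
        moebius (rho (-1) 3 (by norm_num) (castQ (-1) 3 g)) p.1 = q.1)) //
      Quot.factor (fun p q : {τ : ℂ // 0 < τ.im ∧ ∃ x : ℍ[ℚ,((-1 : ℤ) : ℚ),((3 : ℤ) : ℚ)],
        x ∈ order (-1) 3 ∧ x.re = 0 ∧ (x * star x).re = t ∧ moebius (rho (-1) 3 (by norm_num) (castQ (-1) 3 x)) τ = τ} ↦
      ∃ g : ℍ[ℚ,((-1 : ℤ) : ℚ),((3 : ℤ) : ℚ)], g ≠ 0 ∧
        (∀ a : ℍ[ℚ,((-1 : ℤ) : ℚ),((3 : ℤ) : ℚ)], (a ∈ order (-1) 3 ∨ a - ⟨1/2, 1/2, 1/2, -1/2⟩ ∈ order (-1) 3) →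
          ∃ b : ℍ[ℚ,((-1 : ℤ) : ℚ),((3 : ℤ) : ℚ)], (b ∈ order (-1) 3 ∨ b - ⟨1/2, 1/2, 1/2, -1/2⟩ ∈ order (-1) 3) ∧
            g * a = b * g) ∧
        0 < (g * star g).re ∧ (∃ s : ℚ, (g * star g).re = s ^ 2 ∨ (g * star g).re = 6 * s ^ 2) ∧
        moebius (rho (-1) 3 (by norm_num) (castQ (-1) 3 g)) p.1 = q.1)
      (fun p q : {τ : ℂ // 0 < τ.im ∧ ∃ x : ℍ[ℚ,((-1 : ℤ) : ℚ),((3 : ℤ) : ℚ)],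
        x ∈ order (-1) 3 ∧ x.re = 0 ∧ (x * star x).re = t ∧ moebius (rho (-1) 3 (by norm_num) (castQ (-1) 3 x)) τ = τ} ↦
      ∃ g : ℍ[ℚ,((-1 : ℤ) : ℚ),((3 : ℤ) : ℚ)], g ≠ 0 ∧
        (∀ a : ℍ[ℚ,((-1 : ℤ) : ℚ),((3 : ℤ) : ℚ)], (a ∈ order (-1) 3 ∨ a - ⟨1/2, 1/2, 1/2, -1/2⟩ ∈ order (-1) 3) →
          ∃ b : ℍ[ℚ,((-1 : ℤ) : ℚ),((3 : ℤ) : ℚ)], (b ∈ order (-1) 3 ∨ b - ⟨1/2, 1/2, 1/2, -1/2⟩ ∈ order (-1) 3) ∧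
            g * a = b * g) ∧
        0 < (g * star g).re ∧ moebius (rho (-1) 3 (by norm_num) (castQ (-1) 3 g)) p.1 = q.1)
      (specialPointsPlus_rel_of_atkinLehnerQuotient_rel t 6) b = c} = 1 ∨
    Nat.card {b : (Quot (fun p q : {τ : ℂ // 0 < τ.im ∧ ∃ x : ℍ[ℚ,((-1 : ℤ) : ℚ),((3 : ℤ) : ℚ)],
        x ∈ order (-1) 3 ∧ x.re = 0 ∧ (x * star x).re = t ∧ moebius (rho (-1) 3 (by norm_num) (castQ (-1) 3 x)) τ = τ} ↦
      ∃ g : ℍ[ℚ,((-1 : ℤ) : ℚ),((3 : ℤ) : ℚ)], g ≠ 0 ∧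
        (∀ a : ℍ[ℚ,((-1 : ℤ) : ℚ),((3 : ℤ) : ℚ)], (a ∈ order (-1) 3 ∨ a - ⟨1/2, 1/2, 1/2, -1/2⟩ ∈ order (-1) 3) →
          ∃ b : ℍ[ℚ,((-1 : ℤ) : ℚ),((3 : ℤ) : ℚ)], (b ∈ order (-1) 3 ∨ b - ⟨1/2, 1/2, 1/2, -1/2⟩ ∈ order (-1) 3) ∧
            g * a = b * g) ∧
        0 < (g * star g).re ∧ (∃ s : ℚ, (g * star g).re = s ^ 2 ∨ (g * star g).re = 6 * s ^ 2) ∧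
        moebius (rho (-1) 3 (by norm_num) (castQ (-1) 3 g)) p.1 = q.1)) //
      Quot.factor (fun p q : {τ : ℂ // 0 < τ.im ∧ ∃ x : ℍ[ℚ,((-1 : ℤ) : ℚ),((3 : ℤ) : ℚ)],
        x ∈ order (-1) 3 ∧ x.re = 0 ∧ (x * star x).re = t ∧ moebius (rho (-1) 3 (by norm_num) (castQ (-1) 3 x)) τ = τ} ↦
      ∃ g : ℍ[ℚ,((-1 : ℤ) : ℚ),((3 : ℤ) : ℚ)], g ≠ 0 ∧
        (∀ a : ℍ[ℚ,((-1 : ℤ) : ℚ),((3 : ℤ) : ℚ)], (a ∈ order (-1) 3 ∨ a - ⟨1/2, 1/2, 1/2, -1/2⟩ ∈ order (-1) 3) →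
          ∃ b : ℍ[ℚ,((-1 : ℤ) : ℚ),((3 : ℤ) : ℚ)], (b ∈ order (-1) 3 ∨ b - ⟨1/2, 1/2, 1/2, -1/2⟩ ∈ order (-1) 3) ∧
            g * a = b * g) ∧
        0 < (g * star g).re ∧ (∃ s : ℚ, (g * star g).re = s ^ 2 ∨ (g * star g).re = 6 * s ^ 2) ∧
        moebius (rho (-1) 3 (by norm_num) (castQ (-1) 3 g)) p.1 = q.1)
      (fun p q : {τ : ℂ // 0 < τ.im ∧ ∃ x : ℍ[ℚ,((-1 : ℤ) : ℚ),((3 : ℤ) : ℚ)],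
        x ∈ order (-1) 3 ∧ x.re = 0 ∧ (x * star x).re = t ∧ moebius (rho (-1) 3 (by norm_num) (castQ (-1) 3 x)) τ = τ} ↦
      ∃ g : ℍ[ℚ,((-1 : ℤ) : ℚ),((3 : ℤ) : ℚ)], g ≠ 0 ∧
        (∀ a : ℍ[ℚ,((-1 : ℤ) : ℚ),((3 : ℤ) : ℚ)], (a ∈ order (-1) 3 ∨ a - ⟨1/2, 1/2, 1/2, -1/2⟩ ∈ order (-1) 3) →
          ∃ b : ℍ[ℚ,((-1 : ℤ) : ℚ),((3 : ℤ) : ℚ)], (b ∈ order (-1) 3 ∨ b - ⟨1/2, 1/2, 1/2, -1/2⟩ ∈ order (-1) 3) ∧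
            g * a = b * g) ∧
        0 < (g * star g).re ∧ moebius (rho (-1) 3 (by norm_num) (castQ (-1) 3 g)) p.1 = q.1)
      (specialPointsPlus_rel_of_atkinLehnerQuotient_rel t 6) b = c} = 2 := by
  induction c using Quot.ind with
  | _ p =>
    have hF : ∀ b : (Quot (fun p q : {τ : ℂ // 0 < τ.im ∧ ∃ x : ℍ[ℚ,((-1 : ℤ) : ℚ),((3 : ℤ) : ℚ)],
        x ∈ order (-1) 3 ∧ x.re = 0 ∧ (x * star x).re = t ∧ moebius (rho (-1) 3 (by norm_num) (castQ (-1) 3 x)) τ = τ} ↦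
      ∃ g : ℍ[ℚ,((-1 : ℤ) : ℚ),((3 : ℤ) : ℚ)], g ≠ 0 ∧
        (∀ a : ℍ[ℚ,((-1 : ℤ) : ℚ),((3 : ℤ) : ℚ)], (a ∈ order (-1) 3 ∨ a - ⟨1/2, 1/2, 1/2, -1/2⟩ ∈ order (-1) 3) →
          ∃ b : ℍ[ℚ,((-1 : ℤ) : ℚ),((3 : ℤ) : ℚ)], (b ∈ order (-1) 3 ∨ b - ⟨1/2, 1/2, 1/2, -1/2⟩ ∈ order (-1) 3) ∧
            g * a = b * g) ∧
        0 < (g * star g).re ∧ (∃ s : ℚ, (g * star g).re = s ^ 2 ∨ (g * star g).re = 6 * s ^ 2) ∧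
        moebius (rho (-1) 3 (by norm_num) (castQ (-1) 3 g)) p.1 = q.1)),
        Quot.factor (fun p q : {τ : ℂ // 0 < τ.im ∧ ∃ x : ℍ[ℚ,((-1 : ℤ) : ℚ),((3 : ℤ) : ℚ)],
        x ∈ order (-1) 3 ∧ x.re = 0 ∧ (x * star x).re = t ∧ moebius (rho (-1) 3 (by norm_num) (castQ (-1) 3 x)) τ = τ} ↦
      ∃ g : ℍ[ℚ,((-1 : ℤ) : ℚ),((3 : ℤ) : ℚ)], g ≠ 0 ∧
        (∀ a : ℍ[ℚ,((-1 : ℤ) : ℚ),((3 : ℤ) : ℚ)], (a ∈ order (-1) 3 ∨ a - ⟨1/2, 1/2, 1/2, -1/2⟩ ∈ order (-1) 3) →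
          ∃ b : ℍ[ℚ,((-1 : ℤ) : ℚ),((3 : ℤ) : ℚ)], (b ∈ order (-1) 3 ∨ b - ⟨1/2, 1/2, 1/2, -1/2⟩ ∈ order (-1) 3) ∧
            g * a = b * g) ∧
        0 < (g * star g).re ∧ (∃ s : ℚ, (g * star g).re = s ^ 2 ∨ (g * star g).re = 6 * s ^ 2) ∧
        moebius (rho (-1) 3 (by norm_num) (castQ (-1) 3 g)) p.1 = q.1)
      (fun p q : {τ : ℂ // 0 < τ.im ∧ ∃ x : ℍ[ℚ,((-1 : ℤ) : ℚ),((3 : ℤ) : ℚ)],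
        x ∈ order (-1) 3 ∧ x.re = 0 ∧ (x * star x).re = t ∧ moebius (rho (-1) 3 (by norm_num) (castQ (-1) 3 x)) τ = τ} ↦
      ∃ g : ℍ[ℚ,((-1 : ℤ) : ℚ),((3 : ℤ) : ℚ)], g ≠ 0 ∧
        (∀ a : ℍ[ℚ,((-1 : ℤ) : ℚ),((3 : ℤ) : ℚ)], (a ∈ order (-1) 3 ∨ a - ⟨1/2, 1/2, 1/2, -1/2⟩ ∈ order (-1) 3) →
          ∃ b : ℍ[ℚ,((-1 : ℤ) : ℚ),((3 : ℤ) : ℚ)], (b ∈ order (-1) 3 ∨ b - ⟨1/2, 1/2, 1/2, -1/2⟩ ∈ order (-1) 3) ∧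
            g * a = b * g) ∧
        0 < (g * star g).re ∧ moebius (rho (-1) 3 (by norm_num) (castQ (-1) 3 g)) p.1 = q.1)
      (specialPointsPlus_rel_of_atkinLehnerQuotient_rel t 6) b = Quot.mk _ p ↔
        (b = Quot.mk _ p ∨ b = Quot.mk _ (⟨moebius (rho (-1) 3 (by norm_num) (castQ (-1) 3 (⟨1, 1, 0, 0⟩ : ℍ[ℚ,((-1 : ℤ) : ℚ),((3 : ℤ) : ℚ)]))) p.1, moebius_w2_mem_specialPoints p.2.1 p.2.2⟩ : {τ : ℂ // 0 < τ.im ∧ ∃ x : ℍ[ℚ,((-1 : ℤ) : ℚ),((3 : ℤ) : ℚ)],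
        x ∈ order (-1) 3 ∧ x.re = 0 ∧ (x * star x).re = t ∧ moebius (rho (-1) 3 (by norm_num) (castQ (-1) 3 x)) τ = τ})) := by
      intro b
      induction b using Quot.ind with
      | _ p' => exact factorPlus_mk_eq_mk_iff_atkinLehnerQuotientSix p' p
    exact (card_eq_one_iff_of_iff_eq_or_eq₂₂ hF).2.2

/-- **CLASS EQUATION OF `X₆^{(6)} → X₆⁺` ON `Z(t)`** (`t > 0`): `#(Pt(t)/Γ₆^{(6)}) + #{one-class fibres} = 2·#(Pt(t)/Γ₆⁺)`.
[cite: BayerTravesa2007, §2 p. 318 and §7] [cite: Ogg1983RealPoints, §2 (3)–(4)] -/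
theorem card_atkinLehnerQuotientSix_add_card_onePlusFibres_eq_two_mul_card_specialPointsPlus {t : ℤ} (ht : 0 < t) :
    Nat.card (Quot (fun p q : {τ : ℂ // 0 < τ.im ∧ ∃ x : ℍ[ℚ,((-1 : ℤ) : ℚ),((3 : ℤ) : ℚ)],
        x ∈ order (-1) 3 ∧ x.re = 0 ∧ (x * star x).re = t ∧ moebius (rho (-1) 3 (by norm_num) (castQ (-1) 3 x)) τ = τ} ↦
      ∃ g : ℍ[ℚ,((-1 : ℤ) : ℚ),((3 : ℤ) : ℚ)], g ≠ 0 ∧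
        (∀ a : ℍ[ℚ,((-1 : ℤ) : ℚ),((3 : ℤ) : ℚ)], (a ∈ order (-1) 3 ∨ a - ⟨1/2, 1/2, 1/2, -1/2⟩ ∈ order (-1) 3) →
          ∃ b : ℍ[ℚ,((-1 : ℤ) : ℚ),((3 : ℤ) : ℚ)], (b ∈ order (-1) 3 ∨ b - ⟨1/2, 1/2, 1/2, -1/2⟩ ∈ order (-1) 3) ∧
            g * a = b * g) ∧
        0 < (g * star g).re ∧ (∃ s : ℚ, (g * star g).re = s ^ 2 ∨ (g * star g).re = 6 * s ^ 2) ∧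
        moebius (rho (-1) 3 (by norm_num) (castQ (-1) 3 g)) p.1 = q.1)) +
    Nat.card {c : (Quot (fun p q : {τ : ℂ // 0 < τ.im ∧ ∃ x : ℍ[ℚ,((-1 : ℤ) : ℚ),((3 : ℤ) : ℚ)],
        x ∈ order (-1) 3 ∧ x.re = 0 ∧ (x * star x).re = t ∧ moebius (rho (-1) 3 (by norm_num) (castQ (-1) 3 x)) τ = τ} ↦
      ∃ g : ℍ[ℚ,((-1 : ℤ) : ℚ),((3 : ℤ) : ℚ)], g ≠ 0 ∧
        (∀ a : ℍ[ℚ,((-1 : ℤ) : ℚ),((3 : ℤ) : ℚ)], (a ∈ order (-1) 3 ∨ a - ⟨1/2, 1/2, 1/2, -1/2⟩ ∈ order (-1) 3) →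
          ∃ b : ℍ[ℚ,((-1 : ℤ) : ℚ),((3 : ℤ) : ℚ)], (b ∈ order (-1) 3 ∨ b - ⟨1/2, 1/2, 1/2, -1/2⟩ ∈ order (-1) 3) ∧
            g * a = b * g) ∧
        0 < (g * star g).re ∧ moebius (rho (-1) 3 (by norm_num) (castQ (-1) 3 g)) p.1 = q.1)) //
      Nat.card {b : (Quot (fun p q : {τ : ℂ // 0 < τ.im ∧ ∃ x : ℍ[ℚ,((-1 : ℤ) : ℚ),((3 : ℤ) : ℚ)],
        x ∈ order (-1) 3 ∧ x.re = 0 ∧ (x * star x).re = t ∧ moebius (rho (-1) 3 (by norm_num) (castQ (-1) 3 x)) τ = τ} ↦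
      ∃ g : ℍ[ℚ,((-1 : ℤ) : ℚ),((3 : ℤ) : ℚ)], g ≠ 0 ∧
        (∀ a : ℍ[ℚ,((-1 : ℤ) : ℚ),((3 : ℤ) : ℚ)], (a ∈ order (-1) 3 ∨ a - ⟨1/2, 1/2, 1/2, -1/2⟩ ∈ order (-1) 3) →
          ∃ b : ℍ[ℚ,((-1 : ℤ) : ℚ),((3 : ℤ) : ℚ)], (b ∈ order (-1) 3 ∨ b - ⟨1/2, 1/2, 1/2, -1/2⟩ ∈ order (-1) 3) ∧
            g * a = b * g) ∧
        0 < (g * star g).re ∧ (∃ s : ℚ, (g * star g).re = s ^ 2 ∨ (g * star g).re = 6 * s ^ 2) ∧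
        moebius (rho (-1) 3 (by norm_num) (castQ (-1) 3 g)) p.1 = q.1)) //
        Quot.factor (fun p q : {τ : ℂ // 0 < τ.im ∧ ∃ x : ℍ[ℚ,((-1 : ℤ) : ℚ),((3 : ℤ) : ℚ)],
        x ∈ order (-1) 3 ∧ x.re = 0 ∧ (x * star x).re = t ∧ moebius (rho (-1) 3 (by norm_num) (castQ (-1) 3 x)) τ = τ} ↦
      ∃ g : ℍ[ℚ,((-1 : ℤ) : ℚ),((3 : ℤ) : ℚ)], g ≠ 0 ∧
        (∀ a : ℍ[ℚ,((-1 : ℤ) : ℚ),((3 : ℤ) : ℚ)], (a ∈ order (-1) 3 ∨ a - ⟨1/2, 1/2, 1/2, -1/2⟩ ∈ order (-1) 3) →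
          ∃ b : ℍ[ℚ,((-1 : ℤ) : ℚ),((3 : ℤ) : ℚ)], (b ∈ order (-1) 3 ∨ b - ⟨1/2, 1/2, 1/2, -1/2⟩ ∈ order (-1) 3) ∧
            g * a = b * g) ∧
        0 < (g * star g).re ∧ (∃ s : ℚ, (g * star g).re = s ^ 2 ∨ (g * star g).re = 6 * s ^ 2) ∧
        moebius (rho (-1) 3 (by norm_num) (castQ (-1) 3 g)) p.1 = q.1)
      (fun p q : {τ : ℂ // 0 < τ.im ∧ ∃ x : ℍ[ℚ,((-1 : ℤ) : ℚ),((3 : ℤ) : ℚ)],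
        x ∈ order (-1) 3 ∧ x.re = 0 ∧ (x * star x).re = t ∧ moebius (rho (-1) 3 (by norm_num) (castQ (-1) 3 x)) τ = τ} ↦
      ∃ g : ℍ[ℚ,((-1 : ℤ) : ℚ),((3 : ℤ) : ℚ)], g ≠ 0 ∧
        (∀ a : ℍ[ℚ,((-1 : ℤ) : ℚ),((3 : ℤ) : ℚ)], (a ∈ order (-1) 3 ∨ a - ⟨1/2, 1/2, 1/2, -1/2⟩ ∈ order (-1) 3) →
          ∃ b : ℍ[ℚ,((-1 : ℤ) : ℚ),((3 : ℤ) : ℚ)], (b ∈ order (-1) 3 ∨ b - ⟨1/2, 1/2, 1/2, -1/2⟩ ∈ order (-1) 3) ∧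
            g * a = b * g) ∧
        0 < (g * star g).re ∧ moebius (rho (-1) 3 (by norm_num) (castQ (-1) 3 g)) p.1 = q.1)
      (specialPointsPlus_rel_of_atkinLehnerQuotient_rel t 6) b = c} = 1} =
    2 * Nat.card (Quot (fun p q : {τ : ℂ // 0 < τ.im ∧ ∃ x : ℍ[ℚ,((-1 : ℤ) : ℚ),((3 : ℤ) : ℚ)],
        x ∈ order (-1) 3 ∧ x.re = 0 ∧ (x * star x).re = t ∧ moebius (rho (-1) 3 (by norm_num) (castQ (-1) 3 x)) τ = τ} ↦
      ∃ g : ℍ[ℚ,((-1 : ℤ) : ℚ),((3 : ℤ) : ℚ)], g ≠ 0 ∧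
        (∀ a : ℍ[ℚ,((-1 : ℤ) : ℚ),((3 : ℤ) : ℚ)], (a ∈ order (-1) 3 ∨ a - ⟨1/2, 1/2, 1/2, -1/2⟩ ∈ order (-1) 3) →
          ∃ b : ℍ[ℚ,((-1 : ℤ) : ℚ),((3 : ℤ) : ℚ)], (b ∈ order (-1) 3 ∨ b - ⟨1/2, 1/2, 1/2, -1/2⟩ ∈ order (-1) 3) ∧
            g * a = b * g) ∧
        0 < (g * star g).re ∧ moebius (rho (-1) 3 (by norm_num) (castQ (-1) 3 g)) p.1 = q.1)) := by
  haveI := finite_atkinLehnerQuotient ht 6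
  haveI := finite_specialPointsPlus ht
  exact card_add_card_eq_two_mul₂₂ _ card_plusFibre_atkinLehnerQuotientSix_eq_one_or_eq_two

end PlusFibres

end Literature.Geometry.Kaehler.ComplexTorus.QuaternionType
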